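import Mathlib

/-!
# Klainerman–Szeftel, *Kerr stability for small angular momentum*: the set-up, typed
# (parameters, constants, regions, frames, the vocabulary `Γ`, norms, GCM predicates, bootstrap sets; the GKS `τ`-set-up; the PT layer; the GCM-sphere vocabulary)

CITATION HEADER (lean-in-tree rule 2026-08-18). This module is a TYPED SKELETON — the objects every displayed statement of the
following published papers quantifies over, typed schematically but consistently so that statement SHAPES can be written against them:

* S. Klainerman, J. Szeftel, *Kerr stability for small angular momentum*, arXiv:2104.11857 (v1, 2021) = bib key
  `KlainermanSzeftel2021`; journal version Pure Appl. Math. Q. **19** (2023) no. 3, 791–1678, doi:10.4310/pamq.2023.v19.n3.a1 =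
  bib key `KlainermanSzeftel2023` (the refereed record). The text reproduced is the arXiv e-print; `TeX l.N` in the tags below are
  line numbers of its TeX source `Main-Kerr-arxiv.tex`. The journal version was not separately read for this module.
* E. Giorgi, S. Klainerman, J. Szeftel, *Wave equations estimates and the nonlinear stability of slowly rotating Kerr black holes*,
  arXiv:2205.14808 (v1, 2022) = bib key `GiorgiKlainermanSzeftel2022`; journal version Pure Appl. Math. Q. **20** (2024) no. 7,
  2865–3849, doi:10.4310/pamq.241128023033 = bib key `GiorgiKlainermanSzeftel2024` (refereed record). `TeX l.N` for this key refer
  to its TeX source `FinalKerrarxivversion.tex` (arXiv v1). Used for §14 (the spacetimes with a time function `τ` and the Part II /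
  Part III norms) and for the tables `Table.ΓgGKS/ΓbGKS`.
* Companion texts NAMED in docstrings, never used as facts: S. Klainerman, J. Szeftel, arXiv:1911.00697 ("GCM1") and arXiv:1912.12195
  ("GCM2") (both Ann. PDE 8 (2022)); D. Shen, arXiv:2205.12336 = bib key `Shen2023GCM`; the review of these in KS §8.1 is what §16 types.

WHAT IS REPRODUCED, and in what sense. KS chapter 2–3 (§2.4 Kerr parameters; §3.4.1 the smallness constants and their hierarchy; the
names of the linearized Ricci / curvature / metric quantities `Γ_g, Γ_b` of the outgoing / ingoing PG structures and of `Σ_*` (tables of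
§2.8, §3.3); §3.2 GCM admissible spacetimes `𝓜 = (ext)𝓜 ∪ (int)𝓜 ∪ (top)𝓜` with their boundaries, foliations `u, u̲, r`, the GCM
conditions on `Σ_*` and the definition of `(a, m)`; §3.3 the main norms `^*𝔅_k, ^*𝔇_k, ^(ext)𝔅_k, …, 𝔑^(En)_k, 𝔑^(Dec)_k`; §3.5 the
bootstrap assumptions and the set `ℵ(u_*)`; §3.1/§3.3.7 the initial data layer and `ℑ_k`; §3.4 the limiting spacetimes `𝓜_∞`; the
displayed left-hand sides of Theorems M0–M2 (§3.7.1); §9.2.3/§9.4 the PT structures and PT norms; §8.1 the GCM-procedure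
vocabulary = the setting of GCM1/GCM2/Shen as reviewed there) and GKS §1.4–1.5 / §3 (the `τ`-foliated spacetimes, trapping set,
regions, and the Part II / Part III norms) are typed at the level of OBJECTS and NORMS: events are a bare measurable type, every
tensorial quantity enters only through the pointwise sizes `|𝔡^{≤k} ψ| ∈ [0, ∞]` of its jets (`FrameData`, `GField`, `SFrame`), norms are
`⨆` / `∫⁻` expressions valued in `ℝ≥0∞`, and the physics (Einstein vacuum, the construction of the foliations, the null-structure
equations) is NOT modelled — a realized spacetime is an INPUT wherever used. Every `def … : Prop` below is a PREDICATE over such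
data (a statement shape / a definition transcribed from a display of the paper), never an asserted fact: NAMED-FACT SEMANTICS DO NOT
APPLY and no `_holds` discharge is expected; the `[cite: …]` tags record PROVENANCE (which display is transcribed, with the TeX line),
`[folklore]` marks schematic helpers (weights, builders, order-theoretic bookkeeping). What IS proved (zero `sorry`, axioms ⊆ {propext,
Classical.choice, Quot.sound}) is bookkeeping only: monotonicity of the norms in the derivative index, set identities of the regions,
`isSubextremal_of_isSlowlyRotating` (`|a| ≤ ε₀ m`, `ε₀ < 1` ⇒ `|a| < m`), comparisons between regional and combined norms.

STATUS OF THE SOURCE. KS and GKS are refereed publications; this module neither re-proves nor disputes any analytic estimate. It was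
written by the audit cell `pub-kerr` (Final State Conjecture near-miss cell 6: typed skeleton + `|a| ≪ M` census of the Klainerman–Szeftel /
Giorgi–Klainerman–Szeftel proof), whose rule is that the manuscripts under audit enter only as explicit hypotheses over data — the
GKS-dependent steps of the KS architecture are hypothesis nodes elsewhere (`…KlainermanSzeftel2021.Bootstrap`), and nothing here is cited
as establishing them. Every typing simplification is recorded in the cell's DIVERGENCE.md (DV-01 … DV-18, SRC-01 … SRC-08); the ones a
reader must know: (DV-01) schematic carrier; (DV-03) norms in `ℝ≥0∞` (no junk real suprema); (DV-09) `𝔡^{≤k}` = cumulative jets, Sobolev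
sums read as one norm of the cumulative jet; (DV-10) `k − 1` is truncated subtraction; (DV-13) displayed `≲` = explicit constants;
(DV-16/17) GKS signed pairings and the `∇_R̂` term are opaque arguments; (DV-18) coordinate charts, **A3**, **A4**, frame adaptedness and
basis calibration of the GCM procedure are not modelled (opaque `Prop` fields / data); (SRC-06/07/08) source remarks typed verbatim.

RELATION TO EXISTING TREE MATERIAL (reviewers please note). `Literature.Geometry.Lorentzian.klainerman_szeftel_kerr_stability_small_a_cauchy`
(`StabilityCauchy.lean`) is the paper's END-STATEMENT as a named fact over `InitialDataSet` / `VacuumCauchyDevelopment`;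
`SubextremalKerrStabilityConjecture` (`Stability.lean`) is the summit-side conjecture; the tree's Kerr files (`Kerr*.lean`) carry the
exact Kerr geometry. This module claims NO relation to any of them: its `KerrParams` is a bookkeeping pair `(m, a)` with `m > 0` local to
this namespace (not the tree's Kerr metric data), its spacetimes are schematic carriers, and no statement here restates, weakens or
strengthens a tree statement. Sibling module: `…KlainermanSzeftel2021.Bootstrap` (the bootstrap architecture over an abstract `Setting`;
the cell's staged `Bridge.lean` instantiates that `Setting` from the objects below).

NOT HERE (deliberately): the Kerr metric and the realized geometry; the PG/PT structures as tensors; the null-structure / Bianchi /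
Teukolsky equations; any estimate of KS/GKS; the construction of `τ`, of the PT structures, of GCM spheres / hypersurfaces (all INPUTS).
-/

open scoped ENNReal NNReal
open MeasureTheory Set

noncomputable section

namespace Literature.Geometry.Lorentzian.KlainermanSzeftel2021.Setup

/-! ## §1. Kerr parameters `(m, a)` and the explicit smallness parameter

[KS §2.4.1, TeX l.2880–2899]: `q = r + i a cos θ`, `Δ = r² − 2mr + a²`, `Σ² = (r²+a²)² − a² sin²θ Δ`,
`r₊ = m + √(m² − a²)` (l.2899); [GKS TeX l.1431]: `𝒯 = r³ − 3mr² + a²r + ma²` (trapping polynomial). -/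

/-- A pair of Kerr parameters: mass `m > 0` and specific angular momentum `a` ([KS] §2.4.1, l.2880–2899). [cite: KlainermanSzeftel2021, TeX l.2880–2899] -/
structure KerrParams where
  /-- the mass `m` -/
  m : ℝ
  /-- the angular momentum per unit mass `a` -/
  a : ℝ
  m_pos : 0 < m

namespace KerrParams

variable (p : KerrParams)

/-- Sub-extremality `|a| < m` ([KS] l.6056 "`m_0>0` and `|a_0|<m_0`"). [cite: KlainermanSzeftel2021, TeX l.6056] -/
def IsSubextremal (p : KerrParams) : Prop := |p.a| < p.m

/-- **The explicit smallness parameter.** `p.IsSlowlyRotating 𝔞` means `|a| ≤ 𝔞 · m`. Every use of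
"`|a|/m` sufficiently small" / "`|a| ≪ m`" in [KS]/[GKS] is typed as `∃ 𝔞 > 0, ∀ p, p.IsSlowlyRotating 𝔞 → …`
with the position of `∃ 𝔞` in the quantifier prefix made explicit (see `Constants.Hierarchy` and ADEP.md); the source's form is
"`|a|/m` sufficiently small" in the Main Theorem ([KS] l.6196–6240). [cite: KlainermanSzeftel2021, TeX l.6196–6240] -/
def IsSlowlyRotating (𝔞 : ℝ) : Prop := |p.a| ≤ 𝔞 * p.m

/-- `r₊ = m + √(m² − a²)`, the event-horizon radius ([KS] l.2899). [cite: KlainermanSzeftel2021, TeX l.2899] -/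
def rPlus : ℝ := p.m + Real.sqrt (p.m ^ 2 - p.a ^ 2)

/-- `r₋ = m − √(m² − a²)` ([KS] l.2899). [cite: KlainermanSzeftel2021, TeX l.2899] -/
def rMinus : ℝ := p.m - Real.sqrt (p.m ^ 2 - p.a ^ 2)

/-- `Δ(r) = r² − 2mr + a²` ([KS] l.2884–2899). [cite: KlainermanSzeftel2021, TeX l.2884–2899] -/
def Delta (r : ℝ) : ℝ := r ^ 2 - 2 * p.m * r + p.a ^ 2

/-- `q = r + i a cos θ` as a function of `(r, cos θ)` ([KS] l.2884–2899). [cite: KlainermanSzeftel2021, TeX l.2884–2899] -/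
def q (r cosθ : ℝ) : ℂ := (r : ℂ) + (p.a * cosθ : ℝ) * Complex.I

/-- `|q|² = r² + a² cos²θ` ([KS] l.2880–2885). [cite: KlainermanSzeftel2021, TeX l.2880–2885] -/
def qNormSq (r cosθ : ℝ) : ℝ := r ^ 2 + p.a ^ 2 * cosθ ^ 2

/-- `Σ² = (r² + a²)² − a² sin²θ Δ` ([KS] l.2885). [cite: KlainermanSzeftel2021, TeX l.2885] -/
def SigmaSq (r sinθ : ℝ) : ℝ := (r ^ 2 + p.a ^ 2) ^ 2 - p.a ^ 2 * sinθ ^ 2 * p.Delta r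

/-- `Υ = 1 − 2m/r`, the Schwarzschild factor of the `Σ_*`-linearizations ([KS] l.5672–5685,
`\lab{def:renormalizedquantitiesGCMfoliationofSigma*}`). [cite: KlainermanSzeftel2021, TeX l.5672–5685] -/
def Upsilon (r : ℝ) : ℝ := 1 - 2 * p.m / r

/-- The trapping polynomial `𝒯 = r³ − 3mr² + a²r + ma²` of [GKS] (definition of `𝓜_trap`, TeX l.1431). [cite: GiorgiKlainermanSzeftel2022, TeX l.1431] -/
def trapPoly (r : ℝ) : ℝ := r ^ 3 - 3 * p.m * r ^ 2 + p.a ^ 2 * r + p.m * p.a ^ 2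

/-- Sanity: a slowly rotating pair with `𝔞 < 1` is sub-extremal (pure arithmetic; NOT a quoted result). [folklore] -/
theorem isSubextremal_of_isSlowlyRotating {𝔞 : ℝ} (h𝔞 : 𝔞 < 1) (h : p.IsSlowlyRotating 𝔞) :
    p.IsSubextremal := by
  unfold IsSlowlyRotating at h
  unfold IsSubextremal
  have hm := p.m_pos
  calc |p.a| ≤ 𝔞 * p.m := h
    _ < 1 * p.m := by exact mul_lt_mul_of_pos_right h𝔞 hm
    _ = p.m := one_mul _

end KerrParams

/-! ## §2. The fundamental constants and their hierarchy

[KS §3.4.1 "Smallness constants", TeX l.6050–6120, `\lab{sec:discussionofsmallnessconstantforthemaintheorem}`]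
(and [GKS §1.5.1, TeX l.1675–1712]): `m₀ > 0`, `|a₀| < m₀`; `k_large`; `ε₀` (initial layer), `ε` (bootstrap);
`r₀` (`𝒯 = {r = r₀}`); `δ_ℋ` (redshift region / `𝓐`); `δ_dec` (decay loss); `δ_B` (extra `r`-power for `α, β`);
`δ_*` (dominance condition, l.6104 `\lab{eq:behaviorofronS-star}`); `k_small = ⌊k_large/2⌋ + 1` (l.6110
`\lab{eq:choiceksmallmaintheorem}`); `ε = ε₀^{2/3}` (l.6090 `\lab{eq:constraintbetweenepep*ep0}`). -/

/-- The fundamental constants of [KS §3.4.1, l.6050–6120]. The `≪`/`≫` relations among them are NOT built in: they are the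
separate predicates `Constants.Exact` (the genuine equalities / strict inequalities) and `Constants.Regime K`
(the schematic reading of `A ≪ B` as `K · A ≤ B` for a threshold `K` chosen by the theorem being stated). [cite: KlainermanSzeftel2021, TeX l.6050–6120] -/
structure Constants where
  /-- `(m₀, a₀)`: the Kerr solution relative to which the initial perturbation is measured -/
  init : KerrParams
  /-- `ε₀ > 0`: size of the initial data layer norm (`ℑ_{k_large+10} ≤ ε₀²`, l.6211 `\lab{def:initialdatalayerassumptions}`) -/
  ε₀ : ℝ
  /-- `ε > 0`: size of the bootstrap norms (BA-B l.6354, BA-D l.6361) -/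
  ε : ℝ
  /-- `δ_ℋ`: width of the redshift region `|r − m₀ − √(m₀²−a₀²)| ≤ 2m₀δ_ℋ` (l.6065); `𝓐 = {(int)r = (m₀ + √(m₀²−a₀²))(1 − δ_ℋ)}` (l.5331) -/
  δH : ℝ
  /-- `δ_dec`: loss in the `u`, `ū` (`τ`) decay rates `u^{-1-δ_dec}`, `u^{-1/2-δ_dec}` -/
  δdec : ℝ
  /-- `δ_B`: extra power `r^{δ_B/2}` in the sup norms of high derivatives of `α, β` (`δ_B > 2δ_dec`) -/
  δB : ℝ
  /-- `δ_*`: dominance condition `r_* = δ_* ε₀⁻¹ u_*^{1+δ_dec}` on `S_*` (l.6104 `\lab{eq:behaviorofronS-star}`) -/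
  δstar : ℝ
  /-- `r₀`: the timelike hypersurface `𝒯 = {(ext)r = r₀} = (ext)𝓜 ∩ (int)𝓜` (l.5305) -/
  r₀ : ℝ
  /-- `k_large`: maximum number of derivatives (l.6058) -/
  kLarge : ℕ

namespace Constants

variable (c : Constants)

/-- `k_small = ⌊k_large / 2⌋ + 1` ([KS] l.6110 `\lab{eq:choiceksmallmaintheorem}`). [cite: KlainermanSzeftel2021, TeX l.6110] -/
def kSmall : ℕ := c.kLarge / 2 + 1

/-- `m₀`, the mass of the initial data layer's reference Kerr ([KS] l.6054–6073). [cite: KlainermanSzeftel2021, TeX l.6054–6073] -/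
abbrev m₀ : ℝ := c.init.m
/-- `a₀` ([KS] l.6054–6073). [cite: KlainermanSzeftel2021, TeX l.6054–6073] -/
abbrev a₀ : ℝ := c.init.a

/-- The EXACT constraints among the constants ([KS] l.6074–6091, `\lab{eq:constraintsonthemainsmallconstantsepanddelta}`,
`…:bis`, `\lab{eq:constraintofep0wrta0}`, `\lab{eq:constraintbetweenepep*ep0}`): positivity, `|a₀| < m₀`,
`δ_B > 2 δ_dec`, `ε = ε₀^{2/3}`. (The `≪` parts are `Constants.Regime`.) [cite: KlainermanSzeftel2021, TeX l.6074–6091] -/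
structure Exact : Prop where
  subextremal : c.init.IsSubextremal
  ε₀_pos : 0 < c.ε₀
  ε_pos : 0 < c.ε
  δH_pos : 0 < c.δH
  δdec_pos : 0 < c.δdec
  δB_pos : 0 < c.δB
  δstar_pos : 0 < c.δstar
  r₀_pos : 0 < c.r₀
  kLarge_pos : 0 < c.kLarge
  /-- `δ_B > 2 δ_dec` (l.6077) -/
  two_δdec_lt_δB : 2 * c.δdec < c.δB
  /-- `ε = ε₀^{2/3}` (l.6090–6091) -/
  ε_eq : c.ε = c.ε₀ ^ (2 / 3 : ℝ)

/-- The schematic reading of the `≪` / `≫` relations of [KS] l.6076–6088 at a threshold `K ≥ 1`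
(DIVERGENCE DV-05: "`A ≪ B`" := "`K · A ≤ B` for a constant `K` depending only on previously fixed constants",
with `K` existentially quantified by the statement that uses it):
`δ_ℋ, δ_dec, δ_B, δ_* ≪ min{m₀, 1}`, `r₀ ≫ max{m₀, 1}`, `k_large ≫ 1/δ_dec`,
`ε₀, ε ≪ min{δ_ℋ, δ_dec, δ_B, δ_*, r₀⁻¹, k_large⁻¹, m₀ − |a₀|, 1}`, and `ε₀, ε ≪ |a₀|` if `a₀ ≠ 0`. [cite: KlainermanSzeftel2021, TeX l.6076–6088] -/
structure Regime (K : ℝ) : Prop where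
  one_le : 1 ≤ K
  δ_small : K * max (max c.δH c.δdec) (max c.δB c.δstar) ≤ min c.m₀ 1
  r₀_large : K * max c.m₀ 1 ≤ c.r₀
  kLarge_large : K ≤ c.δdec * c.kLarge
  eps_small : K * max c.ε₀ c.ε ≤
      min (min (min c.δH c.δdec) (min c.δB c.δstar)) (min (min c.r₀⁻¹ (c.kLarge : ℝ)⁻¹) (min (c.m₀ - |c.a₀|) 1))
  /-- l.6086–6088: `ε₀, ε ≪ |a₀|` in the case `a₀ ≠ 0` (Remark l.6093–6099: may be assumed w.l.o.g.) -/
  eps_small_a : c.a₀ ≠ 0 → K * max c.ε₀ c.ε ≤ |c.a₀|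

/-- [GKS] TeX l.1693: the variant `δ_ℋ, δ_dec ≪ min{m₀ − |a₀|, 1}` used in GKS instead of `min{m₀,1}`
(DIVERGENCE SRC-02 between the two primary sources; equivalent under `|a₀| ≪ m₀`). [cite: GiorgiKlainermanSzeftel2022, TeX l.1693] -/
def RegimeGKS (K : ℝ) : Prop :=
  K * max c.δH c.δdec ≤ min (c.m₀ - |c.a₀|) 1 ∧ K * max c.m₀ 1 ≤ c.r₀ ∧ K ≤ c.δdec * c.kLarge ∧
    K * max c.ε₀ c.ε ≤ min (min c.δdec c.r₀⁻¹) (min (c.kLarge : ℝ)⁻¹ (min (c.m₀ - |c.a₀|) 1))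

/-- `δ₀ := 130 / (k_large − k_small)` ([KS] l.6459), the interpolation loss for the second frame of `(ext)𝓜`
(Prop. `\lab{prop:constructionsecondframeinMext}`, l.6463); the source assumes `0 < δ₀ ≤ δ_dec / 3`. [cite: KlainermanSzeftel2021, TeX l.6459] -/
def δ₀ : ℝ := 130 / ((c.kLarge : ℝ) - c.kSmall)

/-- **Quantifier combinators for "sufficiently small / large".** `ForAllSmall P` := `P ε` for all `ε` in some
interval `(0, ε̄]`; `ForAllLarge P` := `P x` for all `x ≥ x̄`. These are `∀ᶠ ε in 𝓝[>] 0, P ε` and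
`∀ᶠ x in atTop, P x` spelled out (lemma `forAllSmall_iff_eventually` below), so that the ORDER in which
[KS]/[GKS] choose `(m₀,a₀) → (δ's, r₀, k_large) → (ε₀, ε)` can be written as a nesting. [folklore] -/
def ForAllSmall (P : ℝ → Prop) : Prop := ∃ ε₁ > 0, ∀ ε, 0 < ε → ε ≤ ε₁ → P ε

/-- `P x` for all sufficiently large real `x`. [folklore] -/
def ForAllLarge (P : ℝ → Prop) : Prop := ∃ x₁ : ℝ, ∀ x, x₁ ≤ x → P x

/-- `P k` for all sufficiently large natural `k`. [folklore] -/
def ForAllLargeNat (P : ℕ → Prop) : Prop := ∃ k₁ : ℕ, ∀ k, k₁ ≤ k → P k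

/-- `ForAllSmall P` is `∀ᶠ ε in 𝓝[>] 0, P ε` (dictionary to Mathlib filters). [folklore] -/
theorem forAllSmall_iff_eventually (P : ℝ → Prop) :
    ForAllSmall P ↔ ∀ᶠ ε in nhdsWithin (0 : ℝ) (Set.Ioi 0), P ε := by
  constructor
  · rintro ⟨ε₁, hε₁, h⟩
    have : Set.Ioc (0 : ℝ) ε₁ ∈ nhdsWithin (0 : ℝ) (Set.Ioi 0) := Ioc_mem_nhdsGT hε₁
    exact Filter.mem_of_superset this fun ε hε => h ε hε.1 hε.2
  · intro h
    obtain ⟨ε₁, hε₁, hsub⟩ := (mem_nhdsGT_iff_exists_Ioc_subset).1 h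
    exact ⟨ε₁, hε₁, fun ε h0 h1 => hsub ⟨h0, h1⟩⟩

/-- `ForAllLarge P` is `∀ᶠ x in atTop, P x`. [folklore] -/
theorem forAllLarge_iff_eventually (P : ℝ → Prop) :
    ForAllLarge P ↔ ∀ᶠ x in Filter.atTop, P x := by
  simp [ForAllLarge, Filter.eventually_atTop]

/-- `ForAllSmall` is monotone in the predicate. [folklore] -/
theorem ForAllSmall.mono {P Q : ℝ → Prop} (h : ForAllSmall P) (hPQ : ∀ ε, P ε → Q ε) : ForAllSmall Q := by
  obtain ⟨ε₁, hε₁, h⟩ := h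
  exact ⟨ε₁, hε₁, fun ε h0 h1 => hPQ ε (h ε h0 h1)⟩

/-- `ForAllSmall` is closed under conjunction (take the smaller threshold). [folklore] -/
theorem ForAllSmall.and {P Q : ℝ → Prop} (hP : ForAllSmall P) (hQ : ForAllSmall Q) :
    ForAllSmall fun ε => P ε ∧ Q ε := by
  obtain ⟨ε₁, hε₁, h₁⟩ := hP
  obtain ⟨ε₂, hε₂, h₂⟩ := hQ
  refine ⟨min ε₁ ε₂, lt_min hε₁ hε₂, fun ε h0 h1 => ⟨h₁ ε h0 ?_, h₂ ε h0 ?_⟩⟩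
  · exact h1.trans (min_le_left _ _)
  · exact h1.trans (min_le_right _ _)

/-- **The constants hierarchy of [KS §3.4.1] as a quantifier prefix** (l.6074: "`m₀` and `a₀` are fixed
constants …, `δ_ℋ, δ_B, δ_dec` are fixed, sufficiently small, universal constants, and `r₀` and `k_large` are
fixed, sufficiently large, universal constants … Then `ε` and `ε₀` are chosen such that …"; Main Theorem
l.6206: "`|a₀|/m₀` sufficiently small, `k_large` sufficiently large, and `ε₀ > 0` sufficiently small").
`Hierarchy 𝔞 P` says: for every `(m₀,a₀)` with `|a₀| ≤ 𝔞 m₀` there is a threshold `K` such that `P c`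
holds for every family of constants `c` over `(m₀,a₀)` which is `Exact` and in `Regime K`.
The smallness `𝔞` of `|a₀|/m₀` is an ARGUMENT, so a node can record exactly which `𝔞` it needs. [cite: KlainermanSzeftel2021, TeX l.6074] -/
def Hierarchy (𝔞 : ℝ) (P : Constants → Prop) : Prop :=
  ∀ p₀ : KerrParams, p₀.IsSlowlyRotating 𝔞 →
    ∃ K : ℝ, ∀ c : Constants, c.init = p₀ → c.Exact → c.Regime K → P c

end Constants

/-! ## §3. Schematic spacetimes, regions, weights

A spacetime (region) is modelled by a bare type of events carrying a measurable structure (for the schematic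
hypersurface integrals); regions, boundaries, spheres are subsets; `r, u, ū, τ, θ, φ` are real functions on
events (DIVERGENCE DV-01, DV-04). -/

/-- Level-0 schematic spacetime: a type of events with a σ-algebra. No metric (DV-01). [folklore] -/
structure Spacetime where
  /-- events -/
  Pt : Type
  /-- σ-algebra used for the schematic surface/volume integrals (DV-04) -/
  [mPt : MeasurableSpace Pt]

/-- the measurable structure of the carrier of a schematic spacetime [folklore] -/
instance Spacetime.instMeasurableSpacePt (M : Spacetime) : MeasurableSpace M.Pt := M.mPt

/-- The three regions of a GCM admissible spacetime `𝓜 = (ext)𝓜 ∪ (int)𝓜 ∪ (top)𝓜` ([KS §3.2], l.5213–5230). [cite: KlainermanSzeftel2021, TeX l.5213–5230] -/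
inductive Region
  /-- `(ext)𝓜`: far region, outgoing PG structure, foliated by `(u, (ext)r)`, `u ≥ 1`, `(ext)r ≥ r₀` -/
  | ext
  /-- `(int)𝓜`: near region, ingoing PG structure, foliated by `(ū, (int)r)`, `r₊⁽⁰⁾(1−δ_ℋ) ≤ (int)r ≤ r₀` -/
  | int
  /-- `(top)𝓜`: top region, ingoing PG structure `(ū, (top)r)`, between `{ū = u_*}`, `{u = u_*}` and `(top)Σ` -/
  | top
  deriving DecidableEq, Repr

/-- Named boundary / interface hypersurfaces of a GCM admissible spacetime ([KS §3.2.1], l.5240–5264):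
`∂⁺𝓜 = 𝓐 ∪ (top)Σ ∪ Σ_*`, `∂⁻𝓜 = 𝓑₁ ∪ 𝓑̲₁`, `𝒯 = (ext)𝓜 ∩ (int)𝓜`. [cite: KlainermanSzeftel2021, TeX l.5240–5264] -/
inductive Hsurf
  /-- `𝓐 = {(int)r = (m₀ + √(m₀² − a₀²))(1 − δ_ℋ)}`, future spacelike boundary of `(int)𝓜` (l.5330–5332) -/
  | A
  /-- `Σ_*`, future spacelike boundary of `(ext)𝓜`, a GCM hypersurface; `u = c_* − r` on it (l.5504 `\lab{eq:choiceofuonSigmastar}`) -/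
  | SigmaStar
  /-- `(top)Σ = {ū + σ_top((top)r) = u_*}`, future boundary of `(top)𝓜` (l.5378–5380) -/
  | topSigma
  /-- `𝓑₁ = {u = 1}`, past boundary of `(ext)𝓜`, inside the initial data layer `𝓛₀` (l.5251, l.5302) -/
  | B1
  /-- `𝓑̲₁ = {ū = 1}`, past boundary of `(int)𝓜` (l.5327) -/
  | B1bar
  /-- `𝒯 = {(ext)r = r₀}`, timelike, separates `(ext)𝓜` from `(int)𝓜` (l.5260, l.5304–5306) -/
  | T
  /-- `{u = u_*} = (ext)𝓜 ∩ (top)𝓜` (initialization of `(top)𝓜`, l.5546–5549) -/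
  | uEqUStar
  /-- `{ū = u_*} = (int)𝓜 ∩ (top)𝓜` (l.5360) -/
  | ubarEqUStar
  deriving DecidableEq, Repr

/-- Index of the `ℓ = 1` basis `J⁽⁰⁾ = cos θ`, `J⁽⁺⁾ = sin θ cos φ`, `J⁽⁻⁾ = sin θ sin φ` ([KS] l.3683, l.4347). [cite: KlainermanSzeftel2021, TeX l.3683] -/
inductive JIdx | zero | plus | minus
  deriving DecidableEq, Repr

/-! ## §4. Names of the linearized quantities (the vocabulary `Γ`)

One flat vocabulary of SYMBOLS, in the complex notation of [KS] l.2050–2055: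
`A = α + i*α, B = β + i*β, P = ρ + i*ρ, B̲, A̲; X = χ + i*χ, X̲, H = η + i*η, H̲, Z = ζ + i*ζ, Ξ, Ξ̲, ω, ω̲`,
their linearizations ("checks": outgoing PG l.4150–4198 `\lab{def:renormalizationofallnonsmallquantitiesinPGstructurebyKerrvalue}`,
ingoing PG l.4401–4447 `…:ingoingcase`, on `Σ_*` l.5672–5685 `\lab{def:renormalizedquantitiesGCMfoliationofSigma*}`), the derivatives of the coordinates `r, u, ū, q, J⁽ᵖ⁾` and of the 1-forms
`𝔍, 𝔍_±`, the quantities `𝔮, 𝔮̲` of [GKS], and the frame-transition coefficients `(f, f̲, log λ)`.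
A frame does not know which symbols "make sense" for it; tables below say which symbols each norm reads. -/

/-- Symbols for (linearized) Ricci coefficients, curvature components, metric/coordinate derivatives. The
docstring of each constructor is the TeX symbol and its defining equation in [KS] (tables l.4210–4229, l.4449–4469). [cite: KlainermanSzeftel2021, TeX l.4210–4229] -/
inductive Qty
  -- curvature, complex notation [KS l.2050]; real parts α β ρ *ρ β̲ α̲
  /-- `A = α + i *α` (vanishes in Kerr) -/ | A
  /-- `B = β + i *β` (vanishes in Kerr) -/ | B
  /-- `P = ρ + i *ρ` -/ | P
  /-- `P̌ = P + 2m/q³` (outgoing/ingoing PG, l.4150ff/l.4401ff); on `Σ_*`: `ρ̌ = ρ + 2m/r³`, `*ρ` (l.5672ff) -/ | Pc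
  /-- `B̲ = β̲ + i *β̲` (vanishes in Kerr) -/ | Bb
  /-- `A̲ = α̲ + i *α̲` (vanishes in Kerr) -/ | Ab
  -- Ricci coefficients
  /-- `tr X = tr χ − i ⁽ᵃ⁾tr χ` -/ | trX
  /-- `tr X̌ = tr X − 2/q` (outgoing); `tr X − 2q̄Δ/|q|⁴` (ingoing); `tr χ − 2/r` on `Σ_*` -/ | trXc
  /-- `X̂ = χ̂ + i *χ̂` (vanishes in Kerr) -/ | Xh
  /-- `tr X̲` -/ | trXb
  /-- `tr X̲̌ = tr X̲ + 2qΔ/|q|⁴` (outgoing); `tr X̲ + 2/q̄` (ingoing); `tr χ̲ + 2Υ/r` on `Σ_*` -/ | trXbc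
  /-- `X̲̂ = χ̲̂ + i *χ̲̂` (vanishes in Kerr) -/ | Xbh
  /-- `Z = ζ + i *ζ` (unrenormalized; `ζ ∈ Γ_g^*` on `Σ_*`, l.5695) -/ | Z
  /-- `Ž = Z − a q̄ 𝔍/|q|²` (outgoing); `Z − a q 𝔍/|q|²` (ingoing) -/ | Zc
  /-- `H = η + i *η` (unrenormalized; `η ∈ Γ_b^*` on `Σ_*`) -/ | H
  /-- `Ȟ = H − a q 𝔍/|q|²` (outgoing) -/ | Hc
  /-- `H̲ = η̲ + i *η̲` (`H̲ = −Z` for outgoing PG) -/ | Hb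
  /-- `Ȟ̲ = H̲ + a q̄ 𝔍/|q|²` (ingoing; second frame of `(ext)𝓜`, l.6463ff) -/ | Hbc
  /-- `Ξ = ξ + i *ξ` (`= 0` for outgoing PG; `∈ Γ_{g,1}` ingoing) -/ | Xi
  /-- `Ξ̲ = ξ̲ + i *ξ̲` (`= 0` for ingoing PG; `∈ Γ_{b,1}` outgoing) -/ | Xib
  /-- `ω` (`= 0` outgoing PG) -/ | om
  /-- `ω̌ = ω + ½ ∂_r(Δ/|q|²)` (ingoing) -/ | omc
  /-- `ω̲` (`= 0` ingoing PG) -/ | omb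
  /-- `ω̲̌ = ω̲ − ½ ∂_r(Δ/|q|²)` (outgoing); `ω̲ − m/r²` on `Σ_*` (l.5672ff) -/ | ombc
  /-- mass aspect function `μ` (GCM condition l.3914 `\lab{eq:Si^*-GCM1}`: `μ = 2m/r³ + M₀ + Σ M_p J⁽ᵖ⁾`) -/ | mu
  -- derivatives of coordinates [KS l.4150–4198 outgoing; l.4401–4447 ingoing; l.5672–5685 on Σ_*]
  /-- `ě₃(r) = e₃(r) + Δ/|q|²` (outgoing); `e₃(r) + Υ` on `Σ_*` -/ | e3r
  /-- `ě₄(r) = e₄(r) − Δ/|q|²` (ingoing); `e₄'(r) − 1` (second frame of `(ext)𝓜`) -/ | e4r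
  /-- `𝒟̌q = 𝒟q + a𝔍` -/ | Dq
  /-- `𝒟̌q̄ = 𝒟q̄ − a𝔍` -/ | Dqb
  /-- `𝒟̌u = 𝒟u − a𝔍` (outgoing) -/ | Du
  /-- `𝒟̌ū = 𝒟ū − a𝔍` (ingoing) -/ | Dub
  /-- `ě₃(u) = e₃(u) − 2(r²+a²)/|q|²` (outgoing); `e₃(u) − 2` on `Σ_*` -/ | e3u
  /-- `ě₄(ū) = e₄(ū) − 2(r²+a²)/|q|²` (ingoing) -/ | e4ub
  /-- `e₄'(u)` (second frame of `(ext)𝓜`, l.6463ff) -/ | e4u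
  /-- `r⁻¹ ∇'(r)` (second frame of `(ext)𝓜`, l.6463ff) -/ | Dr
  /-- `b̌_* = b_* + 1 + 2m/r` on `Σ_*` (l.5672ff; GCM l.3914: `b_*|_{SP} = −1 − 2m/r`) -/ | bstar
  -- derivatives of the ℓ=1 basis and of 𝔍, 𝔍_± [KS l.4150–4198; l.4401–4447]
  /-- `𝒟̌J⁽⁰⁾ = 𝒟J⁽⁰⁾ − i𝔍` -/ | DJ0
  /-- `𝒟̌J⁽⁺⁾ = 𝒟J⁽⁺⁾ − 𝔍₊` -/ | DJp
  /-- `𝒟̌J⁽⁻⁾ = 𝒟J⁽⁻⁾ − 𝔍₋` -/ | DJm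
  /-- `e₃(J⁽⁰⁾)` (outgoing) -/ | e3J0
  /-- `ě₃(J⁽⁺⁾) = e₃(J⁽⁺⁾) + 2aJ⁽⁻⁾/|q|²` (outgoing) -/ | e3Jp
  /-- `ě₃(J⁽⁻⁾) = e₃(J⁽⁻⁾) − 2aJ⁽⁺⁾/|q|²` (outgoing) -/ | e3Jm
  /-- `e₄(J⁽⁰⁾)` (ingoing: `r e₄(J⁽⁰⁾) ∈ Γ_{g,2}`; second frame of `(ext)𝓜`) -/ | e4J0
  /-- `ě₄(J⁽⁺⁾)` (ingoing) -/ | e4Jp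
  /-- `ě₄(J⁽⁻⁾)` (ingoing) -/ | e4Jm
  /-- `𝒟̄̌·𝔍 = 𝒟̄·𝔍 − 4i(r²+a²)cos θ/|q|⁴` -/ | DbJk
  /-- `𝒟 ⊗̂ 𝔍` -/ | DhJk
  /-- `∇̌₃𝔍 = ∇₃𝔍 − Δq𝔍/|q|⁴` (outgoing) -/ | n3Jk
  /-- `∇̌₄𝔍 = ∇₄𝔍 + Δq̄𝔍/|q|⁴` (ingoing); `∇₄'𝔍 + 𝔍/q` (second frame of `(ext)𝓜`) -/ | n4Jk
  /-- `𝒟̄̌·𝔍₊` -/ | DbJkp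
  /-- `𝒟̄̌·𝔍₋` -/ | DbJkm
  /-- `𝒟 ⊗̂ 𝔍₊` -/ | DhJkp
  /-- `𝒟 ⊗̂ 𝔍₋` -/ | DhJkm
  /-- `∇̌₃𝔍₊` (outgoing) -/ | n3Jkp
  /-- `∇̌₃𝔍₋` (outgoing) -/ | n3Jkm
  /-- `∇̌₄𝔍₊` (ingoing) -/ | n4Jkp
  /-- `∇̌₄𝔍₋` (ingoing) -/ | n4Jkm
  -- GCM scalars (modes are read through `FrameData.mode`)
  /-- `div η` (GCM l.3914: `∫_S J⁽ᵖ⁾ div η = 0` on every leaf of `Σ_*`) -/ | divEta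
  /-- `div ξ̲` (GCM l.3914: `∫_S J⁽ᵖ⁾ div ξ̲ = 0`) -/ | divXib
  /-- `div β` (GCM l.3926 on `S_*`: `∫_{S_*} J⁽ᵖ⁾ div β = 0`) -/ | divBeta
  /-- `curl β` (GCM l.3930 on `S_*`: `∫_{S_*} J⁽±⁾ curl β = 0`; `a := r³/(8πm) ∫_{S_*} J⁽⁰⁾ curl β`, l.3940–3951) -/ | curlBeta
  -- Teukolsky / gRW unknowns [KS l.6379–6388; GKS]
  /-- `𝔮 = q q̄³ ((∇₃ − 2ω̲)(∇₃ − 4ω̲)A + C₁(∇₃ − 4ω̲)A + C₂A)` (gRW unknown, global frame; [KS] l.6384–6388) -/ | qf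
  /-- `𝔮̲`, the analogue for `A̲` ([GKS] Ch. 10) -/ | qfb
  -- frame-transition coefficients (initial layer norm ℑ'_0, [KS] l.6019; second frame of (ext)M, l.6463)
  /-- transition 1-form `f` of a general frame transformation -/ | f
  /-- `ν(r) + 2` on `Σ_*`, `ν = e₃ + b_* e₄` tangent to `Σ_*` (PT norm on `Σ_*`, [KS] l.23876) -/ | nuR
  /-- transition 1-form `f̲` -/ | fb
  /-- `log(λ₀⁻¹ λ)`, transition scalar -/ | loglam
  deriving DecidableEq, Repr

/-- A weighted table of symbols: entry `(ψ, w)` stands for the quantity `r^w ψ` (DIVERGENCE DV-07: the source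
puts the weight inside the derivative, `|𝔡^{≤k}(r^w ψ)|`; we read `r^w |𝔡^{≤k} ψ|`). [folklore] -/
abbrev Table := List (Qty × ℕ)

namespace Table

/-- `Γ_g` for an OUTGOING PG structure, [KS] l.4210–4218 `\lab{definition.Ga_gGa_b}`:
`Γ_g = {tr X̌, X̂, Ž, tr X̲̌, rP̌, rB, rA}`. [cite: KlainermanSzeftel2021, TeX l.4210–4218] -/
def ΓgOut : Table :=
  [(.trXc, 0), (.Xh, 0), (.Zc, 0), (.trXbc, 0), (.Pc, 1), (.B, 1), (.A, 1)]

/-- `Γ_{b,1} ∪ Γ_{b,2} ∪ Γ_{b,3} ∪ Γ_{b,4}` for an OUTGOING PG structure, [KS] l.4220–4229: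
`Γ_{b,1} = {Ȟ, X̲̂, ω̲̌, Ξ̲, rB̲, A̲}`, `Γ_{b,2} = {r⁻¹ě₃(r), 𝒟̌q, 𝒟̌q̄, 𝒟̌u, r⁻¹ě₃(u)}`,
`Γ_{b,3} = {𝒟̌J⁽⁰⁾, 𝒟̌J⁽±⁾, e₃(J⁽⁰⁾), ě₃(J⁽±⁾)}`,
`Γ_{b,4} = {r𝒟̄̌·𝔍, r𝒟⊗̂𝔍, r∇̌₃𝔍, r𝒟̄̌·𝔍_±, r𝒟⊗̂𝔍_±, r∇̌₃𝔍_±}`.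
NEGATIVE weights `r⁻¹` are recorded in `ΓbOutInv` (DV-07). [cite: KlainermanSzeftel2021, TeX l.4220–4229] -/
def ΓbOut : Table :=
  [(.Hc, 0), (.Xbh, 0), (.ombc, 0), (.Xib, 0), (.Bb, 1), (.Ab, 0),
   (.Dq, 0), (.Dqb, 0), (.Du, 0),
   (.DJ0, 0), (.DJp, 0), (.DJm, 0), (.e3J0, 0), (.e3Jp, 0), (.e3Jm, 0),
   (.DbJk, 1), (.DhJk, 1), (.n3Jk, 1), (.DbJkp, 1), (.DbJkm, 1), (.DhJkp, 1), (.DhJkm, 1),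
   (.n3Jkp, 1), (.n3Jkm, 1)]

/-- The two `r⁻¹`-weighted members of `Γ_{b,2}` (outgoing): `r⁻¹ ě₃(r)`, `r⁻¹ ě₃(u)` (weight `−1`) ([KS] l.4210–4229). [cite: KlainermanSzeftel2021, TeX l.4210–4229] -/
def ΓbOutInv : List Qty := [.e3r, .e3u]

/-- `Γ_g = Γ_{g,1} ∪ Γ_{g,2}` for an INGOING PG structure, [KS] l.4449–4461 `\lab{definition.Ga_gGa_b:ingoingcase}`:
`Γ_{g,1} = {Ξ, ω̌, tr X̌, X̂, Ž, Ȟ̲, tr X̲̌, rP̌, rB, rA}`,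
`Γ_{g,2} = {rě₄(r), rě₄(ū), re₄(J⁽⁰⁾), rě₄(J⁽±⁾), r²∇̌₄𝔍, r²∇̌₄𝔍_±}`. [cite: KlainermanSzeftel2021, TeX l.4449–4461] -/
def ΓgIn : Table :=
  [(.Xi, 0), (.omc, 0), (.trXc, 0), (.Xh, 0), (.Zc, 0), (.Hbc, 0), (.trXbc, 0), (.Pc, 1), (.B, 1), (.A, 1),
   (.e4r, 1), (.e4ub, 1), (.e4J0, 1), (.e4Jp, 1), (.e4Jm, 1), (.n4Jk, 2), (.n4Jkp, 2), (.n4Jkm, 2)]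

/-- `Γ_b = Γ_{b,1} ∪ Γ_{b,2}` for an INGOING PG structure, [KS] l.4463–4469:
`Γ_{b,1} = {X̲̂, rB̲, A̲, 𝒟̌q, 𝒟̌q̄, 𝒟̌ū}`, `Γ_{b,2} = {𝒟̌J⁽⁰⁾, 𝒟̌J⁽±⁾, r𝒟̄̌·𝔍, r𝒟⊗̂𝔍, r𝒟̄̌·𝔍_±, r𝒟⊗̂𝔍_±}`. [cite: KlainermanSzeftel2021, TeX l.4463–4469] -/
def ΓbIn : Table :=
  [(.Xbh, 0), (.Bb, 1), (.Ab, 0), (.Dq, 0), (.Dqb, 0), (.Dub, 0),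
   (.DJ0, 0), (.DJp, 0), (.DJm, 0), (.DbJk, 1), (.DhJk, 1), (.DbJkp, 1), (.DbJkm, 1), (.DhJkp, 1), (.DhJkm, 1)]

/-- In `(top)𝓜` the quantities built on `J⁽±⁾`, `𝔍_±` are removed ([KS] Remark l.5935 `\lab{rmk:noJpmandnoJkpminMtop:chap3}`). [cite: KlainermanSzeftel2021, TeX l.5935] -/
def ΓgTop : Table :=
  [(.Xi, 0), (.omc, 0), (.trXc, 0), (.Xh, 0), (.Zc, 0), (.Hbc, 0), (.trXbc, 0), (.Pc, 1), (.B, 1), (.A, 1),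
   (.e4r, 1), (.e4ub, 1), (.e4J0, 1), (.n4Jk, 2)]

/-- `Γ_b` in `(top)𝓜` (no `J⁽±⁾`, `𝔍_±` quantities) ([KS] l.5870–5900). [cite: KlainermanSzeftel2021, TeX l.5870–5900] -/
def ΓbTop : Table :=
  [(.Xbh, 0), (.Bb, 1), (.Ab, 0), (.Dq, 0), (.Dqb, 0), (.Dub, 0), (.DJ0, 0), (.DbJk, 1), (.DhJk, 1)]

/-- `Γ_g = Γ_{g,1} ∪ Γ_{g,2}` of [GKS] (arXiv:2205.14808) Def. `definition.Ga_gGa_b`, TeX l.7209–7217 (ingoing normalization, global frame):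
`Γ_{g,1} = {Ξ, ω̌, tr X̌, X̂, Ž, Ȟ̲, tr X̲̌, rP̌, rB, rA}`, `Γ_{g,2} = {ě₄(r), r⁻¹∇(r), e₄(cos θ), r∇̌₄𝔍}` (`e₄(cos θ) = e₄(J⁽⁰⁾)`, `r⁻¹∇(r)` is the symbol `Dr`).
NB the weights differ from the [KS] ingoing table `ΓgIn` (`ě₄(r)`: 0 here vs 1; `∇̌₄𝔍`: 1 vs 2) — SRC-07. [cite: KlainermanSzeftel2021, TeX l.7209–7217] -/
def ΓgGKS : Table :=
  [(.Xi, 0), (.omc, 0), (.trXc, 0), (.Xh, 0), (.Zc, 0), (.Hbc, 0), (.trXbc, 0), (.Pc, 1), (.B, 1), (.A, 1),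
   (.e4r, 0), (.Dr, 0), (.e4J0, 0), (.n4Jk, 1)]

/-- `Γ_b = Γ_{b,1} ∪ Γ_{b,2} ∪ Γ_{b,3}` of [GKS] l.7219–7226: `Γ_{b,1} = {Ȟ, X̲̂, ω̲̌, Ξ̲, rB̲, A̲}`, `Γ_{b,2} = {r⁻¹ě₃(r), 𝒟̌(cos θ), e₃(cos θ)}`,
`Γ_{b,3} = {r𝒟̄̌·𝔍, r𝒟⊗̂𝔍, r∇̌₃𝔍}`; the `r⁻¹`-weighted member `ě₃(r)` is in `ΓbGKSInv` (DV-07). [cite: GiorgiKlainermanSzeftel2022, TeX l.7219–7226] -/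
def ΓbGKS : Table :=
  [(.Hc, 0), (.Xbh, 0), (.ombc, 0), (.Xib, 0), (.Bb, 1), (.Ab, 0), (.DJ0, 0), (.e3J0, 0), (.DbJk, 1), (.DhJk, 1), (.n3Jk, 1)]
/-- the inverse-weight member `ě₃(r)` (weight `r⁻¹`… read with `sizeInv`) of the [GKS] table `Γ_b` (Def. `definition.Ga_gGa_b`). [cite: GiorgiKlainermanSzeftel2022, Def. Γ_g/Γ_b, TeX l.7218–7226] -/
def ΓbGKSInv : List Qty := [.e3r]

/-- `Γ_g^*` on `Σ_*`, [KS] l.5690–5697 `\lab{Definition:linearizedquantitiesSi*}`: `{tr χ̌, χ̂, ζ, tr χ̲̌, rα, rβ, r(ρ̌, *ρ)}`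
(real notation in the source; we use the complex symbols: `|X̂| ≃ |χ̂|` etc., DV-08). [cite: KlainermanSzeftel2021, TeX l.5690–5697] -/
def ΓgStar : Table :=
  [(.trXc, 0), (.Xh, 0), (.Z, 0), (.trXbc, 0), (.A, 1), (.B, 1), (.Pc, 1)]

/-- `Γ_b^*` on `Σ_*`, [KS] l.5698–5702: `{η, χ̲̂, ω̲̌, ξ̲, rβ̲, α̲, r⁻¹ě₃(r), r⁻¹ě₃(u), r⁻¹b̌_*}`;
the three `r⁻¹`-weighted members are in `ΓbStarInv`. [cite: KlainermanSzeftel2021, TeX l.5698–5702] -/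
def ΓbStar : Table :=
  [(.H, 0), (.Xbh, 0), (.ombc, 0), (.Xib, 0), (.Bb, 1), (.Ab, 0)]

/-- `r⁻¹`-weighted members of `Γ_b^*`: `ě₃(r), ě₃(u), b̌_*` ([KS] l.5718–5729). [cite: KlainermanSzeftel2021, TeX l.5718–5729] -/
def ΓbStarInv : List Qty := [.e3r, .e3u, .bstar]

end Table

/-! ## §5. Frame data: a null frame seen through the sizes of the jets of the named quantities

DIVERGENCE DV-02: for a horizontal structure `(e₃, e₄, 𝓗)` on a region, and its weighted derivatives
`𝔡 = {∇₃, r∇₄, r∇}` ([KS] l.5799; on `Σ_*`: `𝔡_* = {∇_ν, r∇}`, l.5707; in primed frames `𝔡'`), we keep only `jet ψ k p = |𝔡^{≤k} ψ|(p)` and `jetD d ψ k p = |𝔡^{≤k} ∇_d ψ|(p)` for the distinguished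
unweighted directions `d ∈ {e₃, e₄, ν}`, valued in `[0, ∞]`, monotone in `k`. -/

/-- Distinguished derivative directions appearing unweighted in the norms: `∇₃` (decay norms of `(ext)𝓜`),
`∇₄`, and `∇_ν`, `ν = e₃ + b_* e₄` tangent to `Σ_*` and normal to its `r`-foliation ([KS] l.5423). [cite: KlainermanSzeftel2021, TeX l.5423] -/
inductive Dir | e3 | e4 | nu
  deriving DecidableEq, Repr

/-- The schematic content of a null frame / horizontal structure on (a region of) `Pt`. [folklore] -/
structure FrameData (Pt : Type) where
  /-- `jet ψ k p = |𝔡^{≤k} ψ|(p)` (pointwise Euclidean size of all weighted derivatives of order `≤ k`) -/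
  jet : Qty → ℕ → Pt → ℝ≥0∞
  /-- `jetD d ψ k p = |𝔡^{≤k} ∇_d ψ|(p)` -/
  jetD : Dir → Qty → ℕ → Pt → ℝ≥0∞
  /-- pointwise VALUE of the scalar symbols (`tr X`, `tr X̲`, `ω̲`, `μ`, `b_*`, `e₃(r)`, …); junk for tensors.
  Read only by the GCM predicates (DV-06). -/
  val : Qty → Pt → ℂ
  /-- `mode ψ j p = ∫_{S(p)} ψ J⁽ʲ⁾`, the `ℓ = 1` modes of the scalar `ψ` on the sphere of the foliation through
  `p` ([KS] l.3893 `\lab{eq:canonical-ell=1modesonSi:0}`, up to normalization) (DV-06). -/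
  mode : Qty → JIdx → Pt → ℝ
  /-- `|𝔡^{≤k}ψ| ≤ |𝔡^{≤k+1}ψ|` -/
  jet_mono : ∀ ψ p, Monotone fun k => jet ψ k p
  jetD_mono : ∀ d ψ p, Monotone fun k => jetD d ψ k p

namespace FrameData

variable {Pt : Type} (F : FrameData Pt)

/-- `|𝔡^{≤k} T|(p) := sup_{(ψ,w) ∈ T} r(p)^w |𝔡^{≤k} ψ|(p)` for a weighted table `T` and radius `r`. [folklore] -/
def size (T : Table) (r : Pt → ℝ) (k : ℕ) (p : Pt) : ℝ≥0∞ :=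
  ⨆ e ∈ T, ENNReal.ofReal (r p ^ e.2) * F.jet e.1 k p

/-- same with the list of `r⁻¹`-weighted symbols: `sup_{ψ ∈ L} r(p)⁻¹ |𝔡^{≤k} ψ|(p)`. [folklore] -/
def sizeInv (L : List Qty) (r : Pt → ℝ) (k : ℕ) (p : Pt) : ℝ≥0∞ :=
  ⨆ ψ ∈ L, ENNReal.ofReal (r p)⁻¹ * F.jet ψ k p

/-- `|𝔡^{≤k} ∇_d T|(p)`. [folklore] -/
def sizeD (d : Dir) (T : Table) (r : Pt → ℝ) (k : ℕ) (p : Pt) : ℝ≥0∞ :=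
  ⨆ e ∈ T, ENNReal.ofReal (r p ^ e.2) * F.jetD d e.1 k p

/-- `size T r k p` is monotone in `k` (cumulative jets, DV-09). [folklore] -/
theorem size_mono (T : Table) (r : Pt → ℝ) (p : Pt) : Monotone fun k => F.size T r k p := by
  intro k l hkl
  simp only [size]
  exact iSup₂_mono fun e _ => mul_le_mul' le_rfl (F.jet_mono e.1 p hkl)

/-- `sizeD d T r k p` is monotone in `k`. [folklore] -/
theorem sizeD_mono (d : Dir) (T : Table) (r : Pt → ℝ) (p : Pt) : Monotone fun k => F.sizeD d T r k p := by
  intro k l hkl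
  simp only [sizeD]
  exact iSup₂_mono fun e _ => mul_le_mul' le_rfl (F.jetD_mono d e.1 p hkl)

/-- `sizeInv T r k p` is monotone in `k`. [folklore] -/
theorem sizeInv_mono (L : List Qty) (r : Pt → ℝ) (p : Pt) : Monotone fun k => F.sizeInv L r k p := by
  intro k l hkl
  simp only [sizeInv]
  exact iSup₂_mono fun ψ _ => mul_le_mul' le_rfl (F.jet_mono ψ p hkl)

end FrameData

/-! ## §6. GCM admissible spacetimes ([KS §3.2], l.5213–5635) and the GCM conditions ([KS] l.3907–3951) -/

/-- **A GCM admissible spacetime** `𝓜 = (ext)𝓜 ∪ (int)𝓜 ∪ (top)𝓜` over the constants `c`, carried by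
subsets of an AMBIENT schematic spacetime `M` (so that extensions `𝓜 ⊂ 𝓜'`, Theorems M7/M8, and the initial
data layer `𝓛₀ ⊃ 𝓑₁ ∪ 𝓑̲₁` live on the same events): regions, boundaries, the scalar functions of the PG
structures, the frames (as `FrameData`, linearized w.r.t. the parameters `(a, m)` of `S_*`), the constants
`u_*, r_*, c_*`, and the measures used for the flux integrals. Only facts that are DEFINITIONAL in [KS §3.2]
are recorded as fields; everything the source PROVES about these objects (e.g. control of coordinates,
Lemma l.5580ff) is a node of the DAG, not an axiom here. Physical realizability (Einstein vacuum, being a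
development of the data) is NOT a field: it is an opaque predicate supplied by the node statements (DV-11). [cite: KlainermanSzeftel2021, TeX l.5580] -/
structure GCMAdmissible (c : Constants) (M : Spacetime) where
  /-- `(ext)𝓜, (int)𝓜, (top)𝓜` (subsets of the ambient carrier `M`, DV-01/DV-11) -/
  region : Region → Set M.Pt
  /-- the named hypersurfaces -/
  hsurf : Hsurf → Set M.Pt
  /-- the last sphere `S_* = S(r_*) ⊂ Σ_*`, the final leaf of the `r`-foliation of `Σ_*` (l.5413, l.5432) -/
  SStar : Set M.Pt
  /-- the south poles `θ = π` of the spheres of `Σ_*` (GCM condition on `b_*`, l.3914–3923) -/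
  southPoles : Set M.Pt
  /-- `(a, m)` of `𝓜` := the parameters of `S_*` ([KS] l.5458; l.3940–3951 `\lab{define:am-onSi}`) -/
  params : KerrParams
  /-- `u` on `(ext)𝓜 ∪ Σ_*` (`e₄(u) = 0`), extended by junk elsewhere -/
  u : M.Pt → ℝ
  /-- `ū` on `(int)𝓜 ∪ (top)𝓜` (`e₃(ū) = 0`) -/
  ubar : M.Pt → ℝ
  /-- `(ext)r, (int)r, (top)r`, the affine parameters of the three PG structures -/
  r : Region → M.Pt → ℝ
  /-- `(ext)θ, (int)θ, (top)θ` (l.5588–5630) -/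
  θ : Region → M.Pt → ℝ
  /-- `(ext)φ, (int)φ` (no `(top)φ`) -/
  φ : Region → M.Pt → ℝ
  /-- `u_*`, the value of `u` on `S_*` -/
  uStar : ℝ
  /-- `r_*`, the value of `r` on `S_*` -/
  rStar : ℝ
  /-- `c_*`: `u = c_* − r` on `Σ_*` (l.5504) -/
  cStar : ℝ
  /-- the PG frame of each region, as jet data -/
  frame : Region → FrameData M.Pt
  /-- the GCM frame of `Σ_*` (transversality `ξ = ω = 0, η̲ = −ζ, e₄(r) = 1, e₄(u) = 0`, l.5665), derivatives `𝔡_* = {∇_ν, r∇}` -/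
  frameStar : FrameData M.Pt
  /-- the second frame of `(ext)𝓜` ([KS] Prop. l.6463 `\lab{prop:constructionsecondframeinMext}`), derivatives `𝔡'` -/
  framePrime : FrameData M.Pt
  /-- the global frame of `𝓜` ([KS §3.6] l.6372–6620) in which `𝔮` is defined -/
  frameGlo : FrameData M.Pt
  /-- induced measure on each named hypersurface (schematic `∫_Σ`, DV-04) -/
  surf : Hsurf → Measure M.Pt
  /-- `∫_{S_*} ·`, the integral over the last sphere (Hawking mass and `a`, l.3940–3951) -/
  intSStar : (M.Pt → ℝ) → ℝ
  -- definitional facts of [KS §3.2]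
  /-- the named hypersurfaces and `S_*` lie in `𝓜 = (ext)𝓜 ∪ (int)𝓜 ∪ (top)𝓜` (l.5269) -/
  hsurf_sub : ∀ h, hsurf h ⊆ region .ext ∪ region .int ∪ region .top
  /-- `𝒯 = (ext)𝓜 ∩ (int)𝓜` (l.5260, l.6175) -/
  T_eq : hsurf .T = region .ext ∩ region .int
  /-- `𝒯 = {(ext)r = r₀}` (l.5304–5306) -/
  T_level : ∀ p ∈ hsurf .T, r .ext p = c.r₀
  /-- `(ext)r ≥ r₀` on `(ext)𝓜` (the `u`-foliation terminates at `𝒯`) -/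
  r₀_le_rExt : ∀ p ∈ region .ext, c.r₀ ≤ r .ext p
  /-- `𝓐 = {(int)r = (m₀ + √(m₀² − a₀²))(1 − δ_ℋ)}` (l.5330–5332) — NB: the INITIAL parameters `(m₀, a₀)` -/
  A_level : ∀ p ∈ hsurf .A, r .int p = c.init.rPlus * (1 - c.δH)
  /-- `𝓑₁ = {u = 1} ∩ (ext)𝓜` (l.5302) -/
  B1_level : hsurf .B1 = {p ∈ region .ext | u p = 1}
  /-- `𝓑̲₁ = {ū = 1} ∩ (int)𝓜` (l.5327) -/
  B1bar_level : hsurf .B1bar = {p ∈ region .int | ubar p = 1}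
  /-- `u ≥ 1` on `(ext)𝓜`, `ū ≥ 1` on `(int)𝓜` (past boundaries `𝓑₁ = {u = 1}`, `𝓑̲₁ = {ū = 1}`) -/
  one_le_u : ∀ p ∈ region .ext, 1 ≤ u p
  one_le_ubar : ∀ p ∈ region .int, 1 ≤ ubar p
  /-- `u ≤ u_*` on `(ext)𝓜`; `{u = u_*} = (ext)𝓜 ∩ (top)𝓜` -/
  u_le_uStar : ∀ p ∈ region .ext, u p ≤ uStar
  uEq_level : hsurf .uEqUStar = {p ∈ region .ext | u p = uStar}
  /-- `(int)𝓜 ∩ (top)𝓜 = {ū = u_*}` (l.5360) -/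
  ubarEq_level : hsurf .ubarEqUStar = region .int ∩ region .top
  ubarEq_val : ∀ p ∈ hsurf .ubarEqUStar, ubar p = uStar
  /-- `Σ_* ⊂ (ext)𝓜` is its future boundary; `S_* ⊂ Σ_*` -/
  SigmaStar_sub : hsurf .SigmaStar ⊆ region .ext
  SStar_sub : SStar ⊆ hsurf .SigmaStar
  /-- `u = c_* − r` on `Σ_*` (l.5504); `u = u_*`, `r = r_*` on `S_*` (l.5432, l.5506) -/
  u_on_SigmaStar : ∀ p ∈ hsurf .SigmaStar, u p = cStar - r .ext p
  u_on_SStar : ∀ p ∈ SStar, u p = uStar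
  r_on_SStar : ∀ p ∈ SStar, r .ext p = rStar
  /-- `r` increases along `Σ_*` from `r_*` ((a), l.5432) -/
  rStar_le : ∀ p ∈ hsurf .SigmaStar, rStar ≤ r .ext p
  /-- `(int)r = (ext)r` on `𝒯`, `(top)r = (ext)r` on `{u = u_*}` (initializations, l.5521, l.5548) -/
  rInt_on_T : ∀ p ∈ hsurf .T, r .int p = r .ext p
  rTop_on_uEq : ∀ p ∈ hsurf .uEqUStar, r .top p = r .ext p
  /-- `ū = u` on `𝒯` (l.5521) -/
  ubar_on_T : ∀ p ∈ hsurf .T, ubar p = u p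
  /-- `ū = u + 2 ∫_{r₀}^{(ext)r} (r̃² + a²)/(r̃² − 2m r̃ + a²) dr̃` on `{u = u_*}` (l.5548), with the `(a, m)` of `𝓜` -/
  ubar_on_uEq : ∀ p ∈ hsurf .uEqUStar,
    ubar p = u p + 2 * ∫ x in c.r₀..r .ext p, (x ^ 2 + params.a ^ 2) / params.Delta x

namespace GCMAdmissible

variable {c : Constants} {M : Spacetime} (𝓜 : GCMAdmissible c M)

/-- events of (the ambient carrier of) `𝓜` [folklore] -/
abbrev Pt (_𝓜 : GCMAdmissible c M) : Type := M.Pt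

/-- `𝓜 = (ext)𝓜 ∪ (int)𝓜 ∪ (top)𝓜` as a subset of the ambient carrier (l.5269). [cite: KlainermanSzeftel2021, TeX l.5269] -/
def carrier : Set 𝓜.Pt := 𝓜.region .ext ∪ 𝓜.region .int ∪ 𝓜.region .top

/-- `Σ_*` [folklore] -/
abbrev SigmaStar : Set 𝓜.Pt := 𝓜.hsurf .SigmaStar

/-- `(top)u := ū − 2 ∫_{r₀}^{r} (r̃² + a²)/(r̃² − 2m r̃ + a²) dr̃` on `(top)𝓜(r ≥ r₀)` ([KS] l.5966),
with the parameters `(a, m)` of `𝓜`. [cite: KlainermanSzeftel2021, TeX l.5966] -/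
def uTop (p : 𝓜.Pt) : ℝ :=
  𝓜.ubar p - 2 * ∫ x in c.r₀..𝓜.r .top p, (x ^ 2 + 𝓜.params.a ^ 2) / 𝓜.params.Delta x

/-- A function on `Σ_*` is constant along the leaves of the `r`-foliation of `Σ_*`
(the scalars `C̲₀, C̲_p, M₀, M_p` of the GCM condition l.3914–3923). [cite: KlainermanSzeftel2021, TeX l.3914–3923] -/
def LeafConstant (f : 𝓜.Pt → ℝ) : Prop :=
  ∀ p ∈ 𝓜.SigmaStar, ∀ p' ∈ 𝓜.SigmaStar, 𝓜.r .ext p = 𝓜.r .ext p' → f p = f p'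

/-- The `ℓ = 1` basis functions `J⁽⁰⁾ = cos θ, J⁽⁺⁾ = sin θ cos φ, J⁽⁻⁾ = sin θ sin φ` of a region
([KS] l.3683, l.4347; on `Σ_*`: `(θ, φ)` initialized on `S_*` and transported by `ν(θ) = ν(φ) = 0`, l.5419–5423). [cite: KlainermanSzeftel2021, TeX l.3683] -/
def J (i : Region) (j : JIdx) (p : 𝓜.Pt) : ℝ :=
  match j with
  | .zero => Real.cos (𝓜.θ i p)
  | .plus => Real.sin (𝓜.θ i p) * Real.cos (𝓜.φ i p)
  | .minus => Real.sin (𝓜.θ i p) * Real.sin (𝓜.φ i p)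

/-- **The GCM conditions on `Σ_*`** ([KS] l.3907–3937 `\lab{def:CanonicalGCM-hypersurface}`, equations
`\lab{eq:Si^*-GCM1}` l.3914, `…GCM2` l.3926, `…GCM3` l.3930), read in the GCM frame `frameStar` with the parameters `(a, m)` of `𝓜`:
on every leaf `S` of `Σ_*`: `tr χ = 2/r`, `tr χ̲ = −2Υ/r + C̲₀ + Σ_p C̲_p J⁽ᵖ⁾`, `μ = 2m/r³ + M₀ + Σ_p M_p J⁽ᵖ⁾`
with `C̲₀, C̲_p, M₀, M_p` constant on leaves, `∫_S J⁽ᵖ⁾ div η = 0 = ∫_S J⁽ᵖ⁾ div ξ̲` (`p = 0,+,−`),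
`b_*|_{SP} = −1 − 2m/r`; on `S_*`: `tr χ̲̌ = 0`, `∫_{S_*} J⁽ᵖ⁾ div β = 0`, `∫_{S_*} J⁽±⁾ curl β = 0`. [cite: KlainermanSzeftel2021, TeX l.3907–3937] -/
structure GCMConditions : Prop where
  trχ : ∀ p ∈ 𝓜.SigmaStar, (𝓜.frameStar.val .trX p).re = 2 / 𝓜.r .ext p
  trχbar : ∃ Cb₀ : 𝓜.Pt → ℝ, ∃ Cb : JIdx → 𝓜.Pt → ℝ, 𝓜.LeafConstant Cb₀ ∧ (∀ j, 𝓜.LeafConstant (Cb j)) ∧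
    ∀ p ∈ 𝓜.SigmaStar, (𝓜.frameStar.val .trXb p).re =
      -2 * 𝓜.params.Upsilon (𝓜.r .ext p) / 𝓜.r .ext p + Cb₀ p
        + (Cb .zero p * 𝓜.J .ext .zero p + Cb .plus p * 𝓜.J .ext .plus p + Cb .minus p * 𝓜.J .ext .minus p)
  mu : ∃ M₀ : 𝓜.Pt → ℝ, ∃ Mp : JIdx → 𝓜.Pt → ℝ, 𝓜.LeafConstant M₀ ∧ (∀ j, 𝓜.LeafConstant (Mp j)) ∧
    ∀ p ∈ 𝓜.SigmaStar, (𝓜.frameStar.val .mu p).re =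
      2 * 𝓜.params.m / 𝓜.r .ext p ^ 3 + M₀ p
        + (Mp .zero p * 𝓜.J .ext .zero p + Mp .plus p * 𝓜.J .ext .plus p + Mp .minus p * 𝓜.J .ext .minus p)
  divEta : ∀ p ∈ 𝓜.SigmaStar, ∀ j, 𝓜.frameStar.mode .divEta j p = 0
  divXib : ∀ p ∈ 𝓜.SigmaStar, ∀ j, 𝓜.frameStar.mode .divXib j p = 0
  bstar_SP : ∀ p ∈ 𝓜.SigmaStar ∩ 𝓜.southPoles,
    (𝓜.frameStar.val .bstar p).re = -1 - 2 * 𝓜.params.m / 𝓜.r .ext p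
  /-- on `S_*`: `tr χ̲̌ = tr χ̲ + 2Υ/r = 0` (l.3926) -/
  trχbar_SStar : ∀ p ∈ 𝓜.SStar, (𝓜.frameStar.val .trXbc p).re = 0
  divBeta_SStar : ∀ p ∈ 𝓜.SStar, ∀ j, 𝓜.frameStar.mode .divBeta j p = 0
  curlBeta_SStar : ∀ p ∈ 𝓜.SStar, 𝓜.frameStar.mode .curlBeta .plus p = 0 ∧
    𝓜.frameStar.mode .curlBeta .minus p = 0

/-- **Definition of `(a, m)`** ([KS] l.3940–3951 `\lab{define:am-onSi}`): `m` is the Hawking mass of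
`S_*`, `2m/r_* = 1 + (1/16π) ∫_{S_*} tr χ tr χ̲`, and `a := r_*³/(8πm) ∫_{S_*} J⁽⁰⁾ curl β`. [cite: KlainermanSzeftel2021, TeX l.3940–3951] -/
structure ParamsOfSStar : Prop where
  hawking : 2 * 𝓜.params.m / 𝓜.rStar =
    1 + (1 / (16 * Real.pi)) * 𝓜.intSStar fun p => (𝓜.frameStar.val .trX p).re * (𝓜.frameStar.val .trXb p).re
  angular : 𝓜.params.a =
    𝓜.rStar ^ 3 / (8 * Real.pi * 𝓜.params.m) * 𝓜.intSStar fun p => 𝓜.J .ext .zero p * (𝓜.frameStar.val .curlBeta p).re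

/-- The dominance condition `r_* = δ_* ε₀⁻¹ u_*^{1+δ_dec}` on `S_*` ([KS] l.6104 `\lab{eq:behaviorofronS-star}`; part of
the definition of `ℵ(u_*)`, l.6750–6752). [cite: KlainermanSzeftel2021, TeX l.6104] -/
def Dominance (𝓜 : GCMAdmissible c M) : Prop := 𝓜.rStar = c.δstar * c.ε₀⁻¹ * 𝓜.uStar ^ (1 + c.δdec)

/-! ### §7. Main norms ([KS §3.3], l.5636–5965), valued in `[0, ∞]` (DV-03) -/

section Norms

/-- weight `u^{s}` as an extended nonnegative real [folklore] -/
def wU (s : ℝ) (p : 𝓜.Pt) : ℝ≥0∞ := ENNReal.ofReal (𝓜.u p ^ s)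
/-- weight `ū^{s}` [folklore] -/
def wUbar (s : ℝ) (p : 𝓜.Pt) : ℝ≥0∞ := ENNReal.ofReal (𝓜.ubar p ^ s)
/-- weight `((top)u)^{s}` [folklore] -/
def wUTop (s : ℝ) (p : 𝓜.Pt) : ℝ≥0∞ := ENNReal.ofReal (𝓜.uTop p ^ s)
/-- weight `r^{s}` of region `i` (real exponent) [folklore] -/
def wR (i : Region) (s : ℝ) (p : 𝓜.Pt) : ℝ≥0∞ := ENNReal.ofReal (𝓜.r i p ^ s)

/-- `^*𝔅_k := sup_{Σ_*} { r² |𝔡_*^{≤k} Γ_g^*| + r |𝔡_*^{≤k} Γ_b^*| }` ([KS] l.5718, `k ≥ 0`). [cite: KlainermanSzeftel2021, TeX l.5718] -/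
def BStar (k : ℕ) : ℝ≥0∞ :=
  ⨆ p ∈ 𝓜.SigmaStar,
    (𝓜.wR .ext 2 p * 𝓜.frameStar.size Table.ΓgStar (𝓜.r .ext) k p
      + 𝓜.wR .ext 1 p * (𝓜.frameStar.size Table.ΓbStar (𝓜.r .ext) k p
          + 𝓜.frameStar.sizeInv Table.ΓbStarInv (𝓜.r .ext) k p))

/-- `^*𝔇_k := sup_{Σ_*} { r² u^{1/2+δ} |𝔡_*^{≤k} Γ_g^*| + r² u^{1+δ} |𝔡_*^{≤k−1} ∇_ν Γ_g^*| + r u^{1+δ} |𝔡_*^{≤k} Γ_b^*| }`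
([KS] l.5729), `δ = δ_dec`, `k ≥ 1` (we use truncated `k − 1`, DV-10). [cite: KlainermanSzeftel2021, TeX l.5729] -/
def DStar (k : ℕ) : ℝ≥0∞ :=
  ⨆ p ∈ 𝓜.SigmaStar,
    (𝓜.wR .ext 2 p * 𝓜.wU (1/2 + c.δdec) p * 𝓜.frameStar.size Table.ΓgStar (𝓜.r .ext) k p
      + 𝓜.wR .ext 2 p * 𝓜.wU (1 + c.δdec) p * 𝓜.frameStar.sizeD .nu Table.ΓgStar (𝓜.r .ext) (k - 1) p
      + 𝓜.wR .ext 1 p * 𝓜.wU (1 + c.δdec) p * (𝓜.frameStar.size Table.ΓbStar (𝓜.r .ext) k p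
          + 𝓜.frameStar.sizeInv Table.ΓbStarInv (𝓜.r .ext) k p))

/-- the flux term `(∫_{Σ_*} w |𝔡^{≤k} Ȟ|²)^{1/2}` of the `(ext)` norms (l.5811, l.5826) [cite: KlainermanSzeftel2021, TeX l.5811] -/
def fluxHc (w : 𝓜.Pt → ℝ≥0∞) (k : ℕ) : ℝ≥0∞ :=
  (∫⁻ p in 𝓜.SigmaStar, w p * (𝓜.frame .ext).jet .Hc k p ^ 2 ∂(𝓜.surf .SigmaStar)) ^ (1 / 2 : ℝ)

/-- `^(ext)𝔅_k` ([KS] l.5811 `\lab{equation:defboudednessnormsMext:chap3}`, `k ≥ 1`):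
`sup_{(ext)𝓜} { r²|𝔡^{≤k}Γ_g| + r|𝔡^{≤k}Γ_b| + r^{7/2+δ_B/2}(|𝔡^{≤k}A| + |𝔡^{≤k}B|) + r^{9/2+δ_dec}|𝔡^{≤k−1}∇₃A| + r⁴|𝔡^{≤k−1}∇₃B| } + (∫_{Σ_*}|𝔡^{≤k}Ȟ|²)^{1/2}`.
(NB the exponent `δ_dec` — not `δ_B` — on the `∇₃A` term is verbatim from the source.) [cite: KlainermanSzeftel2021, TeX l.5811] -/
def BExt (k : ℕ) : ℝ≥0∞ :=
  (⨆ p ∈ 𝓜.region .ext,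
    (𝓜.wR .ext 2 p * (𝓜.frame .ext).size Table.ΓgOut (𝓜.r .ext) k p
      + 𝓜.wR .ext 1 p * ((𝓜.frame .ext).size Table.ΓbOut (𝓜.r .ext) k p
          + (𝓜.frame .ext).sizeInv Table.ΓbOutInv (𝓜.r .ext) k p)
      + 𝓜.wR .ext (7/2 + c.δB/2) p * ((𝓜.frame .ext).jet .A k p + (𝓜.frame .ext).jet .B k p)
      + 𝓜.wR .ext (9/2 + c.δdec) p * (𝓜.frame .ext).jetD .e3 .A (k - 1) p
      + 𝓜.wR .ext 4 p * (𝓜.frame .ext).jetD .e3 .B (k - 1) p))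
  + 𝓜.fluxHc (fun _ => 1) k

/-- `^(ext)𝔇_k` ([KS] l.5826 `\lab{equation:defdecaynormsMext:chap3}`, `k ≥ 1`), `δ = δ_dec`:
`sup (ru^{1+δ} + r²u^{1/2+δ})|𝔡^{≤k}Γ_g| + sup ru^{1+δ}|𝔡^{≤k}Γ_b| + sup r⁴u^{1/2+δ}(|𝔡^{≤k−1}∇₃A| + |𝔡^{≤k−1}∇₃B|)
 + sup r²u^{1+δ}|𝔡^{≤k−1}∇₃Γ_g| + (∫_{Σ_*} u^{2+2δ}|𝔡^{≤k}Ȟ|²)^{1/2}`. [cite: KlainermanSzeftel2021, TeX l.5826] -/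
def DExt (k : ℕ) : ℝ≥0∞ :=
  (⨆ p ∈ 𝓜.region .ext,
    (𝓜.wR .ext 1 p * 𝓜.wU (1 + c.δdec) p + 𝓜.wR .ext 2 p * 𝓜.wU (1/2 + c.δdec) p)
      * (𝓜.frame .ext).size Table.ΓgOut (𝓜.r .ext) k p)
  + (⨆ p ∈ 𝓜.region .ext,
    𝓜.wR .ext 1 p * 𝓜.wU (1 + c.δdec) p * ((𝓜.frame .ext).size Table.ΓbOut (𝓜.r .ext) k p
      + (𝓜.frame .ext).sizeInv Table.ΓbOutInv (𝓜.r .ext) k p))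
  + (⨆ p ∈ 𝓜.region .ext,
    𝓜.wR .ext 4 p * 𝓜.wU (1/2 + c.δdec) p
      * ((𝓜.frame .ext).jetD .e3 .A (k - 1) p + (𝓜.frame .ext).jetD .e3 .B (k - 1) p))
  + (⨆ p ∈ 𝓜.region .ext,
    𝓜.wR .ext 2 p * 𝓜.wU (1 + c.δdec) p * (𝓜.frame .ext).sizeD .e3 Table.ΓgOut (𝓜.r .ext) (k - 1) p)
  + 𝓜.fluxHc (fun p => 𝓜.wU (2 + 2 * c.δdec) p) k

/-- `^(int)𝔅_k := sup_{(int)𝓜} { |𝔡^{≤k}Γ_g| + |𝔡^{≤k}Γ_b| }` ([KS] l.5881). [cite: KlainermanSzeftel2021, TeX l.5881] -/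
def BInt (k : ℕ) : ℝ≥0∞ :=
  ⨆ p ∈ 𝓜.region .int,
    ((𝓜.frame .int).size Table.ΓgIn (𝓜.r .int) k p + (𝓜.frame .int).size Table.ΓbIn (𝓜.r .int) k p)

/-- `^(int)𝔇_k := sup_{(int)𝓜} ū^{1+δ_dec} ( |𝔡^{≤k}Γ_g| + |𝔡^{≤k}Γ_b| )` ([KS] l.5894). [cite: KlainermanSzeftel2021, TeX l.5894] -/
def DInt (k : ℕ) : ℝ≥0∞ :=
  ⨆ p ∈ 𝓜.region .int,
    𝓜.wUbar (1 + c.δdec) p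
      * ((𝓜.frame .int).size Table.ΓgIn (𝓜.r .int) k p + (𝓜.frame .int).size Table.ΓbIn (𝓜.r .int) k p)

/-- `^(top)𝔅_k` ([KS] l.5947–5951): as `^(ext)𝔅_k` without the flux term, over `(top)𝓜` (ingoing PG structure),
with the `(top)` tables. [cite: KlainermanSzeftel2021, TeX l.5947–5951] -/
def BTop (k : ℕ) : ℝ≥0∞ :=
  ⨆ p ∈ 𝓜.region .top,
    (𝓜.wR .top 2 p * (𝓜.frame .top).size Table.ΓgTop (𝓜.r .top) k p
      + 𝓜.wR .top 1 p * (𝓜.frame .top).size Table.ΓbTop (𝓜.r .top) k p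
      + 𝓜.wR .top (7/2 + c.δB/2) p * ((𝓜.frame .top).jet .A k p + (𝓜.frame .top).jet .B k p)
      + 𝓜.wR .top (9/2 + c.δdec) p * (𝓜.frame .top).jetD .e3 .A (k - 1) p
      + 𝓜.wR .top 4 p * (𝓜.frame .top).jetD .e3 .B (k - 1) p)

/-- `^(top)𝔇_k = ^(top)𝔇_k^{≤ r₀} + ^(top)𝔇_k^{≥ r₀}` ([KS] l.5976–5985). [cite: KlainermanSzeftel2021, TeX l.5976–5985] -/
def DTop (k : ℕ) : ℝ≥0∞ :=
  (⨆ p ∈ 𝓜.region .top ∩ {p | 𝓜.r .top p ≤ c.r₀},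
    𝓜.wUbar (1 + c.δdec) p
      * ((𝓜.frame .top).size Table.ΓgTop (𝓜.r .top) k p + (𝓜.frame .top).size Table.ΓbTop (𝓜.r .top) k p))
  + (⨆ p ∈ 𝓜.region .top ∩ {p | c.r₀ ≤ 𝓜.r .top p},
    (𝓜.wR .top 1 p * 𝓜.wUTop (1 + c.δdec) p + 𝓜.wR .top 2 p * 𝓜.wUTop (1/2 + c.δdec) p)
      * (𝓜.frame .top).size Table.ΓgTop (𝓜.r .top) k p)
  + (⨆ p ∈ 𝓜.region .top ∩ {p | c.r₀ ≤ 𝓜.r .top p},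
    𝓜.wR .top 1 p * 𝓜.wUTop (1 + c.δdec) p * (𝓜.frame .top).size Table.ΓbTop (𝓜.r .top) k p)
  + (⨆ p ∈ 𝓜.region .top ∩ {p | c.r₀ ≤ 𝓜.r .top p},
    𝓜.wR .top 2 p * 𝓜.wUTop (1 + c.δdec) p * (𝓜.frame .top).sizeD .e3 Table.ΓgTop (𝓜.r .top) (k - 1) p)
  + (⨆ p ∈ 𝓜.region .top ∩ {p | c.r₀ ≤ 𝓜.r .top p},
    𝓜.wR .top 4 p * 𝓜.wUTop (1/2 + c.δdec) p
      * ((𝓜.frame .top).jetD .e3 .A (k - 1) p + (𝓜.frame .top).jetD .e3 .B (k - 1) p))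

/-- **Combined norms** ([KS] l.5990–5997 `\lab{sec:definitionofconcatenatednorm}`):
`𝔑^(Sup)_k := ^*𝔅_k + ^(ext)𝔅_k + ^(int)𝔅_k + ^(top)𝔅_k`. [cite: KlainermanSzeftel2021, TeX l.5990–5997] -/
def NSup (k : ℕ) : ℝ≥0∞ := 𝓜.BStar k + 𝓜.BExt k + 𝓜.BInt k + 𝓜.BTop k

/-- `𝔑^(Dec)_k := ^*𝔇_k + ^(ext)𝔇_k + ^(int)𝔇_k + ^(top)𝔇_k` ([KS] l.5995). [cite: KlainermanSzeftel2021, TeX l.5995] -/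
def NDec (k : ℕ) : ℝ≥0∞ := 𝓜.DStar k + 𝓜.DExt k + 𝓜.DInt k + 𝓜.DTop k

end Norms

/-! ### §8. Bootstrap assumptions and the set `ℵ(u_*)` ([KS §3.5] l.6345–6366; Def. l.6744–6760) -/

/-- `ε` as an extended nonnegative real ([KS] l.6345–6366) [cite: KlainermanSzeftel2021, TeX l.6345–6366] -/
def epsE (c : Constants) : ℝ≥0∞ := ENNReal.ofReal c.ε

/-- **BA-B** ([KS] l.6354 `\lab{def:bootstrapasumptionsglobalnormonenergie}`): `𝔑^(Sup)_{k_large} + |m − m₀| + |a − a₀| ≤ ε`. [cite: KlainermanSzeftel2021, TeX l.6354] -/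
def BootstrapB (𝓜 : GCMAdmissible c M) : Prop :=
  𝓜.NSup c.kLarge + ENNReal.ofReal (|𝓜.params.m - c.m₀| + |𝓜.params.a - c.a₀|) ≤ epsE c

/-- **BA-D** ([KS] l.6361 `\lab{def:bootstrapasumptionsglobalnormondecay}`): `𝔑^(Dec)_{k_small} ≤ ε`. [cite: KlainermanSzeftel2021, TeX l.6361] -/
def BootstrapD (𝓜 : GCMAdmissible c M) : Prop := 𝓜.NDec c.kSmall ≤ epsE c

/-- `𝓜 ∈ ℵ(u_*)` ([KS] l.6744–6756 `\lab{definition:UU(u_*)}`): `u_*` is the value of `u` on `S_*`, the dominance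
condition l.6104 holds, and `𝔑^(Sup)_{k_large} ≤ ε`, `𝔑^(Dec)_{k_small} ≤ ε` (footnote l.6753: "i.e. the bootstrap
assumptions … hold true"; the `|m−m₀|+|a−a₀| ≤ ε` part of BA-B (l.6354) is not repeated in the source's definition —
recorded as source remark SRC-01 in DIVERGENCE.md; we follow BA-B). [cite: KlainermanSzeftel2021, TeX l.6744–6756] -/
structure InAleph (uStar : ℝ) : Prop where
  uStar_eq : 𝓜.uStar = uStar
  dominance : 𝓜.Dominance
  baB : 𝓜.BootstrapB
  baD : 𝓜.BootstrapD

end GCMAdmissible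

/-- `𝒰 := {u_* ≥ 0 | ℵ(u_*) ≠ ∅}` ([KS] l.6758–6760: "the set of all values of `u_* ≥ 0` for which the spacetime
`ℵ(u_*)` exists"). The opaque predicate `Realized` carries the unmodelled physical content ("`𝓜` is a piece of
the Einstein-vacuum development of the given initial data layer, with `𝓑₁ ∪ 𝓑̲₁ ⊂ 𝓛₀`", DV-11); node statements
quantify over it. [cite: KlainermanSzeftel2021, TeX l.6758–6760] -/
def 𝒰 (c : Constants) (M : Spacetime) (Realized : GCMAdmissible c M → Prop) : Set ℝ :=
  {u | 0 ≤ u ∧ ∃ 𝓜 : GCMAdmissible c M, Realized 𝓜 ∧ 𝓜.InAleph u}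

/-! ### §9. Bookkeeping lemmas every node may use (pure order theory on the schematic norms) -/

namespace GCMAdmissible

variable {c : Constants} {M : Spacetime} (𝓜 : GCMAdmissible c M)

/-- `^*𝔅_k` is monotone in `k`. [folklore] -/
theorem BStar_mono : Monotone 𝓜.BStar := by
  intro k l hkl
  simp only [BStar]
  refine iSup₂_mono fun p _ => add_le_add ?_ ?_
  · exact mul_le_mul' le_rfl (𝓜.frameStar.size_mono _ _ p hkl)
  · exact mul_le_mul' le_rfl (add_le_add (𝓜.frameStar.size_mono _ _ p hkl)
      (𝓜.frameStar.sizeInv_mono _ _ p hkl))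

/-- `^*𝔇_k` is monotone in `k`. [folklore] -/
theorem DStar_mono : Monotone 𝓜.DStar := by
  intro k l hkl
  simp only [DStar]
  refine iSup₂_mono fun p _ => add_le_add (add_le_add ?_ ?_) ?_
  · exact mul_le_mul' le_rfl (𝓜.frameStar.size_mono _ _ p hkl)
  · exact mul_le_mul' le_rfl (𝓜.frameStar.sizeD_mono _ _ _ p (Nat.sub_le_sub_right hkl 1))
  · exact mul_le_mul' le_rfl (add_le_add (𝓜.frameStar.size_mono _ _ p hkl)
      (𝓜.frameStar.sizeInv_mono _ _ p hkl))

/-- the `Ȟ` flux term is monotone in `k`. [folklore] -/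
theorem fluxHc_mono (w : 𝓜.Pt → ℝ≥0∞) : Monotone (𝓜.fluxHc w) := by
  intro k l hkl
  simp only [fluxHc]
  refine ENNReal.rpow_le_rpow ?_ (by norm_num)
  refine lintegral_mono fun p => mul_le_mul' le_rfl ?_
  exact pow_le_pow_left' ((𝓜.frame .ext).jet_mono .Hc p hkl) 2

/-- `^(ext)𝔅_k` is monotone in `k`. [folklore] -/
theorem BExt_mono : Monotone 𝓜.BExt := by
  intro k l hkl
  simp only [BExt]
  refine add_le_add (iSup₂_mono fun p _ => ?_) (𝓜.fluxHc_mono _ hkl)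
  have h1 := (𝓜.frame .ext).size_mono Table.ΓgOut (𝓜.r .ext) p hkl
  have h2 := (𝓜.frame .ext).size_mono Table.ΓbOut (𝓜.r .ext) p hkl
  have h3 := (𝓜.frame .ext).sizeInv_mono Table.ΓbOutInv (𝓜.r .ext) p hkl
  have h4 := (𝓜.frame .ext).jet_mono .A p hkl
  have h5 := (𝓜.frame .ext).jet_mono .B p hkl
  have h6 := (𝓜.frame .ext).jetD_mono .e3 .A p (Nat.sub_le_sub_right hkl 1)
  have h7 := (𝓜.frame .ext).jetD_mono .e3 .B p (Nat.sub_le_sub_right hkl 1)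
  gcongr

/-- `^(ext)𝔇_k` is monotone in `k`. [folklore] -/
theorem DExt_mono : Monotone 𝓜.DExt := by
  intro k l hkl
  simp only [DExt]
  have hk1 : k - 1 ≤ l - 1 := Nat.sub_le_sub_right hkl 1
  refine add_le_add (add_le_add (add_le_add (add_le_add ?_ ?_) ?_) ?_) (𝓜.fluxHc_mono _ hkl)
  · exact iSup₂_mono fun p _ => mul_le_mul' le_rfl ((𝓜.frame .ext).size_mono _ _ p hkl)
  · exact iSup₂_mono fun p _ => mul_le_mul' le_rfl (add_le_add ((𝓜.frame .ext).size_mono _ _ p hkl)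
      ((𝓜.frame .ext).sizeInv_mono _ _ p hkl))
  · exact iSup₂_mono fun p _ => mul_le_mul' le_rfl (add_le_add ((𝓜.frame .ext).jetD_mono _ _ p hk1)
      ((𝓜.frame .ext).jetD_mono _ _ p hk1))
  · exact iSup₂_mono fun p _ => mul_le_mul' le_rfl ((𝓜.frame .ext).sizeD_mono _ _ _ p hk1)

/-- `^(top)𝔅_k` is monotone in `k`. [folklore] -/
theorem BTop_mono : Monotone 𝓜.BTop := by
  intro k l hkl
  simp only [BTop]
  refine iSup₂_mono fun p _ => ?_
  have h1 := (𝓜.frame .top).size_mono Table.ΓgTop (𝓜.r .top) p hkl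
  have h2 := (𝓜.frame .top).size_mono Table.ΓbTop (𝓜.r .top) p hkl
  have h4 := (𝓜.frame .top).jet_mono .A p hkl
  have h5 := (𝓜.frame .top).jet_mono .B p hkl
  have h6 := (𝓜.frame .top).jetD_mono .e3 .A p (Nat.sub_le_sub_right hkl 1)
  have h7 := (𝓜.frame .top).jetD_mono .e3 .B p (Nat.sub_le_sub_right hkl 1)
  gcongr

/-- `^(top)𝔇_k` is monotone in `k`. [folklore] -/
theorem DTop_mono : Monotone 𝓜.DTop := by
  intro k l hkl
  simp only [DTop]
  have hk1 : k - 1 ≤ l - 1 := Nat.sub_le_sub_right hkl 1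
  refine add_le_add (add_le_add (add_le_add (add_le_add ?_ ?_) ?_) ?_) ?_
  · exact iSup₂_mono fun p _ => mul_le_mul' le_rfl (add_le_add ((𝓜.frame .top).size_mono _ _ p hkl)
      ((𝓜.frame .top).size_mono _ _ p hkl))
  · exact iSup₂_mono fun p _ => mul_le_mul' le_rfl ((𝓜.frame .top).size_mono _ _ p hkl)
  · exact iSup₂_mono fun p _ => mul_le_mul' le_rfl ((𝓜.frame .top).size_mono _ _ p hkl)
  · exact iSup₂_mono fun p _ => mul_le_mul' le_rfl ((𝓜.frame .top).sizeD_mono _ _ _ p hk1)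
  · exact iSup₂_mono fun p _ => mul_le_mul' le_rfl (add_le_add ((𝓜.frame .top).jetD_mono _ _ p hk1)
      ((𝓜.frame .top).jetD_mono _ _ p hk1))

/-- `^(int)𝔅_k` is monotone in `k`. [folklore] -/
theorem BInt_mono : Monotone 𝓜.BInt := by
  intro k l hkl
  simp only [BInt]
  exact iSup₂_mono fun p _ => add_le_add ((𝓜.frame .int).size_mono _ _ p hkl)
    ((𝓜.frame .int).size_mono _ _ p hkl)

/-- `^(int)𝔇_k` is monotone in `k`. [folklore] -/
theorem DInt_mono : Monotone 𝓜.DInt := by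
  intro k l hkl
  simp only [DInt]
  exact iSup₂_mono fun p _ => mul_le_mul' le_rfl (add_le_add ((𝓜.frame .int).size_mono _ _ p hkl)
    ((𝓜.frame .int).size_mono _ _ p hkl))

/-- `𝔑^(Sup)_k` is monotone in `k` (the norms are suprema over `𝔡^{≤k}`). [folklore] -/
theorem NSup_mono : Monotone 𝓜.NSup := fun _ _ h =>
  add_le_add (add_le_add (add_le_add (𝓜.BStar_mono h) (𝓜.BExt_mono h)) (𝓜.BInt_mono h)) (𝓜.BTop_mono h)

/-- `𝔑^(Dec)_k` is monotone in `k`. [folklore] -/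
theorem NDec_mono : Monotone 𝓜.NDec := fun _ _ h =>
  add_le_add (add_le_add (add_le_add (𝓜.DStar_mono h) (𝓜.DExt_mono h)) (𝓜.DInt_mono h)) (𝓜.DTop_mono h)

end GCMAdmissible

/-! ### §10. Generic norm builders (component-restricted norms such as `^(int)𝔇_k[α̲]`, `sup_{𝓑₁} |𝔡^k A|`,
`∫_{Σ_*(≥u)} …` used by Theorems M0–M5 are assembled from these by the node statements) -/

namespace GCMAdmissible

variable {c : Constants} {M : Spacetime} (𝓜 : GCMAdmissible c M)

/-- `sup_{S} w |𝔡^{≤k} ψ|` for a frame `F`, a set of events `S`, a weight `w`. [folklore] -/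
def supNorm (S : Set 𝓜.Pt) (F : FrameData 𝓜.Pt) (w : 𝓜.Pt → ℝ≥0∞) (ψ : Qty) (k : ℕ) : ℝ≥0∞ :=
  ⨆ p ∈ S, w p * F.jet ψ k p

/-- `sup_{S} w |𝔡^{≤k} ∇_d ψ|`. [folklore] -/
def supNormD (S : Set 𝓜.Pt) (F : FrameData 𝓜.Pt) (w : 𝓜.Pt → ℝ≥0∞) (d : Dir) (ψ : Qty) (k : ℕ) : ℝ≥0∞ :=
  ⨆ p ∈ S, w p * F.jetD d ψ k p

/-- `∫_{S} w |𝔡^{≤k} ψ|²` against the induced measure of the named hypersurface `h` (no square root). [folklore] -/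
def fluxNorm (h : Hsurf) (S : Set 𝓜.Pt) (F : FrameData 𝓜.Pt) (w : 𝓜.Pt → ℝ≥0∞) (ψ : Qty) (k : ℕ) : ℝ≥0∞ :=
  ∫⁻ p in S, w p * F.jet ψ k p ^ 2 ∂(𝓜.surf h)

/-- `Σ_*(≥ u₀) := Σ_* ∩ {u ≥ u₀}` (flux on the late part of `Σ_*`, Theorem M1 l.6681). [cite: KlainermanSzeftel2021, TeX l.6681] -/
def SigmaStarGe (u₀ : ℝ) : Set 𝓜.Pt := {p ∈ 𝓜.SigmaStar | u₀ ≤ 𝓜.u p}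

/-- `(ext)𝓜(r ≤ u^{1/2})`, where the second frame of `(ext)𝓜` coincides with the PG frame (l.6467). [cite: KlainermanSzeftel2021, TeX l.6467] -/
def extNear : Set 𝓜.Pt := {p ∈ 𝓜.region .ext | 𝓜.r .ext p ≤ Real.sqrt (𝓜.u p)}

/-- `supNorm S F w ψ k` is monotone in `k`. [folklore] -/
theorem supNorm_mono (S : Set 𝓜.Pt) (F : FrameData 𝓜.Pt) (w : 𝓜.Pt → ℝ≥0∞) (ψ : Qty) :
    Monotone (𝓜.supNorm S F w ψ) := by
  intro k l hkl
  simp only [supNorm]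
  exact iSup₂_mono fun p _ => mul_le_mul' le_rfl (F.jet_mono ψ p hkl)

/-- `supNorm` is monotone in the region. [folklore] -/
theorem supNorm_mono_set {S S' : Set 𝓜.Pt} (h : S ⊆ S') (F : FrameData 𝓜.Pt) (w : 𝓜.Pt → ℝ≥0∞) (ψ : Qty)
    (k : ℕ) : 𝓜.supNorm S F w ψ k ≤ 𝓜.supNorm S' F w ψ k := by
  simp only [supNorm]
  exact iSup_le fun p => iSup_le fun hp => le_iSup₂ (f := fun p _ => w p * F.jet ψ k p) p (h hp)

end GCMAdmissible

/-! ### §11. The initial data layer `𝓛₀ = (ext)𝓛₀ ∪ (int)𝓛₀` and its norm `ℑ_k` ([KS §3.1], l.4982–5210; §3.3.7,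
l.6002–6036). Linearizations in `𝓛₀` are taken w.r.t. the INITIAL parameters `(a₀, m₀)` (l.6008). -/

/-- The initial data layer `𝓛₀(a₀, m₀)` on the ambient carrier `M`: two regions with an outgoing, resp. ingoing,
PG structure `(u_{𝓛₀}, (ext)r_{𝓛₀})`, `(ū_{𝓛₀}, (int)r_{𝓛₀})` (l.5060–5118), their frames, and the transition
coefficients `(f, f̲, log(λ₀⁻¹λ))` between the two frames on `(ext)𝓛₀ ∩ (int)𝓛₀` (l.6019–6030). [cite: KlainermanSzeftel2021, TeX l.5060–5118] -/
structure InitialDataLayer (c : Constants) (M : Spacetime) where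
  /-- `(ext)𝓛₀` -/
  Lext : Set M.Pt
  /-- `(int)𝓛₀` -/
  Lint : Set M.Pt
  /-- `u_{𝓛₀}` (`L₀(u_{𝓛₀}) = 0`), `0 ≤ u_{𝓛₀} ≤ 3` between `𝓑_{(0,0)}` and `𝓑_{(3,0)}` (l.5077) -/
  u₀ : M.Pt → ℝ
  /-- `ū_{𝓛₀}` (l.5094) -/
  ubar₀ : M.Pt → ℝ
  /-- `(ext)r_{𝓛₀}` (`≥ r₀ − 1`, l.5083) -/
  rExt₀ : M.Pt → ℝ
  /-- `(int)r_{𝓛₀}` (`r₊⁽⁰⁾(1 − 2δ_ℋ) ≤ (int)r_{𝓛₀} ≤ r₀ + 1`, l.5107–5118) -/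
  rInt₀ : M.Pt → ℝ
  /-- the outgoing PG frame of `(ext)𝓛₀` (linearized w.r.t. `(a₀, m₀)`) -/
  frameExt : FrameData M.Pt
  /-- the ingoing PG frame of `(int)𝓛₀` -/
  frameInt : FrameData M.Pt
  /-- sizes of the transition coefficients `(f, f̲, log(λ₀⁻¹λ))` from `frameExt` to `frameInt` on `Lext ∩ Lint`,
  read through the symbols `Qty.f, Qty.fb, Qty.loglam` -/
  trans : FrameData M.Pt
  /-- `(ext)𝓛₀ ∩ (int)𝓛₀ ≠ ∅` (l.4994) -/
  overlap : (Lext ∩ Lint).Nonempty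
  /-- `𝓑_{(0,0)} = {u_{𝓛₀} = 0}`, `𝓑_{(3,0)} = {u_{𝓛₀} = 3}` bound `(ext)𝓛₀` (l.5077) -/
  u₀_range : ∀ p ∈ Lext, 0 ≤ u₀ p ∧ u₀ p ≤ 3
  ubar₀_range : ∀ p ∈ Lint, 0 ≤ ubar₀ p ∧ ubar₀ p ≤ 3
  /-- `(ext)r_{𝓛₀} ≥ r₀ − 1` on `(ext)𝓛₀` (l.5083); `(int)r_{𝓛₀} ≤ r₀ + 1` on `(int)𝓛₀` (l.5118) -/
  rExt₀_lb : ∀ p ∈ Lext, c.r₀ - 1 ≤ rExt₀ p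
  rInt₀_ub : ∀ p ∈ Lint, rInt₀ p ≤ c.r₀ + 1
  /-- `𝓐₀ = {(int)r_{𝓛₀} = r₊⁽⁰⁾(1 − 2δ_ℋ)}` bounds `(int)𝓛₀` (l.5107) -/
  rInt₀_lb : ∀ p ∈ Lint, c.init.rPlus * (1 - 2 * c.δH) ≤ rInt₀ p

namespace InitialDataLayer

variable {c : Constants} {M : Spacetime} (𝓛 : InitialDataLayer c M)

/-- `^(ext)ℑ_k := sup_{(ext)𝓛₀} { r²|𝔡^{≤k}Γ_g| + r|𝔡^{≤k}Γ_b| + r^{7/2+δ_B/2}(|𝔡^{≤k}A| + |𝔡^{≤k}B|) }` (l.6014,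
higher `k` by l.6030: "replacing each component by `𝔡^{≤k}` of it"). [cite: KlainermanSzeftel2021, TeX l.6014] -/
def IExt (k : ℕ) : ℝ≥0∞ :=
  ⨆ p ∈ 𝓛.Lext,
    (ENNReal.ofReal (𝓛.rExt₀ p ^ 2) * 𝓛.frameExt.size Table.ΓgOut 𝓛.rExt₀ k p
      + ENNReal.ofReal (𝓛.rExt₀ p) * (𝓛.frameExt.size Table.ΓbOut 𝓛.rExt₀ k p
          + 𝓛.frameExt.sizeInv Table.ΓbOutInv 𝓛.rExt₀ k p)
      + ENNReal.ofReal (𝓛.rExt₀ p ^ (7/2 + c.δB/2))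
          * (𝓛.frameExt.jet .A k p + 𝓛.frameExt.jet .B k p))

/-- `^(int)ℑ_k := sup_{(int)𝓛₀} { |𝔡^{≤k}Γ_g| + |𝔡^{≤k}Γ_b| }` (l.6018). [cite: KlainermanSzeftel2021, TeX l.6018] -/
def IInt (k : ℕ) : ℝ≥0∞ :=
  ⨆ p ∈ 𝓛.Lint, (𝓛.frameInt.size Table.ΓgIn 𝓛.rInt₀ k p + 𝓛.frameInt.size Table.ΓbIn 𝓛.rInt₀ k p)

/-- `ℑ'_k := sup_{(int)𝓛₀ ∩ (ext)𝓛₀} ( |𝔡^{≤k}f| + |𝔡^{≤k}f̲| + |𝔡^{≤k} log(λ₀⁻¹λ)| )` (l.6021). [cite: KlainermanSzeftel2021, TeX l.6021] -/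
def IPrime (k : ℕ) : ℝ≥0∞ :=
  ⨆ p ∈ 𝓛.Lext ∩ 𝓛.Lint, (𝓛.trans.jet .f k p + 𝓛.trans.jet .fb k p + 𝓛.trans.jet .loglam k p)

/-- **The initial layer norm** `ℑ_k := ^(ext)ℑ_k + ^(int)ℑ_k + ℑ'_k` ([KS] l.6009–6011). [cite: KlainermanSzeftel2021, TeX l.6009–6011] -/
def I (k : ℕ) : ℝ≥0∞ := 𝓛.IExt k + 𝓛.IInt k + 𝓛.IPrime k

/-- `𝓛₀` is `(ε₀, k)`-admissible: `ℑ_k ≤ ε₀²` ([KS] l.6133–6141 `\lab{def:ep0kadmissibleLL0region}`; the causal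
part "lies in the future of an asymptotically flat initial data set of ADM mass `m₀` and angular momentum `a₀`"
is unmodelled, DV-11). [cite: KlainermanSzeftel2021, TeX l.6133–6141] -/
def Admissible (k : ℕ) : Prop := 𝓛.I k ≤ ENNReal.ofReal (c.ε₀ ^ 2)

/-- `𝓑₁ ∪ 𝓑̲₁ ⊂ 𝓛₀` for a GCM admissible `𝓜` on the same carrier ([KS] l.5251). [cite: KlainermanSzeftel2021, TeX l.5251] -/
def ContainsPastBoundaryOf (𝓜 : GCMAdmissible c M) : Prop :=
  𝓜.hsurf .B1 ∪ 𝓜.hsurf .B1bar ⊆ 𝓛.Lext ∪ 𝓛.Lint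

end InitialDataLayer

/-! ### §12. Admissible future null complete spacetimes `𝓜_∞ = (ext)𝓜_∞ ∪ (int)𝓜_∞` ([KS] l.6126–6195,
`\lab{Definition:admissible.futurenullcomplete}`) and the norms `𝔑^(Sup)_k(a_∞, m_∞)`, `𝔑^(Dec)_k(a_∞, m_∞)`. -/

/-- The conclusion object of the Main Theorem: `𝓜 = (ext)𝓜 ∪ (int)𝓜`, `𝒯 = (ext)𝓜 ∩ (int)𝓜 = {r = r₀}`,
outgoing PG structure `(u, r)` on `(ext)𝓜`, ingoing on `(int)𝓜` (l.6169–6184). The frames are indexed by the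
parameters `(a, m)` w.r.t. which the linearized quantities are formed, since the theorem chooses `(a_∞, m_∞)`
a posteriori (l.6189–6195). Completeness of `𝓘⁺`, vacuum, "development of `𝓛₀`" are unmodelled (DV-11). [cite: KlainermanSzeftel2021, TeX l.6169–6184] -/
structure FutureDevelopment (c : Constants) (M : Spacetime) where
  /-- `(ext)𝓜_∞`, `(int)𝓜_∞` (`top` unused: `region .top = ∅`) -/
  region : Region → Set M.Pt
  top_empty : region .top = ∅
  /-- `𝒯 = (ext)𝓜 ∩ (int)𝓜 = {r = r₀}` -/
  T : Set M.Pt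
  T_eq : T = region .ext ∩ region .int
  u : M.Pt → ℝ
  ubar : M.Pt → ℝ
  r : Region → M.Pt → ℝ
  T_level : ∀ p ∈ T, r .ext p = c.r₀
  one_le_u : ∀ p ∈ region .ext, 1 ≤ u p
  /-- PG frame of each region, its quantities linearized w.r.t. the parameters `p` -/
  frameAt : KerrParams → Region → FrameData M.Pt

namespace FutureDevelopment

variable {c : Constants} {M : Spacetime} (𝓜 : FutureDevelopment c M)

/-- `𝔑^(Sup)_k(a_∞, m_∞)` on `𝓜_∞`: the `(ext)` and `(int)` boundedness norms of §7 with `(a, m) := pInf` and no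
`(top)` part (footnote l.6190); the `Σ_*`-flux and `^*𝔅` parts are absent since `𝓜_∞` has no `Σ_*` (SRC-03). [cite: KlainermanSzeftel2021, TeX l.6190] -/
def NSup (pInf : KerrParams) (k : ℕ) : ℝ≥0∞ :=
  (⨆ p ∈ 𝓜.region .ext,
    (ENNReal.ofReal (𝓜.r .ext p ^ 2) * (𝓜.frameAt pInf .ext).size Table.ΓgOut (𝓜.r .ext) k p
      + ENNReal.ofReal (𝓜.r .ext p) * ((𝓜.frameAt pInf .ext).size Table.ΓbOut (𝓜.r .ext) k p
          + (𝓜.frameAt pInf .ext).sizeInv Table.ΓbOutInv (𝓜.r .ext) k p)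
      + ENNReal.ofReal (𝓜.r .ext p ^ (7/2 + c.δB/2))
          * ((𝓜.frameAt pInf .ext).jet .A k p + (𝓜.frameAt pInf .ext).jet .B k p)
      + ENNReal.ofReal (𝓜.r .ext p ^ (9/2 + c.δdec)) * (𝓜.frameAt pInf .ext).jetD .e3 .A (k - 1) p
      + ENNReal.ofReal (𝓜.r .ext p ^ (4 : ℝ)) * (𝓜.frameAt pInf .ext).jetD .e3 .B (k - 1) p))
  + (⨆ p ∈ 𝓜.region .int,
    ((𝓜.frameAt pInf .int).size Table.ΓgIn (𝓜.r .int) k p + (𝓜.frameAt pInf .int).size Table.ΓbIn (𝓜.r .int) k p))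

/-- `𝔑^(Dec)_k(a_∞, m_∞)` on `𝓜_∞` (same conventions; [KS] l.6126–6195). [cite: KlainermanSzeftel2021, TeX l.6126–6195] -/
def NDec (pInf : KerrParams) (k : ℕ) : ℝ≥0∞ :=
  (⨆ p ∈ 𝓜.region .ext,
    (ENNReal.ofReal (𝓜.r .ext p * 𝓜.u p ^ (1 + c.δdec))
        + ENNReal.ofReal (𝓜.r .ext p ^ 2 * 𝓜.u p ^ (1/2 + c.δdec)))
      * (𝓜.frameAt pInf .ext).size Table.ΓgOut (𝓜.r .ext) k p)
  + (⨆ p ∈ 𝓜.region .ext,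
    ENNReal.ofReal (𝓜.r .ext p * 𝓜.u p ^ (1 + c.δdec))
      * ((𝓜.frameAt pInf .ext).size Table.ΓbOut (𝓜.r .ext) k p
          + (𝓜.frameAt pInf .ext).sizeInv Table.ΓbOutInv (𝓜.r .ext) k p))
  + (⨆ p ∈ 𝓜.region .ext,
    ENNReal.ofReal (𝓜.r .ext p ^ 4 * 𝓜.u p ^ (1/2 + c.δdec))
      * ((𝓜.frameAt pInf .ext).jetD .e3 .A (k - 1) p + (𝓜.frameAt pInf .ext).jetD .e3 .B (k - 1) p))
  + (⨆ p ∈ 𝓜.region .ext,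
    ENNReal.ofReal (𝓜.r .ext p ^ 2 * 𝓜.u p ^ (1 + c.δdec))
      * (𝓜.frameAt pInf .ext).sizeD .e3 Table.ΓgOut (𝓜.r .ext) (k - 1) p)
  + (⨆ p ∈ 𝓜.region .int,
    ENNReal.ofReal (𝓜.ubar p ^ (1 + c.δdec))
      * ((𝓜.frameAt pInf .int).size Table.ΓgIn (𝓜.r .int) k p
          + (𝓜.frameAt pInf .int).size Table.ΓbIn (𝓜.r .int) k p))

/-- The Main Theorem's quantitative conclusion ([KS] l.6214–6219 `\lab{def:bootstrapasumptionsglobalnorms}`):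
`𝔑^(Sup)_{k_large} + 𝔑^(Dec)_{k_small} + |a_∞ − a₀| + |m_∞ − m₀| ≤ C ε₀`. [cite: KlainermanSzeftel2021, TeX l.6214–6219] -/
def FinalBounds (pInf : KerrParams) (C : ℝ) : Prop :=
  𝓜.NSup pInf c.kLarge + 𝓜.NDec pInf c.kSmall + ENNReal.ofReal (|pInf.a - c.a₀| + |pInf.m - c.m₀|)
    ≤ ENNReal.ofReal (C * c.ε₀)

end FutureDevelopment

/-! ### §13. The displayed left-hand sides of Theorems M0, M1, M2 ([KS] l.6649–6697) as terms over the schematic norms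

These are the `ℝ≥0∞` quantities whose reading in `ℝ` (through `Bootstrap.trunc`) instantiates the opaque functionals
`m0Ext, m0Int, m1Sup, m1Flux, m1A, m2Dec, m2Flux` of `Literature.Geometry.Lorentzian.KlainermanSzeftel2021.Bootstrap.Setting` (instantiated by the cell's staged `Bridge.lean`). Conventions:
(a) every display `max_{0 ≤ k ≤ K} (…)` is the term at `k = K`, jets being cumulative (DV-09), with the truncated `K − 1` on the
`𝔡^{k−1}∇₃` terms (DV-10); (b) a display `sup_S [t₁ + … + t_n]` is typed as `sup_S t₁ + … + sup_S t_n` (DIVERGENCE DV-13: equivalent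
up to the factor `n ≤ 6`, invisible under `≲`); (c) the `u`-range of `sup_u u^{2+2δ} ∫_{Σ_*(≥u)}` is `u ≥ 1` (DV-13: `u ≥ 1` on
`(ext)𝓜 ⊇ Σ_*`, and `u < 1` is dominated by `u = 1`). -/

namespace GCMAdmissible

variable {c : Constants} {M : Spacetime} (𝓜 : GCMAdmissible c M)

/-- `∫_{S} w |𝔡^{≤k} ∇_d ψ|²` against the induced measure of the named hypersurface `h`. [folklore] -/
def fluxNormD (h : Hsurf) (S : Set 𝓜.Pt) (F : FrameData 𝓜.Pt) (w : 𝓜.Pt → ℝ≥0∞) (d : Dir) (ψ : Qty) (k : ℕ) :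
    ℝ≥0∞ :=
  ∫⁻ p in S, w p * F.jetD d ψ k p ^ 2 ∂(𝓜.surf h)

/-- `𝓑₁`, the outgoing past boundary, `= {u = 1}` ([KS] l.5250, l.5302) [cite: KlainermanSzeftel2021, TeX l.5250] -/
abbrev B1 : Set 𝓜.Pt := 𝓜.hsurf .B1
/-- `𝓑̲₁`, the ingoing past boundary ([KS] l.5250–5254) [cite: KlainermanSzeftel2021, TeX l.5250–5254] -/
abbrev B1bar : Set 𝓜.Pt := 𝓜.hsurf .B1bar

/-- **Theorem M0, first display** ([KS] l.6654–6657), at `k = k_large − 2`, outgoing PG frame of `(ext)𝓜` on `𝓑₁`: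
`sup_{𝓑₁} [ r^{7/2+δ_B}(|𝔡^k A| + |𝔡^k B|) + r^{9/2+δ_B}|𝔡^{k−1}∇₃A| ] + sup_{𝓑₁} [ r³|𝔡^k(P + 2m/q³)| + r²|𝔡^k B̲| + r|𝔡^k A̲| ]`
(NB `δ_B`, not the `δ_B/2` of `^(ext)𝔅_k`; verbatim). [cite: KlainermanSzeftel2021, TeX l.6654–6657] -/
def M0Ext : ℝ≥0∞ :=
  let k := c.kLarge - 2
  let F := 𝓜.frame .ext
  𝓜.supNorm 𝓜.B1 F (𝓜.wR .ext (7/2 + c.δB)) .A k + 𝓜.supNorm 𝓜.B1 F (𝓜.wR .ext (7/2 + c.δB)) .B k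
    + 𝓜.supNormD 𝓜.B1 F (𝓜.wR .ext (9/2 + c.δB)) .e3 .A (k - 1)
    + 𝓜.supNorm 𝓜.B1 F (𝓜.wR .ext 3) .Pc k + 𝓜.supNorm 𝓜.B1 F (𝓜.wR .ext 2) .Bb k
    + 𝓜.supNorm 𝓜.B1 F (𝓜.wR .ext 1) .Ab k

/-- **Theorem M0, second display** ([KS] l.6659–6662), at `k = k_large − 2`, ingoing PG frame of `(int)𝓜` on `𝓑̲₁`:
`sup_{𝓑̲₁} [ |𝔡^k A| + |𝔡^k B| + |𝔡^k(P + 2m/q³)| + |𝔡^k B̲| + |𝔡^k A̲| ]` (unweighted: `r ≤ r₀` there). [cite: KlainermanSzeftel2021, TeX l.6659–6662] -/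
def M0Int : ℝ≥0∞ :=
  let k := c.kLarge - 2
  let F := 𝓜.frame .int
  𝓜.supNorm 𝓜.B1bar F (fun _ => 1) .A k + 𝓜.supNorm 𝓜.B1bar F (fun _ => 1) .B k
    + 𝓜.supNorm 𝓜.B1bar F (fun _ => 1) .Pc k + 𝓜.supNorm 𝓜.B1bar F (fun _ => 1) .Bb k
    + 𝓜.supNorm 𝓜.B1bar F (fun _ => 1) .Ab k

/-- **Theorem M0, third display** ([KS] l.6664–6666): `sup_{𝓑₁ ∪ 𝓑̲₁} (|m − m₀| + |a − a₀|)` — `(m, a)` are the constants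
of `𝓜` (those of `S_*`, l.5458), so the sup is the number itself. [cite: KlainermanSzeftel2021, TeX l.6664–6666] -/
def paramDev : ℝ := |𝓜.params.m - c.m₀| + |𝓜.params.a - c.a₀|

/-- the level `k_small + 100` of Theorem M1 ([KS] l.6676) [cite: KlainermanSzeftel2021, TeX l.6676] -/
def kM1 (c : Constants) : ℕ := c.kSmall + 100

/-- **Theorem M1 (1), first display** ([KS] l.6676–6679), for a candidate `δ_extra = δe`, in the GLOBAL frame (where `𝔮` lives,
l.6384): `sup_{(ext)𝓜} { (r u^{1/2+δe} + u^{1+δe}) |𝔡^k 𝔮| + r u^{1+δe} |𝔡^{k−1}∇₃𝔮| } + sup_{(int)𝓜 ∪ (top)𝓜} ū^{1+δe} |𝔡^k 𝔮|`,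
`k = k_small + 100`. [cite: KlainermanSzeftel2021, TeX l.6676–6679] -/
def M1Sup (δe : ℝ) : ℝ≥0∞ :=
  let k := kM1 c
  𝓜.supNorm (𝓜.region .ext) 𝓜.frameGlo (fun p => 𝓜.wR .ext 1 p * 𝓜.wU (1/2 + δe) p + 𝓜.wU (1 + δe) p) .qf k
    + 𝓜.supNormD (𝓜.region .ext) 𝓜.frameGlo (fun p => 𝓜.wR .ext 1 p * 𝓜.wU (1 + δe) p) .e3 .qf (k - 1)
    + 𝓜.supNorm (𝓜.region .int ∪ 𝓜.region .top) 𝓜.frameGlo (𝓜.wUbar (1 + δe)) .qf k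

/-- **Theorem M1 (1), second display** ([KS] l.6681–6683): `sup_{u ≥ 1} u^{2+2δe} ∫_{Σ_*(≥ u)} |𝔡^{k−1}∇₃𝔮|²`, `k = k_small + 100`
(the source bounds it by `ε₀²`). [cite: KlainermanSzeftel2021, TeX l.6681–6683] -/
def M1Flux (δe : ℝ) : ℝ≥0∞ :=
  ⨆ u₀ ∈ Set.Ici (1 : ℝ),
    ENNReal.ofReal (u₀ ^ (2 + 2 * δe)) * 𝓜.fluxNormD .SigmaStar (𝓜.SigmaStarGe u₀) 𝓜.frameGlo (fun _ => 1) .e3 .qf (kM1 c - 1)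

/-- the weight of Theorem M1 (2) ([KS] l.6687): `r²(2r+u)^{1+δe}/log(1+u) + r³(2r+u)^{1/2+δe}` on `(ext)𝓜` (`u ≥ 1` there, so
`log(1+u) ≥ log 2 > 0`). [cite: KlainermanSzeftel2021, TeX l.6687] -/
def wM1A (δe : ℝ) (p : 𝓜.Pt) : ℝ≥0∞ :=
  ENNReal.ofReal
    (𝓜.r .ext p ^ 2 * (2 * 𝓜.r .ext p + 𝓜.u p) ^ (1 + δe) / Real.log (1 + 𝓜.u p)
      + 𝓜.r .ext p ^ 3 * (2 * 𝓜.r .ext p + 𝓜.u p) ^ (1/2 + δe))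

/-- **Theorem M1 (2)** ([KS] l.6685–6688), outgoing PG frame of `(ext)𝓜`, `k = k_small + 100`:
`sup_{(ext)𝓜} w (|𝔡^k A| + r |𝔡^{k−1}∇₃A|)`, `w = wM1A`. [cite: KlainermanSzeftel2021, TeX l.6685–6688] -/
def M1A (δe : ℝ) : ℝ≥0∞ :=
  let k := kM1 c
  𝓜.supNorm (𝓜.region .ext) (𝓜.frame .ext) (𝓜.wM1A δe) .A k
    + 𝓜.supNormD (𝓜.region .ext) (𝓜.frame .ext) (fun p => 𝓜.wM1A δe p * 𝓜.wR .ext 1 p) .e3 .A (k - 1)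

/-- the level `k_small + 80` of Theorem M2 ([KS] l.6695) [cite: KlainermanSzeftel2021, TeX l.6695] -/
def kM2 (c : Constants) : ℕ := c.kSmall + 80

/-- `^(int)𝔇_k[α̲]` ([KS] l.6695; the `α̲`-component of `^(int)𝔇_k`, l.5894: `α̲ ∈ Γ_b` unweighted in the ingoing tables):
`sup_{(int)𝓜} ū^{1+δ_dec} |𝔡^{≤k} A̲|`. [cite: KlainermanSzeftel2021, TeX l.6695] -/
def DIntAb (k : ℕ) : ℝ≥0∞ := 𝓜.supNorm (𝓜.region .int) (𝓜.frame .int) (𝓜.wUbar (1 + c.δdec)) .Ab k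

/-- `^(top)𝔇_k[α̲]` (the `α̲`-component of `^(top)𝔇_k = ^(top)𝔇_k^{≤r₀} + ^(top)𝔇_k^{≥r₀}`, l.5976–5985):
`sup_{(top)𝓜(r ≤ r₀)} ū^{1+δ} |𝔡^{≤k} A̲| + sup_{(top)𝓜(r ≥ r₀)} r ((top)u)^{1+δ} |𝔡^{≤k} A̲|`, `δ = δ_dec`. [cite: KlainermanSzeftel2021, TeX l.5976–5985] -/
def DTopAb (k : ℕ) : ℝ≥0∞ :=
  𝓜.supNorm (𝓜.region .top ∩ {p | 𝓜.r .top p ≤ c.r₀}) (𝓜.frame .top) (𝓜.wUbar (1 + c.δdec)) .Ab k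
    + 𝓜.supNorm (𝓜.region .top ∩ {p | c.r₀ ≤ 𝓜.r .top p}) (𝓜.frame .top)
        (fun p => 𝓜.wR .top 1 p * 𝓜.wUTop (1 + c.δdec) p) .Ab k

/-- **Theorem M2, first display** ([KS] l.6695): `^(int)𝔇_{k_small+80}[α̲] + ^(top)𝔇_{k_small+80}[α̲]`. [cite: KlainermanSzeftel2021, TeX l.6695] -/
def M2Dec : ℝ≥0∞ := 𝓜.DIntAb (kM2 c) + 𝓜.DTopAb (kM2 c)

/-- **Theorem M2, second display** ([KS] l.6695): `max_{k ≤ k_small+80} ∫_{Σ_*} u^{2+2δ_dec} |𝔡^k α̲|²` (outgoing PG frame of `(ext)𝓜`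
restricted to `Σ_*`, as for the flux terms of `^(ext)𝔇_k`; the source bounds it by `ε₀²`). [cite: KlainermanSzeftel2021, TeX l.6695] -/
def M2Flux : ℝ≥0∞ :=
  𝓜.fluxNorm .SigmaStar 𝓜.SigmaStar (𝓜.frame .ext) (𝓜.wU (2 + 2 * c.δdec)) .Ab (kM2 c)

/-- a table entry with weight `r⁰` dominates the bare jet: `|𝔡^{≤k} ψ| ≤ |𝔡^{≤k} T|` for `(ψ, 0) ∈ T` [folklore] -/
theorem jet_le_size (F : FrameData 𝓜.Pt) (T : Table) (r : 𝓜.Pt → ℝ) (ψ : Qty) (hmem : (ψ, 0) ∈ T) (k : ℕ) (p : 𝓜.Pt) :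
    F.jet ψ k p ≤ F.size T r k p := by
  unfold FrameData.size
  have h : ENNReal.ofReal (r p ^ ((ψ, 0) : Qty × ℕ).2) * F.jet ((ψ, 0) : Qty × ℕ).1 k p
      ≤ ⨆ e ∈ T, ENNReal.ofReal (r p ^ e.2) * F.jet e.1 k p :=
    le_iSup₂_of_le (f := fun (e : Qty × ℕ) (_ : e ∈ T) => ENNReal.ofReal (r p ^ e.2) * F.jet e.1 k p) (ψ, 0) hmem le_rfl
  simpa using h

/-- `^(int)𝔇_k[α̲] ≤ ^(int)𝔇_k`: the `α̲`-component is dominated by the full decay norm (sanity of the typing of Theorem M2). [folklore] -/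
theorem DIntAb_le_DInt (k : ℕ) : 𝓜.DIntAb k ≤ 𝓜.DInt k := by
  unfold DIntAb supNorm DInt
  refine iSup₂_mono fun p _ => ?_
  refine mul_le_mul' le_rfl (le_trans ?_ le_add_self)
  have hmem : (Qty.Ab, 0) ∈ Table.ΓbIn :=
    List.mem_cons_of_mem _ (List.mem_cons_of_mem _ List.mem_cons_self)
  exact 𝓜.jet_le_size (𝓜.frame .int) Table.ΓbIn (𝓜.r .int) .Ab hmem k p

/-- `^(top)𝔇_k[α̲] ≤ ^(top)𝔇_k`. [folklore] -/
theorem DTopAb_le_DTop (k : ℕ) : 𝓜.DTopAb k ≤ 𝓜.DTop k := by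
  have hmem : (Qty.Ab, 0) ∈ Table.ΓbTop :=
    List.mem_cons_of_mem _ (List.mem_cons_of_mem _ List.mem_cons_self)
  have h1 : 𝓜.supNorm (𝓜.region .top ∩ {p | 𝓜.r .top p ≤ c.r₀}) (𝓜.frame .top) (𝓜.wUbar (1 + c.δdec)) .Ab k
      ≤ ⨆ p ∈ 𝓜.region .top ∩ {p | 𝓜.r .top p ≤ c.r₀},
          𝓜.wUbar (1 + c.δdec) p * ((𝓜.frame .top).size Table.ΓgTop (𝓜.r .top) k p
            + (𝓜.frame .top).size Table.ΓbTop (𝓜.r .top) k p) := by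
    unfold supNorm
    refine iSup₂_mono fun p _ => mul_le_mul' le_rfl (le_trans ?_ le_add_self)
    exact 𝓜.jet_le_size (𝓜.frame .top) Table.ΓbTop (𝓜.r .top) .Ab hmem k p
  have h3 : 𝓜.supNorm (𝓜.region .top ∩ {p | c.r₀ ≤ 𝓜.r .top p}) (𝓜.frame .top)
        (fun p => 𝓜.wR .top 1 p * 𝓜.wUTop (1 + c.δdec) p) .Ab k
      ≤ ⨆ p ∈ 𝓜.region .top ∩ {p | c.r₀ ≤ 𝓜.r .top p},
          𝓜.wR .top 1 p * 𝓜.wUTop (1 + c.δdec) p * (𝓜.frame .top).size Table.ΓbTop (𝓜.r .top) k p := by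
    unfold supNorm
    refine iSup₂_mono fun p _ => mul_le_mul' le_rfl ?_
    exact 𝓜.jet_le_size (𝓜.frame .top) Table.ΓbTop (𝓜.r .top) .Ab hmem k p
  have key : ∀ a b c' d e : ℝ≥0∞, a + c' ≤ a + b + c' + d + e := fun a b c' d e =>
    calc a + c' ≤ a + b + c' := add_le_add le_self_add le_rfl
      _ ≤ a + b + c' + d := le_self_add
      _ ≤ a + b + c' + d + e := le_self_add
  unfold DTopAb DTop
  exact le_trans (add_le_add h1 h3) (key _ _ _ _ _)

/-- the first display of Theorem M2 is a component of `^(int)𝔇 + ^(top)𝔇` at level `k_small + 80` [folklore] -/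
theorem M2Dec_le : 𝓜.M2Dec ≤ 𝓜.DInt (kM2 c) + 𝓜.DTop (kM2 c) :=
  add_le_add (𝓜.DIntAb_le_DInt _) (𝓜.DTopAb_le_DTop _)

end GCMAdmissible

/-! ### §14. The spacetimes of [GKS] (arXiv:2205.14808) with a time function `τ`, and the Part II / Part III norms

[GKS] works on a vacuum region `𝓜` carrying a (non-integrable) horizontal structure, constants `(a, m)`, scalar functions `(r, θ, τ)`,
with `τ ∈ [1, τ_*]`, boundary `∂𝓜 = 𝓐 ∪ Σ_* ∪ Σ(1) ∪ Σ(τ_*)` ([GKS] §`section:SpacetimeMM-chap6`, TeX l.9577–9609; intro l.1400–1432), the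
regions `𝓜_trap = {|𝒯|/r³ ≤ δ_trap}`, `δ_trap = 1/10`, `𝓜_red = {r ≤ r₊(1 + 2δ_red)}`, `𝓜(τ₁, τ₂) = {τ₁ ≤ τ ≤ τ₂}` (Def. `def:causalregions`,
l.9787–9808), the function `τ_trap` (l.9662–9668) and the norms of §`subsection:basicnormsforpsi` (l.9892–10001) and §`subsection:recallMorawetz-Energy`
(l.26058–26075). NO identification with the GCM admissible spacetime of [KS] is typed here: the transfer between the `(u, ū)`-foliations of [KS] and the
`τ`-foliation of [GKS] (KS §3.6.3 / §9.4 ⇒ GKS (1.5.x)) is a NODE of the DAG (carver: KS↔GKS restatement), not a definition (DIVERGENCE DV-16).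
Same schematic conventions as §5–§7 (DV-01–04, DV-09): a "solution `ψ ∈ 𝔰₂`" is jet data (`GField`), integrals are `∫⁻` against attached measures,
norms are `ℝ≥0∞`-valued, higher-order norms `Q^s[ψ] = Σ_{k≤s} Q[𝔡^k ψ]` are the cumulative-jet terms at level `s` (DV-16(b)). -/

/-- Derivative directions of [GKS] applied OUTSIDE the weighted jets (`|∇_d 𝔡^{≤k} ψ|`, the order used in l.9903–9921, l.26064–26068):
`∇₃`, `∇₄`, horizontal `∇`, `∇_R̂` with `R̂ = ½(e₄ − Δ/|q|² e₃)` (l.25752), `∇_{T̂_δ}` (Def. `definitionThat_de`, l.10317), and the conformal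
`r⁻¹∇₄(r ·)` of the `r^p`-energy for `p > 1 − δ` (l.9961). [cite: GiorgiKlainermanSzeftel2022, TeX l.9903–9921] -/
inductive GDir | e3 | e4 | hor | Rhat | That | e4conf
  deriving DecidableEq, Repr

/-- A schematic tensor field on `Pt` (a solution `ψ` of a gRW / Teukolsky-type equation, or a source term `N`): sizes of its weighted jets
`jet k p = |𝔡^{≤k} ψ|(p)` and `jetD d k p = |∇_d 𝔡^{≤k} ψ|(p)`, monotone in `k`. [folklore] -/
structure GField (Pt : Type) where
  jet : ℕ → Pt → ℝ≥0∞
  jetD : GDir → ℕ → Pt → ℝ≥0∞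
  jet_mono : ∀ p, Monotone fun k => jet k p
  jetD_mono : ∀ d p, Monotone fun k => jetD d k p

/-- **A spacetime of [GKS] with its time function** (schematic). Definitional facts of [GKS] l.9577–9609, l.9709–9725, l.9787–9808 are fields;
the analytic properties of `τ` (`g(N_Σ, N_Σ) ≤ −m²/8r²`, `e₃(τ), e₄(τ) > 0`, …, Def. `definition:definition-oftau` l.9711–9722) have no schematic
content and are NOT fields (DV-16(c)). [cite: GiorgiKlainermanSzeftel2022, TeX l.9577–9609] -/
structure TauSpacetime (M : Spacetime) where
  /-- the constants `(a, m)`, `|a| < m` (l.1408) -/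
  params : KerrParams
  subext : params.IsSubextremal
  /-- `𝓜` as a subset of the ambient carrier -/
  dom : Set M.Pt
  /-- the scalar functions `r, θ, τ` -/
  r : M.Pt → ℝ
  θ : M.Pt → ℝ
  τ : M.Pt → ℝ
  /-- `τ_* > 1` -/
  τStar : ℝ
  /-- `δ_ℋ > 0` (position of `𝓐`), `δ_red > 0` (`δ_ℋ ≪ δ_red^{20}`, l.9801), `r₀ ≫ m` -/
  δH : ℝ
  δred : ℝ
  r₀ : ℝ
  /-- the boundary pieces `𝓐 = {r = r₊ − δ_ℋ… }` (l.9599: `r = r_+ - δ_ℋ`; intro l.1413: `r = r₊(1 − δ_ℋ)` — SRC-06) and `Σ_*` (spacelike, `r ≥ r_* ≫ τ_*` on it, l.9601) -/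
  A : Set M.Pt
  SigmaStar : Set M.Pt
  /-- spacetime volume measure of `(𝓜, g)` and induced measures on `Σ(τ)`, `𝓐`, `Σ_*`, and on the timelike cylinders `{r = λ}` (l.25690) -/
  vol : Measure M.Pt
  slice : ℝ → Measure M.Pt
  surfA : Measure M.Pt
  surfSigmaStar : Measure M.Pt
  cyl : ℝ → Measure M.Pt
  /-- the global frame as jet data for the NAMED quantities (Ricci / curvature components `Γ_g, Γ_b, A, B, P̌, B̲, A̲`, §4 vocabulary) -/
  frame : FrameData M.Pt
  /-- the signed pairings the `𝒩`-norms keep un-estimated (l.9933 `|∫_{𝓜_trap} ∇_{T̂_δ} 𝔡^{≤s}ψ · 𝔡^{≤s}N|`, l.9990 `|∫_{r≥4m} r^{p−1} ∇₄(r 𝔡^{≤s}ψ) · 𝔡^{≤s}N|`),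
  as opaque reals depending on `(ψ, N, s, τ₁, τ₂)` resp. `(ψ, N, p, s, τ₁, τ₂)` (DV-16(d)) -/
  pairT : GField M.Pt → GField M.Pt → ℕ → ℝ → ℝ → ℝ
  pair4r : GField M.Pt → GField M.Pt → ℝ → ℕ → ℝ → ℝ → ℝ
  -- definitional facts
  one_lt_τStar : 1 < τStar
  τ_range : ∀ p ∈ dom, 1 ≤ τ p ∧ τ p ≤ τStar
  A_sub : A ⊆ dom
  SigmaStar_sub : SigmaStar ⊆ dom
  δH_pos : 0 < δH
  δred_pos : 0 < δred

namespace TauSpacetime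

variable {M : Spacetime} (𝓝 : TauSpacetime M)

/-- events [folklore] -/
abbrev Pt (_𝓝 : TauSpacetime M) : Type := M.Pt

/-- `δ_trap = 1/10` ([GKS] l.9792) [cite: GiorgiKlainermanSzeftel2022, TeX l.9792] -/
def δtrap : ℝ := 1 / 10

/-- `𝓜_trap = 𝓜 ∩ {|𝒯(r)|/r³ ≤ δ_trap}`, `𝒯 = r³ − 3mr² + a²r + ma²` ([GKS] (eq:def-MM-trap) l.9791–9797). [cite: GiorgiKlainermanSzeftel2022, TeX l.9791–9797] -/
def trap : Set 𝓝.Pt := {p ∈ 𝓝.dom | |𝓝.params.trapPoly (𝓝.r p)| / 𝓝.r p ^ 3 ≤ δtrap}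

/-- `𝓜_{trap̸}`, the complement of `𝓜_trap` in `𝓜` (l.9799) [cite: GiorgiKlainermanSzeftel2022, TeX l.9799] -/
def ntrap : Set 𝓝.Pt := 𝓝.dom \ 𝓝.trap

/-- `𝓜_red = 𝓜 ∩ {r ≤ r₊(1 + 2δ_red)}` (l.9801–9804) [cite: GiorgiKlainermanSzeftel2022, TeX l.9801–9804] -/
def red : Set 𝓝.Pt := {p ∈ 𝓝.dom | 𝓝.r p ≤ 𝓝.params.rPlus * (1 + 2 * 𝓝.δred)}

/-- `(ext)𝓜 = 𝓜 ∩ {r ≥ r₀}`, `(int)𝓜 = 𝓜 ∩ {r ≤ r₀}` (l.9605–9608) [cite: GiorgiKlainermanSzeftel2022, TeX l.9605–9608] -/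
def ext : Set 𝓝.Pt := {p ∈ 𝓝.dom | 𝓝.r₀ ≤ 𝓝.r p}
/-- `(int)𝓜 := 𝓜 ∩ {r ≤ r₀}` of a `τ`-spacetime. [cite: GiorgiKlainermanSzeftel2022, Def. regions, TeX l.9787–9808] -/
def int : Set 𝓝.Pt := {p ∈ 𝓝.dom | 𝓝.r p ≤ 𝓝.r₀}

/-- `𝓜_{r ≥ 4m}` (the far region of the `r^p` norms, l.9950) [cite: GiorgiKlainermanSzeftel2022, TeX l.9950] -/
def far : Set 𝓝.Pt := {p ∈ 𝓝.dom | 4 * 𝓝.params.m ≤ 𝓝.r p}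

/-- `𝓜(τ₁, τ₂) = 𝓜 ∩ {τ₁ ≤ τ ≤ τ₂}` (l.9806) [cite: GiorgiKlainermanSzeftel2022, TeX l.9806] -/
def slab (τ₁ τ₂ : ℝ) : Set 𝓝.Pt := {p ∈ 𝓝.dom | τ₁ ≤ 𝓝.τ p ∧ 𝓝.τ p ≤ τ₂}

/-- `Σ(τ₀)`, the level set ([GKS] l.9787–9808) [cite: GiorgiKlainermanSzeftel2022, TeX l.9787–9808] -/
def Sigma (τ₀ : ℝ) : Set 𝓝.Pt := {p ∈ 𝓝.dom | 𝓝.τ p = τ₀}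

/-- `τ_trap := 1 + τ` on `𝓜_trap`, `:= 1` on `𝓜_{trap̸}` ([GKS] l.9662–9668) [cite: GiorgiKlainermanSzeftel2022, TeX l.9662–9668] -/
def τtrap (p : 𝓝.Pt) : ℝ := if |𝓝.params.trapPoly (𝓝.r p)| / 𝓝.r p ^ 3 ≤ δtrap then 1 + 𝓝.τ p else 1

/-- `τ_trap = 1 + τ` on `𝓜_trap` [folklore] -/
theorem τtrap_of_mem_trap {p : 𝓝.Pt} (hp : p ∈ 𝓝.trap) : 𝓝.τtrap p = 1 + 𝓝.τ p := by
  unfold τtrap; rw [if_pos hp.2]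

/-- `τ_trap = 1` on `𝓜_{trap̸}` [folklore] -/
theorem τtrap_of_mem_ntrap {p : 𝓝.Pt} (hp : p ∈ 𝓝.ntrap) : 𝓝.τtrap p = 1 := by
  unfold τtrap
  rw [if_neg]
  intro h
  exact hp.2 ⟨hp.1, h⟩

/-- weight `r^s` (real exponent) [folklore] -/
def wR (s : ℝ) (p : 𝓝.Pt) : ℝ≥0∞ := ENNReal.ofReal (𝓝.r p ^ s)

section Norms

variable (ψ N : GField M.Pt)

/-- **1.** `Mor^s[ψ](τ₁, τ₂)` ([GKS] l.9903–9907): `∫_{𝓜(τ₁,τ₂)} r⁻²|∇_R̂ 𝔡^{≤s}ψ|² + r⁻³|𝔡^{≤s}ψ|² + ∫_{𝓜_{trap̸}(τ₁,τ₂)} (r⁻²|∇₃ 𝔡^{≤s}ψ|² + r⁻¹|∇ 𝔡^{≤s}ψ|²)`. [cite: GiorgiKlainermanSzeftel2022, TeX l.9903–9907] -/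
def Mor (s : ℕ) (τ₁ τ₂ : ℝ) : ℝ≥0∞ :=
  (∫⁻ p in 𝓝.slab τ₁ τ₂, 𝓝.wR (-2) p * ψ.jetD .Rhat s p ^ 2 + 𝓝.wR (-3) p * ψ.jet s p ^ 2 ∂𝓝.vol)
  + ∫⁻ p in 𝓝.ntrap ∩ 𝓝.slab τ₁ τ₂, 𝓝.wR (-2) p * ψ.jetD .e3 s p ^ 2 + 𝓝.wR (-1) p * ψ.jetD .hor s p ^ 2 ∂𝓝.vol

/-- `Morr^s[ψ] = Mor^s[ψ] + ∫_{𝓜_{r≥4m}(τ₁,τ₂)} r^{−1−δ}|∇₃ 𝔡^{≤s}ψ|²` (l.9908), `δ > 0` the small [GKS] constant. [cite: GiorgiKlainermanSzeftel2022, TeX l.9908] -/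
def Morr (δ : ℝ) (s : ℕ) (τ₁ τ₂ : ℝ) : ℝ≥0∞ :=
  𝓝.Mor ψ s τ₁ τ₂ + ∫⁻ p in 𝓝.far ∩ 𝓝.slab τ₁ τ₂, 𝓝.wR (-1 - δ) p * ψ.jetD .e3 s p ^ 2 ∂𝓝.vol

/-- the basic energy density `|∇₄ψ|² + r⁻²|∇₃ψ|² + |∇ψ|² + r⁻²|ψ|²` at jet level `s` (l.9914) [cite: GiorgiKlainermanSzeftel2022, TeX l.9914] -/
def eDensity (s : ℕ) (p : 𝓝.Pt) : ℝ≥0∞ :=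
  ψ.jetD .e4 s p ^ 2 + 𝓝.wR (-2) p * ψ.jetD .e3 s p ^ 2 + ψ.jetD .hor s p ^ 2 + 𝓝.wR (-2) p * ψ.jet s p ^ 2

/-- the flux density `|∇₄ψ|² + |∇₃ψ|² + |∇ψ|² + r⁻²|ψ|²` (l.9921–9923) [cite: GiorgiKlainermanSzeftel2022, TeX l.9921–9923] -/
def fDensity (s : ℕ) (p : 𝓝.Pt) : ℝ≥0∞ :=
  ψ.jetD .e4 s p ^ 2 + ψ.jetD .e3 s p ^ 2 + ψ.jetD .hor s p ^ 2 + 𝓝.wR (-2) p * ψ.jet s p ^ 2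

/-- **2.** `E^s[ψ](τ) = ∫_{Σ(τ)} (|∇₄𝔡^{≤s}ψ|² + r⁻²|∇₃𝔡^{≤s}ψ|² + |∇𝔡^{≤s}ψ|² + r⁻²|𝔡^{≤s}ψ|²)` ([GKS] l.9913–9915). [cite: GiorgiKlainermanSzeftel2022, TeX l.9913–9915] -/
def En (s : ℕ) (τ₀ : ℝ) : ℝ≥0∞ := ∫⁻ p in 𝓝.Sigma τ₀, 𝓝.eDensity ψ s p ∂(𝓝.slice τ₀)

/-- **3.** `F^s[ψ](τ₁,τ₂) = F_𝓐 + F_{Σ_*}` ([GKS] l.9919–9924), each the integral of `fDensity` over `𝓐(τ₁,τ₂)`, `Σ_*(τ₁,τ₂)`. [cite: GiorgiKlainermanSzeftel2022, TeX l.9919–9924] -/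
def Fl (s : ℕ) (τ₁ τ₂ : ℝ) : ℝ≥0∞ :=
  (∫⁻ p in 𝓝.A ∩ 𝓝.slab τ₁ τ₂, 𝓝.fDensity ψ s p ∂𝓝.surfA)
  + ∫⁻ p in 𝓝.SigmaStar ∩ 𝓝.slab τ₁ τ₂, 𝓝.fDensity ψ s p ∂𝓝.surfSigmaStar

/-- **4.** `𝒩^s[ψ, N](τ₁, τ₂)` ([GKS] l.9930–9935): `∫_{𝓜(τ₁,τ₂)} (|∇_R̂ψ| + r⁻¹|ψ|)|N| + |∫_{𝓜_trap} ∇_{T̂_δ}ψ · N| + ∫_{𝓜_{trap̸}} |Dψ||N|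
 + ∫_{𝓜(τ₁,τ₂)}|N|² + sup_{τ∈[τ₁,τ₂]} ∫_{Σ(τ)}|N|² + ∫_{Σ_*(τ₁,τ₂)}|N|²` at jet level `s`; the signed pairing is the opaque `pairT`;
`|Dψ|` (all first derivatives) is typed `|𝔡^{≤s+1}ψ|`. [cite: GiorgiKlainermanSzeftel2022, TeX l.9930–9935] -/
def NN (s : ℕ) (τ₁ τ₂ : ℝ) : ℝ≥0∞ :=
  (∫⁻ p in 𝓝.slab τ₁ τ₂, (ψ.jetD .Rhat s p + 𝓝.wR (-1) p * ψ.jet s p) * N.jet s p ∂𝓝.vol)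
  + ENNReal.ofReal |𝓝.pairT ψ N s τ₁ τ₂|
  + (∫⁻ p in 𝓝.ntrap ∩ 𝓝.slab τ₁ τ₂, ψ.jet (s + 1) p * N.jet s p ∂𝓝.vol)
  + (∫⁻ p in 𝓝.slab τ₁ τ₂, N.jet s p ^ 2 ∂𝓝.vol)
  + (⨆ τ₀ ∈ Set.Icc τ₁ τ₂, ∫⁻ p in 𝓝.Sigma τ₀, N.jet s p ^ 2 ∂(𝓝.slice τ₀))
  + ∫⁻ p in 𝓝.SigmaStar ∩ 𝓝.slab τ₁ τ₂, N.jet s p ^ 2 ∂𝓝.surfSigmaStar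

/-- **5.** `B_p^s[ψ](τ₁,τ₂) = Morr^s[ψ] + ∫_{𝓜_{r≥4m}(τ₁,τ₂)} r^{p−3}(|𝔡ψ|² + |ψ|²)` ([GKS] l.9950–9952), `0 < p < 2`; `|𝔡ψ|² + |ψ|²` at level `s`
is `|𝔡^{≤s+1}ψ|²` (cumulative). [cite: GiorgiKlainermanSzeftel2022, TeX l.9950–9952] -/
def Bp (δ p : ℝ) (s : ℕ) (τ₁ τ₂ : ℝ) : ℝ≥0∞ :=
  𝓝.Morr ψ δ s τ₁ τ₂ + ∫⁻ q in 𝓝.far ∩ 𝓝.slab τ₁ τ₂, 𝓝.wR (p - 3) q * ψ.jet (s + 1) q ^ 2 ∂𝓝.vol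

/-- **6.** `E_p^s[ψ](τ)` ([GKS] l.9957–9963): `E^s[ψ](τ) + ∫_{Σ_{r≥4m}(τ)} r^p (|∇₄𝔡^{≤s}ψ|² + r⁻²|𝔡^{≤s}ψ|²)` for `p ≤ 1 − δ`, and
`E^s[ψ](τ) + ∫_{Σ_{r≥4m}(τ)} r^p (|r⁻¹∇₄(r𝔡^{≤s}ψ)|² + r^{−p−1−δ}|𝔡^{≤s}ψ|²)` for `p > 1 − δ`. [cite: GiorgiKlainermanSzeftel2022, TeX l.9957–9963] -/
def Ep (δ p : ℝ) (s : ℕ) (τ₀ : ℝ) : ℝ≥0∞ :=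
  𝓝.En ψ s τ₀ +
    if p ≤ 1 - δ then
      ∫⁻ q in 𝓝.far ∩ 𝓝.Sigma τ₀, 𝓝.wR p q * (ψ.jetD .e4 s q ^ 2 + 𝓝.wR (-2) q * ψ.jet s q ^ 2) ∂(𝓝.slice τ₀)
    else
      ∫⁻ q in 𝓝.far ∩ 𝓝.Sigma τ₀, 𝓝.wR p q * (ψ.jetD .e4conf s q ^ 2 + 𝓝.wR (-p - 1 - δ) q * ψ.jet s q ^ 2) ∂(𝓝.slice τ₀)

/-- **7.** `F_p^s[ψ](τ₁,τ₂) = F^s[ψ] + ∫_{Σ_*(τ₁,τ₂)} r^p (|∇₄𝔡^{≤s}ψ|² + |∇𝔡^{≤s}ψ|² + r⁻²|𝔡^{≤s}ψ|²)` ([GKS] l.9973–9977). [cite: GiorgiKlainermanSzeftel2022, TeX l.9973–9977] -/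
def Fp (p : ℝ) (s : ℕ) (τ₁ τ₂ : ℝ) : ℝ≥0∞ :=
  𝓝.Fl ψ s τ₁ τ₂ + ∫⁻ q in 𝓝.SigmaStar ∩ 𝓝.slab τ₁ τ₂,
    𝓝.wR p q * (ψ.jetD .e4 s q ^ 2 + ψ.jetD .hor s q ^ 2 + 𝓝.wR (-2) q * ψ.jet s q ^ 2) ∂𝓝.surfSigmaStar

/-- **8.** `EF_p^s[ψ](τ₁,τ₂) = sup_{τ∈[τ₁,τ₂]} E_p^s[ψ](τ) + F_p^s[ψ](τ₁,τ₂)` ([GKS] l.9985–9987). [cite: GiorgiKlainermanSzeftel2022, TeX l.9985–9987] -/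
def EFp (δ p : ℝ) (s : ℕ) (τ₁ τ₂ : ℝ) : ℝ≥0∞ :=
  (⨆ τ₀ ∈ Set.Icc τ₁ τ₂, 𝓝.Ep ψ δ p s τ₀) + 𝓝.Fp ψ p s τ₁ τ₂

/-- **8.** `BEF_p^s[ψ](τ₁,τ₂) = sup_τ E_p^s + B_p^s + F_p^s` ([GKS] l.9980–9982). [cite: GiorgiKlainermanSzeftel2022, TeX l.9980–9982] -/
def BEFp (δ p : ℝ) (s : ℕ) (τ₁ τ₂ : ℝ) : ℝ≥0∞ :=
  𝓝.EFp ψ δ p s τ₁ τ₂ + 𝓝.Bp ψ δ p s τ₁ τ₂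

/-- **9.** `𝒩_p^s[ψ, N](τ₁,τ₂) = 𝒩^s[ψ, N] + |∫_{𝓜_{r≥4m}} r^{p−1} ∇₄(r𝔡^{≤s}ψ) · 𝔡^{≤s}N|` ([GKS] l.9990–9993); the signed pairing is the
opaque `pair4r`. [cite: GiorgiKlainermanSzeftel2022, TeX l.9990–9993] -/
def NNp (p : ℝ) (s : ℕ) (τ₁ τ₂ : ℝ) : ℝ≥0∞ :=
  𝓝.NN ψ N s τ₁ τ₂ + ENNReal.ofReal |𝓝.pair4r ψ N p s τ₁ τ₂|

/-! Part III norms ([GKS] §`subsection:recallMorawetz-Energy`, l.26058–26075; `k_L`-level versions of 1–8 with the Part III weights) -/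

/-- `B^k_δ[ψ](τ₁,τ₂) = ∫_{𝓜_trap(τ₁,τ₂)} (|∇_R̂ 𝔡^{≤k}ψ|² + |𝔡^{≤k}ψ|²) + ∫_{𝓜_{trap̸}(τ₁,τ₂)} r^{δ−3}|𝔡^{≤k+1}ψ|²` ([GKS] l.26064). [cite: GiorgiKlainermanSzeftel2022, TeX l.26064] -/
def B3 (δ : ℝ) (k : ℕ) (τ₁ τ₂ : ℝ) : ℝ≥0∞ :=
  (∫⁻ p in 𝓝.trap ∩ 𝓝.slab τ₁ τ₂, ψ.jetD .Rhat k p ^ 2 + ψ.jet k p ^ 2 ∂𝓝.vol)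
  + ∫⁻ p in 𝓝.ntrap ∩ 𝓝.slab τ₁ τ₂, 𝓝.wR (δ - 3) p * ψ.jet (k + 1) p ^ 2 ∂𝓝.vol

/-- `E^k_δ[ψ](τ) = ∫_{Σ(τ)} r^δ(|∇₄𝔡^{≤k}ψ|² + r⁻²|𝔡^{≤k}ψ|²) + |∇𝔡^{≤k}ψ|² + r⁻²|∇₃𝔡^{≤k}ψ|²` ([GKS] l.26065). [cite: GiorgiKlainermanSzeftel2022, TeX l.26065] -/
def E3 (δ : ℝ) (k : ℕ) (τ₀ : ℝ) : ℝ≥0∞ :=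
  ∫⁻ p in 𝓝.Sigma τ₀, 𝓝.wR δ p * (ψ.jetD .e4 k p ^ 2 + 𝓝.wR (-2) p * ψ.jet k p ^ 2) + ψ.jetD .hor k p ^ 2
    + 𝓝.wR (-2) p * ψ.jetD .e3 k p ^ 2 ∂(𝓝.slice τ₀)

/-- `F^k_δ[ψ](τ₁,τ₂) = ∫_{Σ_*(τ₁,τ₂)} r^δ(|∇₄𝔡^{≤k}ψ|² + |∇𝔡^{≤k}ψ|² + r⁻²|𝔡^{≤k}ψ|²) + |∇₃𝔡^{≤k}ψ|² + ∫_{𝓐(τ₁,τ₂)} |𝔡^{≤k+1}ψ|²` ([GKS] l.26066–26067). [cite: GiorgiKlainermanSzeftel2022, TeX l.26066–26067] -/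
def F3 (δ : ℝ) (k : ℕ) (τ₁ τ₂ : ℝ) : ℝ≥0∞ :=
  (∫⁻ p in 𝓝.SigmaStar ∩ 𝓝.slab τ₁ τ₂,
      𝓝.wR δ p * (ψ.jetD .e4 k p ^ 2 + ψ.jetD .hor k p ^ 2 + 𝓝.wR (-2) p * ψ.jet k p ^ 2) + ψ.jetD .e3 k p ^ 2 ∂𝓝.surfSigmaStar)
  + ∫⁻ p in 𝓝.A ∩ 𝓝.slab τ₁ τ₂, ψ.jet (k + 1) p ^ 2 ∂𝓝.surfA

/-- `EF^k_δ[ψ] = sup_{τ∈[1,τ_*]} E^k_δ[ψ](τ) + F^k_δ[ψ]` on `𝓜 = 𝓜(1, τ_*)` ([GKS] l.26072). [cite: GiorgiKlainermanSzeftel2022, TeX l.26072] -/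
def EF3 (δ : ℝ) (k : ℕ) : ℝ≥0∞ := (⨆ τ₀ ∈ Set.Icc 1 𝓝.τStar, 𝓝.E3 ψ δ k τ₀) + 𝓝.F3 ψ δ k 1 𝓝.τStar

/-- `BEF^k_δ[ψ] = B^k_δ[ψ] + sup_τ E^k_δ[ψ](τ) + F^k_δ[ψ]` ([GKS] l.26071). [cite: GiorgiKlainermanSzeftel2022, TeX l.26071] -/
def BEF3 (δ : ℝ) (k : ℕ) : ℝ≥0∞ := 𝓝.B3 ψ δ k 1 𝓝.τStar + 𝓝.EF3 ψ δ k

end Norms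

/-! Part III main norms `ℜ_k = (ext)ℜ_k + (int)ℜ_k`, `𝔖_k = (ext)𝔖_k + (int)𝔖_k` ([GKS] §`subsection:MainNormsM8`, l.25672–25755 = KS §9.4.1),
in the global frame `frame`, over the §4 vocabulary. The sets `Γ_g' = Γ_g ∖ {tr X̲̌}`, `Γ_b' = Γ_b ∖ {Ξ̲}` (l.25697) and `Γ̌` (l.25727–25731),
`Ř = {A̲, B̲, P̌, B, A}` (l.25760) are the tables below. -/

/-- `Ř = {A̲, B̲, P̌, B, A}` with the `(ext)ℜ_k` weights as a SEPARATE function (l.25710–25713): `r^{3+δ_B}` on `A, B`; `r^{3−δ_B}` on `P̌`,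
`r^{1−δ_B}` on `B̲`, `r^{−1−δ_B}` on `A̲`. [cite: GiorgiKlainermanSzeftel2022, TeX l.25710–25713] -/
def RcList : List Qty := [.Ab, .Bb, .Pc, .B, .A]

/-- the `(ext)ℜ_k` weight exponent of each curvature component (l.25710–25713), `δ_B = \dt` of [GKS] [cite: GiorgiKlainermanSzeftel2022, TeX l.25710–25713] -/
def rkExtExp (δB : ℝ) : Qty → ℝ
  | .A => 3 + δB
  | .B => 3 + δB
  | .Pc => 3 - δB
  | .Bb => 1 - δB
  | .Ab => -1 - δB
  | _ => 0

/-- `(ext)ℜ_k² = ∫_{(ext)𝓜} r^{3+δ_B}|𝔡^{≤k}(A,B)|² + r^{3−δ_B}(|𝔡^{≤k}P̌|² + r⁻²|𝔡^{≤k}B̲|² + r⁻⁴|𝔡^{≤k}A̲|²)` ([GKS] Def. `Definiition:Rkext`, l.25707–25714)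
— typed as the SQUARE (no square root), DV-16(e). [cite: GiorgiKlainermanSzeftel2022, TeX l.25707–25714] -/
def RkExtSq (δB : ℝ) (k : ℕ) : ℝ≥0∞ :=
  ∫⁻ p in 𝓝.ext, (RcList.map fun ψ => 𝓝.wR (rkExtExp δB ψ) p * 𝓝.frame.jet ψ k p ^ 2).sum ∂𝓝.vol

/-- `(int)ℜ_k² = ∫_{(int)𝓜} (|∇_R̂ 𝔡^{≤k−1}Ř|² + |𝔡^{≤k−1}Ř|²) + ∫_{(int)𝓜_{trap̸}} |𝔡^{≤k}Ř|² + sup_τ ∫_{(int)𝓜 ∩ Σ(τ)} |𝔡^{≤k}Ř|²` ([GKS] Def.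
`definit:norms-RkMint'`, l.25750–25755); `∇_R̂` applied outside: read through `jetD .e4/.e3`? — NO: the named-quantity frame data `FrameData` only has
`jetD ∈ {e3, e4, nu}` with the derivative INSIDE; the `R̂`-term is therefore typed with the opaque functional `rhatInt` below (DV-16(f)). [cite: GiorgiKlainermanSzeftel2022, TeX l.25750–25755] -/
def RkIntSq (rhatInt : ℕ → ℝ≥0∞) (k : ℕ) : ℝ≥0∞ :=
  rhatInt (k - 1)
  + (∫⁻ p in 𝓝.int, (RcList.map fun ψ => 𝓝.frame.jet ψ (k - 1) p ^ 2).sum ∂𝓝.vol)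
  + (∫⁻ p in 𝓝.int ∩ 𝓝.ntrap, (RcList.map fun ψ => 𝓝.frame.jet ψ k p ^ 2).sum ∂𝓝.vol)
  + ⨆ τ₀ ∈ Set.Icc 1 𝓝.τStar, ∫⁻ p in 𝓝.int ∩ 𝓝.Sigma τ₀, (RcList.map fun ψ => 𝓝.frame.jet ψ k p ^ 2).sum ∂(𝓝.slice τ₀)

/-- `Γ_g' = Γ_g ∖ {tr X̲̌}`, `Γ_b' = Γ_b ∖ {Ξ̲}` ([GKS] l.25697) from the [GKS] tables `Table.ΓgGKS/ΓbGKS` of §4. [cite: GiorgiKlainermanSzeftel2022, TeX l.25697] -/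
def ΓgPrime : Table := Table.ΓgGKS.filter fun e => e.1 ≠ Qty.trXbc
/-- `Γ_b' := Γ_b ∖ {Ξ̲}` (the primed table of the Part III norms). [cite: GiorgiKlainermanSzeftel2022, main norms of Thm M8, TeX l.25700–25731] -/
def ΓbPrime : Table := Table.ΓbGKS.filter fun e => e.1 ≠ Qty.Xib

/-- `(ext)𝔖_k² = sup_{λ ≥ r₀} ∫_{r=λ} ( r²|𝔡^{≤k}Γ_g'|² + |𝔡^{≤k}Γ_b'|² + r^{2−δ_B}|𝔡^{≤k} tr X̲̌|² + r^{−δ_B}|𝔡^{≤k}Ξ̲|² )` ([GKS] Def. `def:exteriorGac.norms`,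
l.25688–25693), integrals over the cylinders `{r = λ} ∩ 𝓜` against `cyl λ`. [cite: GiorgiKlainermanSzeftel2022, TeX l.25688–25693] -/
def SkExtSq (δB : ℝ) (k : ℕ) : ℝ≥0∞ :=
  ⨆ lam ∈ Set.Ici 𝓝.r₀, ∫⁻ p in {p ∈ 𝓝.dom | 𝓝.r p = lam},
    𝓝.wR 2 p * 𝓝.frame.size ΓgPrime 𝓝.r k p ^ 2
      + (𝓝.frame.size ΓbPrime 𝓝.r k p + 𝓝.frame.sizeInv Table.ΓbGKSInv 𝓝.r k p) ^ 2
      + 𝓝.wR (2 - δB) p * 𝓝.frame.jet .trXbc k p ^ 2 + 𝓝.wR (-δB) p * 𝓝.frame.jet .Xib k p ^ 2 ∂(𝓝.cyl lam)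

/-- `Γ̌` = all linearized Ricci and metric coefficients of the global frame ([GKS] l.25727–25731), as a list of §4 symbols:
`{Ξ̲, ω̲, tr X̲̌, X̲̂, ě₃(r), e₃(cos θ), ∇̌₃𝔍, Ž, Ȟ̲, Ȟ, 𝒟r, 𝒟̌cos θ, 𝒟̄̌·𝔍, 𝒟⊗̂𝔍, tr X̌, X̂, ω̌, ě₄(r), e₄(cos θ), ∇̌₄𝔍, Ξ}`; the symbols
`e₃(cos θ), e₄(cos θ), 𝒟r, 𝒟̌cos θ` have no §4 name and are represented by `e3J0, e4J0, Dq, DJ0` (`J⁽⁰⁾ = cos θ`, `q = r + i cos θ`; DV-16(g)). [cite: GiorgiKlainermanSzeftel2022, TeX l.25727–25731] -/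
def GammaCheck : List Qty :=
  [.Xib, .omb, .trXbc, .Xbh, .e3r, .e3J0, .n3Jk, .Zc, .Hbc, .Hc, .Dq, .DJ0, .DbJk, .DhJk, .trXc, .Xh, .omc, .e4r, .e4J0, .n4Jk, .Xi]

/-- `(int)𝔖_k² = ∫_{(int)𝓜} |𝔡^{≤k} Γ̌|²` ([GKS] Def. `definit:norms-SkMint'`, l.25722–25725). [cite: GiorgiKlainermanSzeftel2022, TeX l.25722–25725] -/
def SkIntSq (k : ℕ) : ℝ≥0∞ := ∫⁻ p in 𝓝.int, (GammaCheck.map fun ψ => 𝓝.frame.jet ψ k p ^ 2).sum ∂𝓝.vol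

/-- `ℜ_k = (ext)ℜ_k + (int)ℜ_k`, `𝔖_k = (ext)𝔖_k + (int)𝔖_k` ([GKS] (eq:defintionofglobalnorms) l.25768–25772), square roots of the squares. [cite: GiorgiKlainermanSzeftel2022, TeX l.25768–25772] -/
def Rk (δB : ℝ) (rhatInt : ℕ → ℝ≥0∞) (k : ℕ) : ℝ≥0∞ := 𝓝.RkExtSq δB k ^ (1 / 2 : ℝ) + 𝓝.RkIntSq rhatInt k ^ (1 / 2 : ℝ)
/-- `𝔖_k := ((ext)𝔖_k²)^{1/2} + ((int)𝔖_k²)^{1/2}` (Part III Ricci-coefficient norm). [cite: GiorgiKlainermanSzeftel2022, eq. main norms M8, TeX l.25768–25772] -/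
def Sk (δB : ℝ) (k : ℕ) : ℝ≥0∞ := 𝓝.SkExtSq δB k ^ (1 / 2 : ℝ) + 𝓝.SkIntSq k ^ (1 / 2 : ℝ)

/-- `r³|𝔡^{≤k}ξ| + r²|𝔡^{≤k}Γ_g| + r|𝔡^{≤k}Γ_b|` at `p`, [GKS] tables (the left side of (eq:assumptionsonMMforpartII), l.9669–9673) [cite: GiorgiKlainermanSzeftel2022, TeX l.9669–9673] -/
def ricciSize (k : ℕ) (p : 𝓝.Pt) : ℝ≥0∞ :=
  𝓝.wR 3 p * 𝓝.frame.jet .Xi k p + 𝓝.wR 2 p * 𝓝.frame.size Table.ΓgGKS 𝓝.r k p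
    + 𝓝.wR 1 p * (𝓝.frame.size Table.ΓbGKS 𝓝.r k p + 𝓝.frame.sizeInv Table.ΓbGKSInv 𝓝.r k p)

/-- The Part II assumptions (eq:assumptionsonMMforpartII) ([GKS] l.9669–9673) at levels `(k_L, k_L/2)`, pointwise on `𝓜`:
`r³|𝔡^{≤k}ξ| + r²|𝔡^{≤k}Γ_g| + r|𝔡^{≤k}Γ_b| ≤ ε` (`k ≤ k_L`) and `≤ ε/τ_trap^{1+δ_dec}` (`k ≤ k_L/2`, integer part). [cite: GiorgiKlainermanSzeftel2022, TeX l.9669–9673] -/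
def PartIIAssumptions (ε δdec : ℝ) (kL : ℕ) : Prop :=
  (∀ p ∈ 𝓝.dom, 𝓝.ricciSize kL p ≤ ENNReal.ofReal ε) ∧
  (∀ p ∈ 𝓝.dom, 𝓝.ricciSize (kL / 2) p ≤ ENNReal.ofReal (ε / 𝓝.τtrap p ^ (1 + δdec)))


/-- **10.** The `(ext)𝓜` norms `(ext)B_p, (ext)E_p, (ext)𝒩_p` ([GKS] l.9980–9981: "the restrictions of the norms `B_p, E_p, 𝒩_p` to `(ext)𝓜`, i.e. the
region in `𝓜` where `r ≥ r₀`") are the norms of the RESTRICTED τ-spacetime `𝓝.toExt` (domain `(ext)𝓜`, boundary pieces intersected with it). [cite: GiorgiKlainermanSzeftel2022, TeX l.9980–9981] -/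
def toExt : TauSpacetime M :=
  { 𝓝 with
    dom := 𝓝.ext
    A := 𝓝.A ∩ 𝓝.ext
    SigmaStar := 𝓝.SigmaStar ∩ 𝓝.ext
    τ_range := fun p hp => 𝓝.τ_range p hp.1
    A_sub := fun _ hp => hp.2
    SigmaStar_sub := fun _ hp => hp.2 }

/-- the domain of `toExt` is `(ext)𝓜` (definitional). [folklore] -/
@[simp] theorem toExt_dom : 𝓝.toExt.dom = 𝓝.ext := rfl

/-- `(ext)B_p^s` ([GKS] item 10, l.9980–9981) [cite: GiorgiKlainermanSzeftel2022, TeX l.9980–9981] -/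
def BpExt (ψ : GField M.Pt) (δ p : ℝ) (s : ℕ) (τ₁ τ₂ : ℝ) : ℝ≥0∞ := 𝓝.toExt.Bp ψ δ p s τ₁ τ₂
/-- `E^s_p[ψ](τ)` restricted to `(ext)𝓜` ([GKS] item 10). [cite: GiorgiKlainermanSzeftel2022, basic norms item 10, TeX l.9980–9981] -/
def EpExt (ψ : GField M.Pt) (δ p : ℝ) (s : ℕ) (τ₀ : ℝ) : ℝ≥0∞ := 𝓝.toExt.Ep ψ δ p s τ₀
/-- `𝒩^s_p[ψ, N](τ₁, τ₂)` restricted to `(ext)𝓜` ([GKS] item 10). [cite: GiorgiKlainermanSzeftel2022, basic norms item 10, TeX l.9980–9981] -/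
def NNpExt (ψ N : GField M.Pt) (p : ℝ) (s : ℕ) (τ₁ τ₂ : ℝ) : ℝ≥0∞ := 𝓝.toExt.NNp ψ N p s τ₁ τ₂

/-- monotonicity of the basic energy in the jet level [folklore] -/
theorem En_mono (ψ : GField M.Pt) (τ₀ : ℝ) : Monotone fun s => 𝓝.En ψ s τ₀ := by
  intro s t hst
  simp only [En, eDensity]
  refine MeasureTheory.lintegral_mono fun p => ?_
  gcongr
  · exact ψ.jetD_mono .e4 p hst
  · exact ψ.jetD_mono .e3 p hst
  · exact ψ.jetD_mono .hor p hst
  · exact ψ.jet_mono p hst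

/-- `τ_trap ≥ 1` on `𝓜` (since `τ ≥ 1` there) [folklore] -/
theorem one_le_τtrap {p : 𝓝.Pt} (hp : p ∈ 𝓝.dom) : 1 ≤ 𝓝.τtrap p := by
  unfold τtrap
  split_ifs with h
  · linarith [(𝓝.τ_range p hp).1]
  · exact le_rfl

/-- `𝓜_trap ⊆ 𝓜`. [folklore] -/
theorem trap_sub : 𝓝.trap ⊆ 𝓝.dom := fun _ hp => hp.1

/-- `𝓜 = 𝓜_trap ∪ 𝓜_{trap̸}` [folklore] -/
theorem trap_union_ntrap : 𝓝.trap ∪ 𝓝.ntrap = 𝓝.dom :=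
  Set.union_sdiff_cancel 𝓝.trap_sub

/-- the Part II assumptions are monotone in `ε` [folklore] -/
theorem PartIIAssumptions.mono {𝓝 : TauSpacetime M} {ε ε' δdec : ℝ} {kL : ℕ} (hε : ε ≤ ε')
    (h : 𝓝.PartIIAssumptions ε δdec kL) : 𝓝.PartIIAssumptions ε' δdec kL := by
  refine ⟨fun p hp => (h.1 p hp).trans (ENNReal.ofReal_le_ofReal hε), fun p hp => (h.2 p hp).trans ?_⟩
  refine ENNReal.ofReal_le_ofReal (div_le_div_of_nonneg_right hε ?_)
  exact le_of_lt (Real.rpow_pos_of_pos (lt_of_lt_of_le zero_lt_one (𝓝.one_le_τtrap hp)) _)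

end TauSpacetime

/-! ### §15. The PT structures of `𝓜` and the PT norms of [KS] §9.4 (TeX l.23166–23190, l.23858–24040, l.24441–24458)

For Theorem M8, [KS] re-covers the GCM admissible spacetime by PRINCIPAL TEMPORAL structures: `𝓜 = (ext)𝓜 ∪ (int)𝓜' ∪ (top)𝓜'`
(l.23176–23184; `(ext)𝓜' = (ext)𝓜`, Remark `remark:outgoingPT-versiusPG` l.23187–23189), the outgoing PT structure of `(ext)𝓜` initialized on `Σ_*`,
the ingoing PT structures of `(int)𝓜'` (initialized on `𝒯`) and `(top)𝓜'` (on `{u = u_*'}`, `u_*' ∈ [u_* − 2, u_* − 1]`), a scalar function `τ`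
(Prop. `prop:propertiesoftauusefulfortheoremM8:chap9`, l.23766–23797: only its existence with analytic properties — not typed, cf. DV-16(c)), and the norms
`𝔖^*_k, ℜ^*_k` (on `Σ_*`), `(ext)𝔖_k, (ext)ℜ_k, (int)𝔖_k, (int)ℜ_k, (top)𝔖_k, (top)ℜ_k`, `𝔖_k, ℜ_k` (l.23866–24005), `ℑ^{PT}_k` (l.24010–24040), `L_*(k)` (l.24450–24458).
Schematic conventions as in §5–§7, §14 (DV-17): PT frames are `FrameData` (named quantities, §4 vocabulary), the regions/functions of the PT structures are
fields of `PTData`, integrals are `∫⁻` against attached measures, every norm is typed as the displayed SQUARE and the un-squared norm as its `^(1/2)`. -/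

namespace GCMAdmissible

variable {c : Constants} {M : Spacetime}

/-- **PT data on a GCM admissible spacetime** ([KS] §9.2.3 `sec:defintionofthePTstructuresinMM`, l.23166–23260; §9.3 l.23766ff). [cite: KlainermanSzeftel2021, TeX l.23166–23260] -/
structure PTData (𝓜 : GCMAdmissible c M) where
  /-- `.ext`: the outgoing PT frame of `(ext)𝓜`; `.int`, `.top`: the ingoing PT frames of `(int)𝓜'`, `(top)𝓜'` -/
  frame : Region → FrameData M.Pt
  /-- the null pair `(e₃, e₄)` attached to `Σ_*` with `ν = e₃ + b_* e₄` (l.23878–23879), as jet data for `b̌_* = b_* + 1 + 2m/r`, `ν(r) + 2` and the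
  tangential derivatives `𝔡_*` -/
  frameSigmaStar : FrameData M.Pt
  /-- `(ext)𝓜' = (ext)𝓜`, `(int)𝓜'`, `(top)𝓜'` -/
  regionP : Region → Set M.Pt
  /-- the functions `r` of the three PT structures, `u` (outgoing PT of `(ext)𝓜`), `ū` (ingoing PT of `(int)𝓜'`, `(top)𝓜'`), and `τ` of §9.3 -/
  r : Region → M.Pt → ℝ
  u : M.Pt → ℝ
  ubar : M.Pt → ℝ
  τ : M.Pt → ℝ
  /-- `u_*' ∈ [u_* − 2, u_* − 1]` (l.23184; fixed in §`sec:choiceofuprimstar`) -/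
  uStar' : ℝ
  /-- spacetime volume measure, measures on the level sets `Σ(τ)`, on the cylinders `{r = λ}` of `(ext)𝓜`, and on `{u = u_*'}` (for `L_*`) -/
  vol : Measure M.Pt
  slice : ℝ → Measure M.Pt
  cyl : ℝ → Measure M.Pt
  surfU : Measure M.Pt
  /-- area measures of the spheres `S ⊂ 𝓑₁` (`i = .ext`: the `r`-leaves of `{u = 1}`) and `S ⊂ 𝓑̲₁` (`i = .int`: the `r`-leaves of `{ū = 1}`), l.24010–24013 -/
  sph : Region → ℝ → Measure M.Pt
  /-- the term `∫_{(int)𝓜'} |∇_R̂ 𝔡^{≤k} Ř|² of `(int)ℜ_{k+1}²` (l.23950), derivative OUTSIDE the jets of named quantities: opaque (DV-16(f), DV-17) -/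
  rhatInt : ℕ → ℝ≥0∞
  -- definitional facts
  ext_eq : regionP .ext = 𝓜.region .ext
  cover : regionP .ext ∪ regionP .int ∪ regionP .top = 𝓜.region .ext ∪ 𝓜.region .int ∪ 𝓜.region .top
  uStar'_range : 𝓜.uStar - 2 ≤ uStar' ∧ uStar' ≤ 𝓜.uStar - 1
  /-- `(u, r)` of the outgoing PT frame coincide with those of the outgoing PG frame on `(ext)𝓜` (Remark l.23187–23189, Lemma `lemma:linkPGandTframeinMext`) -/
  u_eq : ∀ p ∈ 𝓜.region .ext, u p = 𝓜.u p
  r_eq : ∀ p ∈ 𝓜.region .ext, r .ext p = 𝓜.r .ext p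

namespace PTData

variable {𝓜 : GCMAdmissible c M} (𝓟 : 𝓜.PTData)

/-- square root in `ℝ≥0∞` (the norms below are typed as squares) [folklore] -/
def sqrt' (x : ℝ≥0∞) : ℝ≥0∞ := x ^ (1 / 2 : ℝ)

/-- weight `r^s` of the PT structure of region `i` [folklore] -/
def wR (i : Region) (s : ℝ) (p : M.Pt) : ℝ≥0∞ := ENNReal.ofReal (𝓟.r i p ^ s)

/-- `Σ j w_j |𝔡^{≤k} ψ_j|²` for a list of (symbol, real `r`-exponent) in the frame of region `i` [folklore] -/
def sqSum (i : Region) (L : List (Qty × ℝ)) (k : ℕ) (p : M.Pt) : ℝ≥0∞ :=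
  (L.map fun e => 𝓟.wR i e.2 p * (𝓟.frame i).jet e.1 k p ^ 2).sum

/-- the `Σ_*` Ricci list of `𝔖^*_k²` (l.23872–23875): `r²` on `X̂, tr X̌, Ž, tr X̲̌`; `r⁰` on `X̲̂, Ȟ, ω̲̌, Ξ̲, 𝒟̌cos θ, 𝒟r, e₃(cos θ)`; `r⁻²` on `ě₃(r)`;
`r²` on `𝒟⊗̂𝔍, 𝒟̄̌·𝔍, ∇̌₃𝔍` (`𝒟̌cos θ ↦ DJ0`, `𝒟r ↦ Dq`, `e₃(cos θ) ↦ e3J0`, DV-16(g)) [cite: KlainermanSzeftel2021, TeX l.23872–23875] -/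
def starList : List (Qty × ℝ) :=
  [(.Xh, 2), (.trXc, 2), (.Zc, 2), (.trXbc, 2), (.Xbh, 0), (.Hc, 0), (.ombc, 0), (.Xib, 0),
   (.DJ0, 0), (.Dq, 0), (.e3J0, 0), (.e3r, -2), (.DhJk, 2), (.DbJk, 2), (.n3Jk, 2)]

/-- `𝔖^*_k²` ([KS] Def. `definition:PT-normson-GacSi_*`, l.23869–23880); the last line `∫_{Σ_*}(|𝔡_*^{≤k}(b_*+1+2m/r)| + |𝔡_*^{≤k}(ν(r)+2)|)` is
NOT squared in the source (SRC-08) and is typed verbatim (power 1), in the `Σ_*` frame data. [cite: KlainermanSzeftel2021, TeX l.23869–23880] -/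
def SkStarSq (k : ℕ) : ℝ≥0∞ :=
  (∫⁻ p in 𝓜.SigmaStar, 𝓟.sqSum .ext starList k p ∂(𝓜.surf .SigmaStar))
  + ∫⁻ p in 𝓜.SigmaStar, 𝓟.frameSigmaStar.jet .bstar k p + 𝓟.frameSigmaStar.jet .nuR k p ∂(𝓜.surf .SigmaStar)

/-- `ℜ^*_k² = ∫_{Σ_*} r^{4+δ_B}(|𝔡^{≤k}A|² + |𝔡^{≤k}B|²) + r⁴|𝔡^{≤k}P̌|² + r²|𝔡^{≤k}B̲|² + |𝔡^{≤k}A̲|²` ([KS] Def. `definition:PT-normson-RcSi_*`, l.23883–23889). [cite: KlainermanSzeftel2021, TeX l.23883–23889] -/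
def RkStarSq (k : ℕ) : ℝ≥0∞ :=
  ∫⁻ p in 𝓜.SigmaStar, 𝓟.sqSum .ext [(.A, 4 + c.δB), (.B, 4 + c.δB), (.Pc, 4), (.Bb, 2), (.Ab, 0)] k p ∂(𝓜.surf .SigmaStar)

/-- `(ext)𝔖_k²` ([KS] l.23897–23903): three `sup_{λ ≥ r₀} ∫_{r=λ}` terms — `r²|(X̂, tr X̌, Ž)|² + r^{2−δ_B}|tr X̲̌|² + |(X̲̂, Ȟ, ω̲̌)|² + r^{−δ_B}|Ξ̲|²`;
`|𝒟̌cos θ|² + |𝒟r|² + |e₃(cos θ)|² + r⁻²|ě₃(r)|²`; `r²(|𝒟⊗̂𝔍|² + |𝒟̄̌·𝔍|² + |∇̌₃𝔍|²)`. [cite: KlainermanSzeftel2021, TeX l.23897–23903] -/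
def SkExtSq (k : ℕ) : ℝ≥0∞ :=
  (⨆ lam ∈ Set.Ici c.r₀, ∫⁻ p in {p ∈ 𝓟.regionP .ext | 𝓟.r .ext p = lam},
      𝓟.sqSum .ext [(.Xh, 2), (.trXc, 2), (.Zc, 2), (.trXbc, 2 - c.δB), (.Xbh, 0), (.Hc, 0), (.ombc, 0), (.Xib, -c.δB)] k p ∂(𝓟.cyl lam))
  + (⨆ lam ∈ Set.Ici c.r₀, ∫⁻ p in {p ∈ 𝓟.regionP .ext | 𝓟.r .ext p = lam},
      𝓟.sqSum .ext [(.DJ0, 0), (.Dq, 0), (.e3J0, 0), (.e3r, -2)] k p ∂(𝓟.cyl lam))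
  + ⨆ lam ∈ Set.Ici c.r₀, ∫⁻ p in {p ∈ 𝓟.regionP .ext | 𝓟.r .ext p = lam},
      𝓟.sqSum .ext [(.DhJk, 2), (.DbJk, 2), (.n3Jk, 2)] k p ∂(𝓟.cyl lam)

/-- `(ext)ℜ_k² = ∫_{(ext)𝓜} r^{3+δ_B}|𝔡^{≤k}(A, B)|² + r^{3−δ_B}(|𝔡^{≤k}P̌|² + r⁻²|𝔡^{≤k}B̲|² + r⁻⁴|𝔡^{≤k}A̲|²)` ([KS] l.23907–23912). [cite: KlainermanSzeftel2021, TeX l.23907–23912] -/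
def RkExtSq (k : ℕ) : ℝ≥0∞ :=
  ∫⁻ p in 𝓟.regionP .ext, 𝓟.sqSum .ext [(.A, 3 + c.δB), (.B, 3 + c.δB), (.Pc, 3 - c.δB), (.Bb, 1 - c.δB), (.Ab, -1 - c.δB)] k p ∂𝓟.vol

/-- `Γ̌` of the ingoing PT frames ([KS] Def. `definit:norms-SkMint'`, l.23928–23931):
`{tr X̲̌, X̲̂, Ž, Ȟ̲, 𝒟̌cos θ, ω̌, 𝒟r, 𝒟̌u, e₄(cos θ), ě₄(r), ě₄(ū), 𝒟̄̌·𝔍, 𝒟⊗̂𝔍, ∇̌₄𝔍, tr X̌, X̂, Ξ}` (`𝒟̌cos θ ↦ DJ0`, `𝒟r ↦ Dq`, `e₄(cos θ) ↦ e4J0`). [cite: KlainermanSzeftel2021, TeX l.23928–23931] -/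
def gammaCheckPT : List Qty :=
  [.trXbc, .Xbh, .Zc, .Hbc, .DJ0, .omc, .Dq, .Du, .e4J0, .e4r, .e4ub, .DbJk, .DhJk, .n4Jk, .trXc, .Xh, .Xi]

/-- `Ř = {A, B, P̌, B̲, A̲}` (l.23952) [cite: KlainermanSzeftel2021, TeX l.23952] -/
def rcList : List Qty := [.A, .B, .Pc, .Bb, .Ab]

/-- unweighted `Σ_{ψ ∈ L} |𝔡^{≤k}ψ|²` in the frame of region `i` [folklore] -/
def sqSum0 (i : Region) (L : List Qty) (k : ℕ) (p : M.Pt) : ℝ≥0∞ := (L.map fun ψ => (𝓟.frame i).jet ψ k p ^ 2).sum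

/-- `(int)𝔖_k² = ∫_{(int)𝓜'} |𝔡^{≤k} Γ̌|²` ([KS] l.23924–23927). [cite: KlainermanSzeftel2021, TeX l.23924–23927] -/
def SkIntSq (k : ℕ) : ℝ≥0∞ := ∫⁻ p in 𝓟.regionP .int, 𝓟.sqSum0 .int gammaCheckPT k p ∂𝓟.vol

/-- `(int)ℜ_k² = ∫_{(int)𝓜'} (|∇_R̂ 𝔡^{≤k−1}Ř|² + |𝔡^{≤k−1}Ř|²) + sup_τ ∫_{(int)𝓜' ∩ Σ(τ)} |𝔡^{≤k}Ř|²` ([KS] Def. `definit:norms-RkMint'`, l.23947–23953);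
the `R̂`-term is `rhatInt (k − 1)`; `sup_τ` over all real `τ`. [cite: KlainermanSzeftel2021, TeX l.23947–23953] -/
def RkIntSq (k : ℕ) : ℝ≥0∞ :=
  𝓟.rhatInt (k - 1) + (∫⁻ p in 𝓟.regionP .int, 𝓟.sqSum0 .int rcList (k - 1) p ∂𝓟.vol)
  + ⨆ τ₀ : ℝ, ∫⁻ p in {p ∈ 𝓟.regionP .int | 𝓟.τ p = τ₀}, 𝓟.sqSum0 .int rcList k p ∂(𝓟.slice τ₀)

/-- `(top)𝓜'(r ≤ r₀)`, `(top)𝓜'(r ≥ r₀)` and `(top)𝓜'_{r₀, ū₁} = (top)𝓜'(r ≥ r₀) ∩ {ū₁ ≤ ū ≤ ū₁ + 1}` (l.23963, l.23981–23983) [cite: KlainermanSzeftel2021, TeX l.23963] -/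
def topNear : Set M.Pt := {p ∈ 𝓟.regionP .top | 𝓟.r .top p ≤ c.r₀}
/-- `(top)𝓜'(r ≥ r₀)`. [cite: KlainermanSzeftel2021, PT norms on (top)M', TeX l.23960–23975] -/
def topFar : Set M.Pt := {p ∈ 𝓟.regionP .top | c.r₀ ≤ 𝓟.r .top p}
/-- the `ū`-slab `{ū₁ ≤ ū ≤ ū₁ + 1}` of `(top)𝓜'(r ≥ r₀)` entering `sup_{ū₁}` of the (top) PT norms. [cite: KlainermanSzeftel2021, PT norms on (top)M', TeX l.23960–23975] -/
def topSlab (ub₁ : ℝ) : Set M.Pt := {p ∈ 𝓟.topFar | ub₁ ≤ 𝓟.ubar p ∧ 𝓟.ubar p ≤ ub₁ + 1}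

/-- `((top)𝔖^{≥r₀}_k)²` ([KS] (definit:norms-SkMtop'>r_0), l.23970–23978): `sup_{ū₁ ≥ u_*'} ∫_{(top)𝓜'_{r₀,ū₁}}` of
`r²|(Ξ, ω̌, X̂, tr X̌, Ž, Ȟ̲)|² + r^{2−δ_B}|tr X̲̌| [sic, power 1: SRC-08] + |X̲̂|²`; `|𝒟̌cos θ|² + |𝒟r|²`; `r⁴|e₄(cos θ)|² + r⁴|ě₄(r)|²`;
`r²(|𝒟⊗̂𝔍|² + |𝒟̄̌·𝔍|²) + r⁶|∇̌₄𝔍|²` — four sups, typed verbatim. [cite: KlainermanSzeftel2021, TeX l.23970–23978] -/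
def SkTopFarSq (k : ℕ) : ℝ≥0∞ :=
  (⨆ ub₁ ∈ Set.Ici 𝓟.uStar', ∫⁻ p in 𝓟.topSlab ub₁,
      𝓟.sqSum .top [(.Xi, 2), (.omc, 2), (.Xh, 2), (.trXc, 2), (.Zc, 2), (.Hbc, 2), (.Xbh, 0)] k p
        + 𝓟.wR .top (2 - c.δB) p * (𝓟.frame .top).jet .trXbc k p ∂𝓟.vol)
  + (⨆ ub₁ ∈ Set.Ici 𝓟.uStar', ∫⁻ p in 𝓟.topSlab ub₁, 𝓟.sqSum .top [(.DJ0, 0), (.Dq, 0)] k p ∂𝓟.vol)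
  + (⨆ ub₁ ∈ Set.Ici 𝓟.uStar', ∫⁻ p in 𝓟.topSlab ub₁, 𝓟.sqSum .top [(.e4J0, 4), (.e4r, 4)] k p ∂𝓟.vol)
  + ⨆ ub₁ ∈ Set.Ici 𝓟.uStar', ∫⁻ p in 𝓟.topSlab ub₁, 𝓟.sqSum .top [(.DhJk, 2), (.DbJk, 2), (.n4Jk, 6)] k p ∂𝓟.vol

/-- `(top)𝔖_k² = ∫_{(top)𝓜'(r ≤ r₀)} |𝔡^{≤k}Γ̌|² + ((top)𝔖^{≥r₀}_k)²` ([KS] (definit:norms-SkMtop'), l.23965–23967). [cite: KlainermanSzeftel2021, TeX l.23965–23967] -/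
def SkTopSq (k : ℕ) : ℝ≥0∞ := (∫⁻ p in 𝓟.topNear, 𝓟.sqSum0 .top gammaCheckPT k p ∂𝓟.vol) + 𝓟.SkTopFarSq k

/-- `(top)ℜ_k² = ∫_{(top)𝓜(r ≥ r₀)} (r^{3+δ_B}|𝔡^{≤k}(A,B)|² + r^{3−δ_B}|𝔡^{≤k}P̌|²) + sup_{ū₁ ≥ u_*'} ∫_{(top)𝓜_{r₀,ū₁}} (r²|𝔡^{≤k}B̲|² + |𝔡^{≤k}A̲|²)
 + sup_τ ∫_{(top)𝓜'(r ≤ r₀) ∩ Σ(τ)} |𝔡^{≤k}Ř|²` ([KS] (definit:norms-RkMtop'), l.23991–23997). [cite: KlainermanSzeftel2021, TeX l.23991–23997] -/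
def RkTopSq (k : ℕ) : ℝ≥0∞ :=
  (∫⁻ p in 𝓟.topFar, 𝓟.sqSum .top [(.A, 3 + c.δB), (.B, 3 + c.δB), (.Pc, 3 - c.δB)] k p ∂𝓟.vol)
  + (⨆ ub₁ ∈ Set.Ici 𝓟.uStar', ∫⁻ p in 𝓟.topSlab ub₁, 𝓟.sqSum .top [(.Bb, 2), (.Ab, 0)] k p ∂𝓟.vol)
  + ⨆ τ₀ : ℝ, ∫⁻ p in {p ∈ 𝓟.topNear | 𝓟.τ p = τ₀}, 𝓟.sqSum0 .top rcList k p ∂(𝓟.slice τ₀)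

/-- the global PT norms `𝔖_k = 𝔖^*_k + (ext)𝔖_k + (int)𝔖_k + (top)𝔖_k`, `ℜ_k = ℜ^*_k + (ext)ℜ_k + (int)ℜ_k + (top)ℜ_k` ([KS] l.24001–24006), as sums of
the square roots of the typed squares. [cite: KlainermanSzeftel2021, TeX l.24001–24006] -/
def Sk (k : ℕ) : ℝ≥0∞ := sqrt' (𝓟.SkStarSq k) + sqrt' (𝓟.SkExtSq k) + sqrt' (𝓟.SkIntSq k) + sqrt' (𝓟.SkTopSq k)
/-- `ℜ_k := (ℜ^*_k²)^{1/2} + ((ext)ℜ_k²)^{1/2} + ((int)ℜ_k²)^{1/2} + ((top)ℜ_k²)^{1/2}` (PT curvature norm). [cite: KlainermanSzeftel2021, combined PT norms, TeX l.24001–24006] -/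
def Rk (k : ℕ) : ℝ≥0∞ := sqrt' (𝓟.RkStarSq k) + sqrt' (𝓟.RkExtSq k) + sqrt' (𝓟.RkIntSq k) + sqrt' (𝓟.RkTopSq k)

/-- `𝓑₁ = {u = 1}`, `𝓑̲₁ = {ū = 1}` for the PT functions `u, ū` ([KS] l.24010–24013) [cite: KlainermanSzeftel2021, TeX l.24010–24013] -/
def B1 : Set M.Pt := {p ∈ 𝓟.regionP .ext | 𝓟.u p = 1}
/-- `𝓑̲₁ := (int)𝓜' ∩ {ū = 1}` (initial PT hypersurface of the interior). [cite: KlainermanSzeftel2021, PT initial norms, TeX l.24010–24040] -/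
def B1bar : Set M.Pt := {p ∈ 𝓟.regionP .int | 𝓟.ubar p = 1}

/-- `‖𝔡^{≤k} ψ‖_{L²(S)}` on the sphere `S = H ∩ {r = s}` of `𝓑₁` (`i = .ext`, `H = 𝓑₁`) or `𝓑̲₁` (`i = .int`), PT frame of region `i` [folklore] -/
def sphL2 (i : Region) (H : Set M.Pt) (s : ℝ) (ψ : Qty) (k : ℕ) : ℝ≥0∞ :=
  sqrt' (∫⁻ p in {p ∈ H | 𝓟.r i p = s}, (𝓟.frame i).jet ψ k p ^ 2 ∂(𝓟.sph i s))

/-- `(ext)ℑ^{PT}_k = sup_{S ⊂ 𝓑₁} r^{5/2+δ_B}(‖𝔡^k A‖_{L²(S)} + ‖𝔡^k B‖_{L²(S)}) + sup_{S ⊂ 𝓑₁} (r²‖𝔡^k P̌‖ + r‖𝔡^k B̲‖ + ‖𝔡^k A̲‖)` ([KS] l.24022–24025),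
outgoing PT frame of `(ext)𝓜`; the spheres are the `r`-leaves `{r = s}` of `𝓑₁`, `s` ranging over `ℝ` (empty leaves contribute `0`); `𝔡^k` read cumulatively (DV-09). [cite: KlainermanSzeftel2021, TeX l.24022–24025] -/
def IkPTExt (k : ℕ) : ℝ≥0∞ :=
  (⨆ s : ℝ, ENNReal.ofReal (s ^ (5 / 2 + c.δB)) * (𝓟.sphL2 .ext 𝓟.B1 s .A k + 𝓟.sphL2 .ext 𝓟.B1 s .B k))
  + ⨆ s : ℝ, ENNReal.ofReal (s ^ (2 : ℝ)) * 𝓟.sphL2 .ext 𝓟.B1 s .Pc k + ENNReal.ofReal s * 𝓟.sphL2 .ext 𝓟.B1 s .Bb k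
      + 𝓟.sphL2 .ext 𝓟.B1 s .Ab k

/-- `(int)ℑ^{PT}_k = sup_{S ⊂ 𝓑̲₁} (‖𝔡^k A‖ + ‖𝔡^k B‖) + sup_{S ⊂ 𝓑̲₁} (‖𝔡^k P̌‖ + r‖𝔡^k B̲‖ + ‖𝔡^k A̲‖)` ([KS] l.24026–24028), ingoing PT frame of `(int)𝓜'`. [cite: KlainermanSzeftel2021, TeX l.24026–24028] -/
def IkPTInt (k : ℕ) : ℝ≥0∞ :=
  (⨆ s : ℝ, 𝓟.sphL2 .int 𝓟.B1bar s .A k + 𝓟.sphL2 .int 𝓟.B1bar s .B k)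
  + ⨆ s : ℝ, 𝓟.sphL2 .int 𝓟.B1bar s .Pc k + ENNReal.ofReal s * 𝓟.sphL2 .int 𝓟.B1bar s .Bb k + 𝓟.sphL2 .int 𝓟.B1bar s .Ab k

/-- `ℑ^{PT}_k = (ext)ℑ^{PT}_k + (int)ℑ^{PT}_k` ([KS] l.24033–24035) [cite: KlainermanSzeftel2021, TeX l.24033–24035] -/
def IkPT (k : ℕ) : ℝ≥0∞ := 𝓟.IkPTExt k + 𝓟.IkPTInt k

/-- `L_*(k)² = ∫_{{u=u_*'}} |Ř|²_{w,k} + ∫_{Σ_* ∩ {u=u_*'}} |Γ̌|²_{w,k}`, `|Ř|²_{w,k} = r^{3+δ_B}|𝔡_*^{≤k}(A,B)|² + r^{3−δ_B}|𝔡_*^{≤k}P̌|² + r^{1−δ_B}|𝔡_*^{≤k}B̲|²`,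
`|Γ̌|²_{w,k} = r²|𝔡̸^{≤k}Γ_g|² + |𝔡̸^{≤k}Γ_b|²` ([KS] (eq:defintionofLstarofk:chap9), l.24450–24458); tangential derivatives `𝔡_*`, `𝔡̸` are read as jets
(schematic over-count, DV-17(c)); `Γ_g, Γ_b` = the outgoing tables of §4 (the frame on `Σ_*`/`(ext)𝓜` is outgoing-normalized). [cite: KlainermanSzeftel2021, TeX l.24450–24458] -/
def LStarSq (k : ℕ) : ℝ≥0∞ :=
  (∫⁻ p in {p ∈ 𝓟.regionP .ext | 𝓟.u p = 𝓟.uStar'},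
      𝓟.sqSum .ext [(.A, 3 + c.δB), (.B, 3 + c.δB), (.Pc, 3 - c.δB), (.Bb, 1 - c.δB)] k p ∂𝓟.surfU)
  + ∫⁻ p in {p ∈ 𝓜.SigmaStar | 𝓟.u p = 𝓟.uStar'},
      𝓟.wR .ext 2 p * (𝓟.frame .ext).size Table.ΓgOut (𝓟.r .ext) k p ^ 2
        + ((𝓟.frame .ext).size Table.ΓbOut (𝓟.r .ext) k p + (𝓟.frame .ext).sizeInv Table.ΓbOutInv (𝓟.r .ext) k p) ^ 2 ∂𝓟.surfU

/-- **BA-PT** ([KS] (9.4.32) / (eq:bootstrapassumptiondiscussionThM8), l.24443–24445): `𝔖_{k_large+7} + ℜ_{k_large+7} ≤ ε`. [cite: KlainermanSzeftel2021, TeX l.24443–24445] -/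
def BAPT (𝓟 : 𝓜.PTData) : Prop := 𝓟.Sk (c.kLarge + 7) + 𝓟.Rk (c.kLarge + 7) ≤ ENNReal.ofReal c.ε

/-- the conclusion of the **Main PT-Theorem** ([KS] Thm `theorem:Main-PT`, l.24018–24030) with an explicit constant `C`:
`𝔖_k + ℜ_k ≤ C ε₀` for all `k ≤ k_large + 7`. [cite: KlainermanSzeftel2021, TeX l.24018–24030] -/
def MainPTConcl (C : ℝ) : Prop := ∀ k ≤ c.kLarge + 7, 𝓟.Sk k + 𝓟.Rk k ≤ ENNReal.ofReal (C * c.ε₀)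

/-- the exterior initial PT norm is dominated by the total one. [folklore] -/
theorem IkPTExt_le_IkPT (k : ℕ) : 𝓟.IkPTExt k ≤ 𝓟.IkPT k := le_self_add
/-- the interior initial PT norm is dominated by the total one. [folklore] -/
theorem IkPTInt_le_IkPT (k : ℕ) : 𝓟.IkPTInt k ≤ 𝓟.IkPT k := le_add_self

/-- `(ext)ℜ_k² ≤ ...`: each regional square is dominated by the corresponding summand of the global norm, e.g. `((ext)ℜ_k²)^{1/2} ≤ ℜ_k`. [folklore] -/
theorem sqrt_RkExtSq_le_Rk (k : ℕ) : sqrt' (𝓟.RkExtSq k) ≤ 𝓟.Rk k := by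
  unfold Rk
  calc sqrt' (𝓟.RkExtSq k) ≤ sqrt' (𝓟.RkStarSq k) + sqrt' (𝓟.RkExtSq k) := le_add_self
    _ ≤ sqrt' (𝓟.RkStarSq k) + sqrt' (𝓟.RkExtSq k) + sqrt' (𝓟.RkIntSq k) := le_self_add
    _ ≤ _ := le_self_add

/-- `((ext)𝔖_k²)^{1/2} ≤ 𝔖_k`. [folklore] -/
theorem sqrt_SkExtSq_le_Sk (k : ℕ) : sqrt' (𝓟.SkExtSq k) ≤ 𝓟.Sk k := by
  unfold Sk
  calc sqrt' (𝓟.SkExtSq k) ≤ sqrt' (𝓟.SkStarSq k) + sqrt' (𝓟.SkExtSq k) := le_add_self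
    _ ≤ sqrt' (𝓟.SkStarSq k) + sqrt' (𝓟.SkExtSq k) + sqrt' (𝓟.SkIntSq k) := le_self_add
    _ ≤ _ := le_self_add

/-- the Main PT conclusion is monotone in the constant [folklore] -/
theorem MainPTConcl.mono {𝓟 : 𝓜.PTData} {C C' : ℝ} (hC : C ≤ C') (hε : 0 ≤ c.ε₀) (h : 𝓟.MainPTConcl C) :
    𝓟.MainPTConcl C' := fun k hk =>
  (h k hk).trans (ENNReal.ofReal_le_ofReal (mul_le_mul_of_nonneg_right hC hε))

end PTData

end GCMAdmissible

/-! ### §16. The GCM procedure vocabulary of [KS] §8.1 (= the setting of GCM1 arXiv:1911.00697, GCM2 arXiv:1912.12195, Shen arXiv:2205.12336), TeX l.17800–18230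

Background vacuum regions `𝓡` with an outgoing geodesic `(u, s)`-foliation by spheres `S(u, s)` (l.17811–17880), the REAL Schwarzschild-normalized
Ricci/curvature scalars and their sets `Γ_g, Γ_b` (GCM1 Def., l.17826–17840), assumptions **A1**, **A2** (l.17884–17895; **A3**, **A4** are chart / basis
conditions kept as opaque `Prop` fields, DV-18), the `ℓ = 1` modes of a scalar function (Def. `Definition:ell=1modesofascalarfunction`, l.3997–4006, with
the `r⁻²` normalization, footnote l.18129), deformations `Ψ : S̊ → 𝐒` generated by `(U, S)` (Def. `definition:Deformations`, l.17951–17958), the `𝔥_k(S)`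
norms (l.10051), GCM spheres ((def:GCMC2) l.18161–18173), the hypotheses (8.1.x) = (eq:thedecomposition…) l.18136–18150 and (Assumptions:theorem-ExistenceGCMS2)
l.18157–18159, and the conclusion bounds 1–4 of Thm `theorem:ExistenceGCMS2` (= GCM2 Thm 7.3, l.18153–18200) with an explicit constant. -/

/-- The REAL scalar vocabulary of an `(u, s)`-foliated background / an adapted sphere frame ([KS] l.17824–17840; GCM quantities l.18136–18173). [cite: KlainermanSzeftel2021, TeX l.17824–17840] -/
inductive SQty
  /-- `tr χ`, `tr χ̲`, `μ` (un-normalized scalars, entering the GCM conditions exactly) -/ | trch | trchb | mu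
  /-- `Γ_g`: `tr χ̌ = tr χ − 2/r`, `χ̂`, `ζ`, `tr χ̲̌ = tr χ̲ + 2Υ/r`, `μ̌ = μ − 2m/r³`, `ρ̌ = ρ + 2m/r³`, `*ρ`, `β`, `α`, `Ǩ = K − 1/r²`, `e₄(r) − 1`, `e₄(m)` -/
  | trchc | chih | ze | trchbc | muc | rhoc | drho | beta | al | Kc | e4r1 | e4m
  /-- `Γ_b`: `η`, `χ̲̂`, `ω̲̌ = ω̲ − m/r²`, `ξ̲`, `β̲`, `α̲`, `Ω̲̌ = Ω̲ + Υ` (`Ω̲ = e₃(s)`), `ς̌ = ς − 1`, `e₃(r) + Υ`, `e₃(m)` -/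
  | eta | chibh | ombc | xib | bb | aa | Ombc | vsic | e3rU | e3m
  /-- `div β`, `curl β`, `div η`, `div ξ̲` (GCM mode conditions) -/ | divbeta | curlbeta | diveta | divxib
  /-- the remainders `κ̇, κ̲̇, μ̇` of (8.1.x) ([KS] l.18136–18150) -/ | kadot | kabdot | mudot
  deriving DecidableEq, Repr

/-- a weighted table of real symbols: `(ψ, z)` stands for `r^z ψ` (integer weights: `r μ̌`, `r⁻¹ Ω̲̌`, …) [folklore] -/
abbrev STable := List (SQty × ℤ)

namespace STable
/-- `Γ_g` of the background foliation ([KS] (definition:Ga_gGa_b:backgroundfoliationGCM), l.17835–17837) [cite: KlainermanSzeftel2021, TeX l.17835–17837] -/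
def Γg : STable :=
  [(.trchc, 0), (.chih, 0), (.ze, 0), (.trchbc, 0), (.muc, 1), (.rhoc, 1), (.drho, 1), (.beta, 1), (.al, 1), (.Kc, 1), (.e4r1, -1), (.e4m, -1)]
/-- `Γ_b` (l.17838–17839) [cite: KlainermanSzeftel2021, TeX l.17838–17839] -/
def Γb : STable :=
  [(.eta, 0), (.chibh, 0), (.ombc, 0), (.xib, 0), (.bb, 1), (.aa, 0), (.Ombc, -1), (.vsic, -1), (.e3rU, -1), (.e3m, -1)]
end STable

/-- Real frame data on (a family of) spheres: values of the scalar symbols and jet sizes `|𝔡^{≤k} ψ|` of all symbols. [folklore] -/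
structure SFrame (Pt : Type) where
  val : SQty → Pt → ℝ
  jet : SQty → ℕ → Pt → ℝ≥0∞
  jet_mono : ∀ ψ p, Monotone fun k => jet ψ k p
  /-- for scalar symbols the order-0 jet is the absolute value -/
  jet_zero : ∀ ψ p, jet ψ 0 p = ENNReal.ofReal |val ψ p|

namespace SFrame
variable {Pt : Type} (F : SFrame Pt)
/-- `sup_{(ψ,z) ∈ T} r^z |𝔡^{≤k} ψ|(p)` [folklore] -/
def size (T : STable) (r : Pt → ℝ) (k : ℕ) (p : Pt) : ℝ≥0∞ := ⨆ e ∈ T, ENNReal.ofReal (r p ^ (e.2 : ℤ)) * F.jet e.1 k p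
end SFrame

/-- **A background spacetime region `𝓡 = 𝓡(ů, s̊, ε̊)` of the GCM procedure** ([KS] §8.1.1, l.17811–17930). [cite: KlainermanSzeftel2021, TeX l.17811–17930] -/
structure GCMBackground (M : Spacetime) where
  /-- `𝓡 ⊆ {|u − ů| ≤ ε̊, |s − s̊| ≤ ε̊}` (l.17878–17881) -/
  R : Set M.Pt
  u : M.Pt → ℝ
  s : M.Pt → ℝ
  ug : ℝ
  sg : ℝ
  /-- `ε̊ > 0` (`\epg`), `δ̊ > 0` (`\dg`), `s_max`, and the mass constant `m₀` of **A2** -/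
  epg : ℝ
  dg : ℝ
  smax : ℕ
  m₀ : ℝ
  /-- area radius `r = r(u, s)` and Hawking mass `m = m(u, s)` of `S(u, s)`, as functions on `𝓡` constant on spheres; `r̊, m̊` those of `S̊ = S(ů, s̊)` -/
  r : M.Pt → ℝ
  mH : M.Pt → ℝ
  rg : ℝ
  mg : ℝ
  /-- the background frame (real scalars + jets), the family `J⁽ᵖ⁾ : 𝓡 → ℝ` of **A4**, area measures of the spheres `S(u, s)` -/
  frame : SFrame M.Pt
  J : JIdx → M.Pt → ℝ
  sph : ℝ → ℝ → Measure M.Pt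
  /-- **A3** (coordinate-chart metric bounds, l.17896–17912) and **A4** (almost-spherical-harmonics + extension of `J⁽ᵖ⁾`, l.17915–17928): charts are not
  modelled — opaque (DV-18(b)) -/
  A3 : Prop
  A4 : Prop
  -- definitional facts
  R_sub : ∀ p ∈ R, |u p - ug| ≤ epg ∧ |s p - sg| ≤ epg
  r_sph : ∀ p ∈ R, ∀ q ∈ R, u p = u q → s p = s q → r p = r q
  mH_sph : ∀ p ∈ R, ∀ q ∈ R, u p = u q → s p = s q → mH p = mH q
  rg_spec : ∀ p ∈ R, u p = ug → s p = sg → r p = rg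
  mg_spec : ∀ p ∈ R, u p = ug → s p = sg → mH p = mg
  epg_pos : 0 < epg
  dg_pos : 0 < dg
  rg_pos : 0 < rg

namespace GCMBackground

variable {M : Spacetime} (B : GCMBackground M)

/-- the sphere `S(u₀, s₀)` and the base sphere `S̊ = S(ů, s̊)` [folklore] -/
def S (u₀ s₀ : ℝ) : Set M.Pt := {p ∈ B.R | B.u p = u₀ ∧ B.s p = s₀}
/-- the base sphere `S̊ = S(ů, s̊)` of the background foliation. [cite: KlainermanSzeftel2021, §8.1.1 item 3, TeX l.17843–17845] -/
def S0 : Set M.Pt := B.S B.ug B.sg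

/-- `∫_{S(u₀,s₀)} f` [folklore] -/
def sphInt (u₀ s₀ : ℝ) (f : M.Pt → ℝ) : ℝ := ∫ p in B.S u₀ s₀, f p ∂(B.sph u₀ s₀)

/-- the `ℓ = 1` modes `(f)_{ℓ=1,j} = r⁻² ∫_{S} f J⁽ʲ⁾` on `S = S(u₀, s₀)` with area radius `r₀` ([KS] l.3997–4006; footnote l.18129) [cite: KlainermanSzeftel2021, TeX l.3997–4006] -/
def mode (u₀ s₀ r₀ : ℝ) (f : M.Pt → ℝ) (j : JIdx) : ℝ := r₀⁻¹ ^ 2 * B.sphInt u₀ s₀ (fun p => f p * B.J j p)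

/-- **A1** ([KS] l.17884–17888): `‖Γ_g‖_{k,∞} ≤ ε̊ r⁻²`, `‖Γ_b‖_{k,∞} ≤ ε̊ r⁻¹` on `𝓡` for `k ≤ s_max` [cite: KlainermanSzeftel2021, TeX l.17884–17888] -/
def A1 (B : GCMBackground M) : Prop :=
  ∀ k ≤ B.smax, ∀ p ∈ B.R,
    B.frame.size STable.Γg B.r k p ≤ ENNReal.ofReal (B.epg * (B.r p)⁻¹ ^ 2) ∧
    B.frame.size STable.Γb B.r k p ≤ ENNReal.ofReal (B.epg * (B.r p)⁻¹)

/-- **A2** ([KS] l.17891–17894): `sup_𝓡 |m/m₀ − 1| ≤ ε̊` [cite: KlainermanSzeftel2021, TeX l.17891–17894] -/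
def A2 (B : GCMBackground M) : Prop := ∀ p ∈ B.R, |B.mH p / B.m₀ - 1| ≤ B.epg

/-- hypotheses (8.1.x) of Thm 8.1.7 ([KS] (eq:thedecompositionofkakabandmu…) l.18136–18150) with explicit constant `C`: `κ = 2/r + κ̇`,
`κ̲ = −2Υ/r + C̲₀(u,s) + Σ_p C̲_p(u,s) J⁽ᵖ⁾ + κ̲̇`, `μ = 2m/r³ + M₀(u,s) + Σ_p M_p(u,s) J⁽ᵖ⁾ + μ̇`, `sup_𝓡 |𝔡^{≤s_max}(κ̇, κ̲̇)| ≤ C r⁻² δ̊`, `sup_𝓡 |𝔡^{≤s_max} μ̇| ≤ C r⁻³ δ̊`;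
`Υ = 1 − 2m/r` with the Hawking mass `m(u, s)` (l.17831). [cite: KlainermanSzeftel2021, TeX l.18136–18150] -/
def Hyp81x (C : ℝ) : Prop :=
  ∃ Cb₀ M₀ : ℝ → ℝ → ℝ, ∃ Cb Mm : JIdx → ℝ → ℝ → ℝ,
    (∀ p ∈ B.R, B.frame.val .trch p = 2 / B.r p + B.frame.val .kadot p) ∧
    (∀ p ∈ B.R, B.frame.val .trchb p = -2 * (1 - 2 * B.mH p / B.r p) / B.r p + Cb₀ (B.u p) (B.s p)
        + (Cb .zero (B.u p) (B.s p) * B.J .zero p + Cb .plus (B.u p) (B.s p) * B.J .plus p + Cb .minus (B.u p) (B.s p) * B.J .minus p)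
        + B.frame.val .kabdot p) ∧
    (∀ p ∈ B.R, B.frame.val .mu p = 2 * B.mH p / B.r p ^ 3 + M₀ (B.u p) (B.s p)
        + (Mm .zero (B.u p) (B.s p) * B.J .zero p + Mm .plus (B.u p) (B.s p) * B.J .plus p + Mm .minus (B.u p) (B.s p) * B.J .minus p)
        + B.frame.val .mudot p) ∧
    (∀ p ∈ B.R, B.frame.jet .kadot B.smax p ≤ ENNReal.ofReal (C * (B.r p)⁻¹ ^ 2 * B.dg) ∧
        B.frame.jet .kabdot B.smax p ≤ ENNReal.ofReal (C * (B.r p)⁻¹ ^ 2 * B.dg) ∧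
        B.frame.jet .mudot B.smax p ≤ ENNReal.ofReal (C * (B.r p)⁻¹ ^ 3 * B.dg))

/-- the mode hypotheses (Assumptions:theorem-ExistenceGCMS2) ([KS] l.18157–18159), relative to the `ℓ = 1` modes of the background foliation, with explicit
constant: `(div β)_{ℓ=1} = O(δ̊ r⁻⁵)`, `(tr χ̌)_{ℓ=1} = O(δ̊ r⁻³)`, `(tr χ̲̌)_{ℓ=1} = O(δ̊ r⁻³)` on every sphere `S(u, s) ⊆ 𝓡`. [cite: KlainermanSzeftel2021, TeX l.18157–18159] -/
def HypModes (C : ℝ) : Prop :=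
  ∀ p ∈ B.R, ∀ j,
    |B.mode (B.u p) (B.s p) (B.r p) (B.frame.val .divbeta) j| ≤ C * B.dg * (B.r p)⁻¹ ^ 5 ∧
    |B.mode (B.u p) (B.s p) (B.r p) (B.frame.val .trchc) j| ≤ C * B.dg * (B.r p)⁻¹ ^ 3 ∧
    |B.mode (B.u p) (B.s p) (B.r p) (B.frame.val .trchbc) j| ≤ C * B.dg * (B.r p)⁻¹ ^ 3

end GCMBackground

/-- **A deformation `Ψ : S̊ → 𝐒` generated by `(U, S)`** ([KS] Def. `definition:Deformations`, l.17951–17958) together with the deformed sphere's data: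
its `𝐒`-adapted frame (Def. l.17962–17966; the well-defined coefficients, footnote l.18190), area measure, area radius `r^𝐒`, Hawking mass `m^𝐒`, a canonical
`ℓ = 1` basis `J^{(p,𝐒)}` calibrated by `Ψ` (calibration not modelled), and the jets of `(U, S)` on `S̊` for the `𝔥_k(S̊)` norms (l.10051). [cite: KlainermanSzeftel2021, TeX l.17951–17958] -/
structure Deformation {M : Spacetime} (B : GCMBackground M) where
  carrier : Set M.Pt
  U : M.Pt → ℝ
  S : M.Pt → ℝ
  /-- `|𝔡̸^{≤k}(U, S)|` on `S̊` -/
  jetUS : ℕ → M.Pt → ℝ≥0∞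
  area : Measure M.Pt
  rS : ℝ
  mS : ℝ
  frame : SFrame M.Pt
  J : JIdx → M.Pt → ℝ
  sub : carrier ⊆ B.R
  /-- `Ψ(ů, s̊, y) = (ů + U(y), s̊ + S(y), y)`: every point of `𝐒` has `(u, s) = (ů + U(q), s̊ + S(q))` for some `q ∈ S̊` (chart identity not modelled) -/
  graph : ∀ p ∈ carrier, ∃ q ∈ B.S0, B.u p = B.ug + U q ∧ B.s p = B.sg + S q
  rS_pos : 0 < rS
  jetUS_mono : ∀ p, Monotone fun k => jetUS k p

namespace Deformation

variable {M : Spacetime} {B : GCMBackground M} (D : Deformation B)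

/-- `∫_𝐒 f` [folklore] -/
def sInt (f : M.Pt → ℝ) : ℝ := ∫ p in D.carrier, f p ∂D.area

/-- `‖(U, S)‖_{𝔥_k(S̊)} = (Σ_{j≤k} ‖𝔡̸^j(U,S)‖²_{L²(S̊)})^{1/2}`, cumulative-jet reading ([KS] l.10051; DV-09) [cite: KlainermanSzeftel2021, TeX l.10051] -/
def hNormUS (k : ℕ) : ℝ≥0∞ := (∫⁻ p in B.S0, D.jetUS k p ^ 2 ∂(B.sph B.ug B.sg)) ^ (1 / 2 : ℝ)

/-- `‖Γ^𝐒‖_{𝔥_k(𝐒)}` for a weighted real table, area radius `r^𝐒` as the weight [folklore] -/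
def hNorm (T : STable) (k : ℕ) : ℝ≥0∞ := (∫⁻ p in D.carrier, D.frame.size T (fun _ => D.rS) k p ^ 2 ∂D.area) ^ (1 / 2 : ℝ)

/-- **`𝐒` is a GCM sphere** ([KS] (def:GCMC2)–(def:GCMC2-b), l.18161–18173 = GCM2 (7.3)): `κ^𝐒 = 2/r^𝐒`, `κ̲^𝐒 = −2Υ^𝐒/r^𝐒` (`Υ^𝐒 = 1 − 2m^𝐒/r^𝐒`),
`μ^𝐒 = 2m^𝐒/(r^𝐒)³ + Σ_p M^𝐒_p J^{(p,𝐒)}` for some constants `M^𝐒_p`, and `∫_𝐒 div^𝐒 β^𝐒 J^{(p,𝐒)} = 0`, `p ∈ {0, +, −}`. [cite: KlainermanSzeftel2021, TeX l.18161–18173] -/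
def IsGCMSphere (D : Deformation B) : Prop :=
  (∀ p ∈ D.carrier, D.frame.val .trch p = 2 / D.rS) ∧
  (∀ p ∈ D.carrier, D.frame.val .trchb p = -2 * (1 - 2 * D.mS / D.rS) / D.rS) ∧
  (∃ Mc : JIdx → ℝ, ∀ p ∈ D.carrier,
      D.frame.val .mu p = 2 * D.mS / D.rS ^ 3 + (Mc .zero * D.J .zero p + Mc .plus * D.J .plus p + Mc .minus * D.J .minus p)) ∧
  (∀ j, D.sInt (fun p => D.frame.val .divbeta p * D.J j p) = 0)

/-- the conclusion bounds 1–4 of [KS] Thm 8.1.7 (l.18175–18199) with explicit constant `C` (the source's `≲`; `r` there read as `r̊`):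
`|r^𝐒/r̊ − 1| ≤ C r̊⁻¹ δ̊`, `‖(U,S)‖_{𝔥_{s_max+1}(S̊)} ≤ C r̊ δ̊`, `|m^𝐒 − m̊| ≤ C δ̊`, `‖Γ^𝐒_g‖_{𝔥_{s_max}(𝐒)} ≤ C ε̊ r̊⁻¹`, `‖Γ^𝐒_b‖_{𝔥_{s_max}(𝐒)} ≤ C ε̊`. [cite: KlainermanSzeftel2021, TeX l.18175–18199] -/
def GCMSBounds (C : ℝ) : Prop :=
  |D.rS / B.rg - 1| ≤ C * B.rg⁻¹ * B.dg ∧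
  D.hNormUS (B.smax + 1) ≤ ENNReal.ofReal (C * B.rg * B.dg) ∧
  |D.mS - B.mg| ≤ C * B.dg ∧
  D.hNorm STable.Γg B.smax ≤ ENNReal.ofReal (C * B.epg * B.rg⁻¹) ∧
  D.hNorm STable.Γb B.smax ≤ ENNReal.ofReal (C * B.epg)

/-- the SHAPE of [KS] Thm 8.1.7 = GCM2 Thm 7.3 (existence of intrinsic GCM spheres) over this vocabulary, hypotheses constant `C₁`, conclusion constant `C₂`
(**A1-Strong**, **A4-Strong** are not distinguished from **A1**, **A4** here: DV-18(c)). A node that CITES GCM2 Thm 7.3 instantiates this predicate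
([KS] l.18153–18200). [cite: KlainermanSzeftel2021, TeX l.18153–18200] -/
def GCMSExistenceShape (B : GCMBackground M) (C₁ C₂ : ℝ) : Prop :=
  B.A1 → B.A2 → B.A3 → B.A4 → B.Hyp81x C₁ → B.HypModes C₁ → ∃ D : Deformation B, D.IsGCMSphere ∧ D.GCMSBounds C₂

/-- the conclusion bounds of KS Thm 8.1.7 are monotone in the constant. [folklore] -/
theorem GCMSBounds.mono {D : Deformation B} {C C' : ℝ} (hC : C ≤ C') (h : D.GCMSBounds C) : D.GCMSBounds C' := by
  obtain ⟨h1, h2, h3, h4, h5⟩ := h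
  have hdg : 0 ≤ B.dg := le_of_lt B.dg_pos
  have hepg : 0 ≤ B.epg := le_of_lt B.epg_pos
  have hrg : 0 ≤ B.rg⁻¹ := inv_nonneg.2 (le_of_lt B.rg_pos)
  refine ⟨h1.trans ?_, h2.trans (ENNReal.ofReal_le_ofReal ?_), h3.trans ?_, h4.trans (ENNReal.ofReal_le_ofReal ?_),
    h5.trans (ENNReal.ofReal_le_ofReal ?_)⟩
  · exact mul_le_mul_of_nonneg_right (mul_le_mul_of_nonneg_right hC hrg) hdg
  · exact mul_le_mul_of_nonneg_right (mul_le_mul_of_nonneg_right hC (le_of_lt B.rg_pos)) hdg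
  · exact mul_le_mul_of_nonneg_right hC hdg
  · exact mul_le_mul_of_nonneg_right (mul_le_mul_of_nonneg_right hC hepg) hrg
  · exact mul_le_mul_of_nonneg_right hC hepg

end Deformation

end Literature.Geometry.Lorentzian.KlainermanSzeftel2021.Setup
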